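import Mathlib
import Literature.NumberTheory.MahlerMeasure.MinimalMeasuresByDegree
import Literature.NumberTheory.MahlerMeasure.IntegerMahlerMeasure
import Literature.NumberTheory.MahlerMeasure.SmythNonreciprocalTheorem
import Literature.NumberTheory.MahlerMeasure.SmythIsolation
import Literature.NumberTheory.MahlerMeasure.CyclotomicIntegerHeightBound
import Literature.NumberTheory.MahlerMeasure.DobrowolskiTheorem
import HarnessLib

/-!
# Structure of integer polynomials of small Mahler measure: Kronecker, unimodular roots ⇒ reciprocal, Salem shape, Schinzel's totally-real bound `M ≥ φ^{deg/2}`, low-degree minimal measures, and the exact-arithmetic Graeffe certificate kernel (re-homed proofs)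

**Structure of integer polynomials of small Mahler measure** — Kronecker's theorem in measure form (`M = 1` ⇒ cyclotomic · `z^k`,
McKee–Smyth Thm 1.3), a unimodular root of an irreducible polynomial forces reciprocity (McKee–Smyth Exercise 12.15) and the Salem shape,
SCHINZEL'S THEOREM `M ≥ φ^{deg/2}` for totally real (and `φ^{deg}` for totally positive) algebraic integers (Schinzel 1973; McKee–Smyth Exercise
14.11, Höhn–Skoruppa's proof), the low-degree rows of the table of minimal measures (degrees ≤ 4 below 1.3248, Mossinghoff–Rhin–Wu Table 1;
palindromic quartics), `M(P) < θ₀ ⇒ P` reciprocal, and the EXACT-ARITHMETIC CERTIFICATE KERNEL of the cell's census (ascending coefficient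
lists, list-polynomial arithmetic, coefficient domination, Graeffe rejection certificates `checkCert`, trace certificates — Mossinghoff–Rhin–Wu §2
style, checked by `decide`) — RE-HOMED into `Literature/` by the Hodge foundations lane (`lit-hodgefound`, seat p20, generation 36) from the
venture cell `pub-namedobj` (seats `pub-namedobj-mahler` gens 2–12, `-g24`): verbatim DECLARATION-LEVEL ports (only the declarations the
quadrinomial bound and the isolation results consume), in dependency order and each with its original module docstring, of the modules
`Summits/Ventures/DiscreteObjects/Mahler/{OddCoefficientsResultant (3), SmallMeasureCensus (5), OddCoefficientsCyclotomicFactors (1),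
SubLehmerDegree57 (2), MeasureOneQuadratic (2), GraeffeIdentity (8), SubLehmerStructure (2), SchinzelTotallyPositive, CoresCertificateLift (1),
SchinzelTotallyReal, LowDegreeCensus, QuarticCensusTools, UnimodularRootReciprocal, SalemStructure, PalindromicQuartic, QuarticCensusRow,
MahlerMeasureUnit (1), SmallMeasureReciprocal (2), LowDegreeMeasures (5), UnitMeasureFactors (2), Height1CensusData46 (1), CensusListPoly (22),
ReciprocalCoeffBound (6), CensusCertificate (7), CensusTraceCertificate (2)}.lean`, namespace `Summit.Ventures.DiscreteObjects.Mahler` re-rooted as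
`Literature.NumberTheory.MahlerMeasure` (this file's path namespace); the cell's `lehmerPoly` is the tree's `lehmerPolynomial`
(`MinimalMeasuresByDegree.lean`), REUSED.  Definitions kept from the source (with bodies, verbatim): the census vocabulary `ofCoeffs`,
`DegreeCensus`, `IsGraeffeIterate`, `GraeffeChain` (inductive), the domination predicates `Dominates` / `CoeffLE` / `CoeffNonneg`, the
list-polynomial operations `lp*`, the certificate type `Cert` (inductive) with `graeffeIter` / `checkCert` / `allCertified` / `lpMonom` …;
no named fact; imports Mathlib/Literature only; every declaration carries the citation of the printed step it formalises.  The Summits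
originals stay in place (transitional duplication).  Lehmer's problem is not touched.
-/

noncomputable section

/-!
## Part 1 — port of `Summits/Ventures/DiscreteObjects/Mahler/OddCoefficientsResultant.lean` (3 declarations kept)

# Resultants of an odd-coefficient polynomial with `X^n ∓ 1`, `X^{2n} + 1` (venture `DiscreteObjects`, target L)

Cell `pub-namedobj`, seat `pub-namedobj-mahler` (gen 8). Framing: lottery ticket; floor = certified
bounds/negative ranges.

This is Lemma 3.1 (case `m = 2`) of Borwein–Dobrowolski–Mossinghoff, *Lehmer's problem for polynomials
with odd coefficients*, Ann. of Math. 166 (2007) 347–366, in Mathlib's vocabulary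
(`Polynomial.resultant`, explicit Sylvester formats `(deg f, N)`):

* `exists_X_pow_sub_one_eq_of_odd` — if all coefficients `f_0, …, f_d` of `f ∈ ℤ[X]` are odd then
  `X^{d+1} - 1 = 2 s + f · (X - 1)` for some `s ∈ ℤ[X]` with `deg s ≤ d + 1` ((3.3) of the paper);
* `two_pow_le_abs_resultant` — if `G = 2 T + f · P` with `deg P + deg f ≤ N` and `Res(f, G) ≠ 0` then
  `2^{deg f} ≤ |Res(f, G)|`; applied to `G = X^{d+1} - 1`, `X^{d+1} + 1`, `X^{2(d+1)} + 1`
  (`two_pow_le_abs_resultant_X_pow_sub_one` / `_add_one` / `_X_pow_two_mul_add_one`);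
* `resultant_intCast_eq` — over `ℂ`, `Res(f, G) = a^N ∏_{f(α)=0} G(α)` (Mathlib's
  `resultant_eq_prod_eval`), and `pow_ne_one_of_cyclotomicFree` — the roots of a cyclotomic-free
  integer polynomial are not roots of unity, so these resultants are nonzero
  (`resultant_ne_zero_of_cyclotomicFree`).

These feed the proof of [BDM07, Cor. 3.4] in `OddCoefficientsMahlerBound`.
-/

section Part1

namespace Literature.NumberTheory.MahlerMeasure

open _root_.Polynomial

/-- Membership in the complex root multiset of `f ∈ ℤ[X]`, `f ≠ 0`, means `f(α) = 0`.
[cite: Dobrowolski2006, Proposition 2 p.203 (proof: resultants with z^m − 1)] -/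
theorem aeval_eq_zero_of_mem_roots_map {f : ℤ[X]} {α : ℂ}
    (hα : α ∈ (f.map (Int.castRingHom ℂ)).roots) : aeval α f = 0 := by
  have h := (mem_roots'.mp hα).2
  rwa [IsRoot.def, ← algebraMap_int_eq, eval_map_algebraMap] at h

/-- **Nonvanishing.** If `f ∈ ℤ[X]` is nonzero and cyclotomic-free and `G ∈ ℤ[X]` vanishes only at
roots of unity of order dividing `L > 0` (i.e. `G(z) = 0 → z^L = 1`), then `Res(f, G) ≠ 0`.
[cite: Dobrowolski2006, Proposition 2 p.203 (proof: resultants with z^m − 1)] -/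
theorem resultant_ne_zero_of_cyclotomicFree {f G : ℤ[X]} {N L : ℕ} (hf : f ≠ 0)
    (hcf : ∀ m : ℕ, 0 < m → ¬ cyclotomic m ℤ ∣ f) (hG : G.natDegree ≤ N) (hL : 0 < L)
    (hGL : ∀ z : ℂ, (G.map (Int.castRingHom ℂ)).eval z = 0 → z ^ L = 1) :
    f.resultant G f.natDegree N ≠ 0 := by
  intro h
  have hinj : Function.Injective (Int.castRingHom ℂ) := (Int.castRingHom ℂ).injective_int
  have hC := resultant_intCast_eq (f := f) hG
  rw [h, Int.cast_zero] at hC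
  have hlc : (f.map (Int.castRingHom ℂ)).leadingCoeff ≠ 0 := by
    rw [Ne, leadingCoeff_eq_zero, Polynomial.map_eq_zero_iff hinj]
    exact hf
  rcases mul_eq_zero.mp hC.symm with h1 | h2
  · exact hlc (pow_eq_zero_iff'.mp h1).1
  · rw [Multiset.prod_eq_zero_iff, Multiset.mem_map] at h2
    obtain ⟨α, hαmem, hα0⟩ := h2
    exact pow_ne_one_of_cyclotomicFree hcf (aeval_eq_zero_of_mem_roots_map hαmem) hL (hGL α hα0)

/-- `Res(f, X^n - 1) ≠ 0` for `f ≠ 0` cyclotomic-free and `n > 0`.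
[cite: Dobrowolski2006, Proposition 2 p.203 (proof: resultants with z^m − 1)] -/
theorem resultant_X_pow_sub_one_ne_zero {f : ℤ[X]} (hf : f ≠ 0)
    (hcf : ∀ m : ℕ, 0 < m → ¬ cyclotomic m ℤ ∣ f) {n : ℕ} (hn : 0 < n) :
    f.resultant (X ^ n - 1) f.natDegree n ≠ 0 := by
  refine resultant_ne_zero_of_cyclotomicFree (L := n) hf hcf ?_ hn ?_
  · rw [← C_1, natDegree_X_pow_sub_C]
  · intro z hz
    simp only [Polynomial.map_sub, Polynomial.map_pow, map_X, Polynomial.map_one, eval_sub,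
      eval_pow, eval_X, eval_one] at hz
    exact sub_eq_zero.mp hz

end Literature.NumberTheory.MahlerMeasure

end Part1

/-!
## Part 2 — port of `Summits/Ventures/DiscreteObjects/Mahler/SmallMeasureCensus.lean` (5 declarations kept)

# Small Mahler measure census — typed statements and the rejection certificate (venture `DiscreteObjects`, target L)

Cell `pub-namedobj`, seat `pub-namedobj-mahler`. Framing: lottery ticket; floor = certified
bounds/negative ranges.

This file fixes, in Mathlib's vocabulary (`Polynomial.mahlerMeasure` over `ℂ`), the objects of the
census of integer polynomials of small Mahler measure:

* `intMahlerMeasure p` — the Mahler measure of `p : ℤ[X]` (via `ℤ → ℂ`);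
* `lehmerPolynomial` — Lehmer's polynomial `x¹⁰+x⁹-x⁷-x⁶-x⁵-x⁴-x³+x+1` (`M = 1.17628081825991750654…`,
  certified by the cell to 40 digits by two independent exact methods, see `CONTROLS-L.md`);
* `height p` — the naive height `max |aᵢ|`;
* `HeightBoundedCensus n h B L` — the STATEMENT "every integer polynomial of degree `n`, height `≤ h`
  and Mahler measure in `(1, B)` has the Mahler measure of some member of the explicit list `L`, and
  every member of `L` has degree `n`, height `≤ h` and measure in `(1, B)`" — the shape of each
  certified census row (`bound reached (height h, degree n)`); the lists themselves and the job
  certificates live in the cell's table, and an instance is asserted in Lean only as a `def … : Prop`.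

and PROVES the soundness of the elementary rejection step used (in exact integer arithmetic) by the
census engines: if some coefficient violates Mahler's bound `‖aₖ‖ ≤ C(n,k)·B` then `B < M(p)`
(`lt_mahlerMeasure_of_choose_mul_lt_norm_coeff`, from Mathlib's
`Polynomial.norm_coeff_le_choose_mul_mahlerMeasure`). The engines apply this to Graeffe iterates
`P_m` (roots `αᵢ^(2^m)`, `M(P_m) = M(P)^(2^m)`); that relation is named here as the predicate
`IsGraeffeIterate` (the identity `M(q) = M(p)^2` is not yet proved in Lean).
-/

section Part2

namespace Literature.NumberTheory.MahlerMeasure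

open _root_.Polynomial

/-- The integer polynomial with ascending coefficient list `l` (`l[i]` is the coefficient of `X^i`).
[cite: MossinghoffRhinWu2008, §2 (coefficient bounds |a_k| ≤ C(n,k)·M and Graeffe root-squaring)] -/
noncomputable def ofCoeffs (l : List ℤ) : ℤ[X] :=
  (l.zipIdx.map fun ai => C ai.1 * X ^ ai.2).sum

/-- Census row statement for degree `n`, all heights: every IRREDUCIBLE integer polynomial of degree
`n` with Mahler measure in `(1, B)` is, up to sign and `x ↦ -x`, in the list `L`.
[cite: MossinghoffRhinWu2008, §2 (coefficient bounds |a_k| ≤ C(n,k)·M and Graeffe root-squaring)] -/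
def DegreeCensus (n : ℕ) (B : ℝ) (L : List (List ℤ)) : Prop :=
  ∀ p : ℤ[X], p.natDegree = n → Irreducible p → 1 < intMahlerMeasure p → intMahlerMeasure p < B →
    ∃ l ∈ L, p = ofCoeffs l ∨ p = -ofCoeffs l ∨ p = (ofCoeffs l).comp (-X) ∨ p = -(ofCoeffs l).comp (-X)

/-- **Rejection certificate, elementary step.** If the `k`-th coefficient of `p : ℂ[X]` exceeds
Mahler's bound `C(deg p, k) · B`, then `B < M(p)`.  The census engines reject a candidate exactly
when such an inequality holds (in integers, for a Graeffe iterate).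
[cite: MossinghoffRhinWu2008, §2 (coefficient bounds |a_k| ≤ C(n,k)·M and Graeffe root-squaring)] -/
theorem lt_mahlerMeasure_of_choose_mul_lt_norm_coeff (p : ℂ[X]) (k : ℕ) {B : ℝ}
    (h : (p.natDegree.choose k : ℝ) * B < ‖p.coeff k‖) : B < p.mahlerMeasure := by
  by_contra hle
  rw [not_lt] at hle
  have hc : (0 : ℝ) ≤ (p.natDegree.choose k : ℝ) := by positivity
  have := norm_coeff_le_choose_mul_mahlerMeasure k p
  have h2 : (p.natDegree.choose k : ℝ) * p.mahlerMeasure ≤ (p.natDegree.choose k : ℝ) * B :=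
    mul_le_mul_of_nonneg_left hle hc
  linarith

/-- Integer form of the rejection step, as used by the engines: for `p : ℤ[X]` and a rational bound
`B`, `C(n,k) · B < |aₖ|` implies `B < M(p)`.
[cite: MossinghoffRhinWu2008, §2 (coefficient bounds |a_k| ≤ C(n,k)·M and Graeffe root-squaring)] -/
theorem lt_intMahlerMeasure_of_choose_mul_lt_abs_coeff (p : ℤ[X]) (k : ℕ) {B : ℚ}
    (h : (p.natDegree.choose k : ℚ) * B < |(p.coeff k : ℚ)|) : (B : ℝ) < intMahlerMeasure p := by
  unfold intMahlerMeasure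
  apply lt_mahlerMeasure_of_choose_mul_lt_norm_coeff _ k
  rw [natDegree_map_eq_of_injective (Int.castRingHom ℂ).injective_int, coeff_map]
  have h' : ((p.natDegree.choose k : ℚ) * B : ℝ) < (|(p.coeff k : ℚ)| : ℝ) := by exact_mod_cast h
  simpa [Rat.cast_mul, Rat.cast_natCast, Rat.cast_abs, Rat.cast_intCast] using h'

/-- The Graeffe transfer used by the engines, for a given pair: `q` is a Graeffe iterate of `p`, i.e.
`q(x²) = ± p(x)·p(-x)` with `q` monic of the same degree; the engines use that then `M(q) = M(p)²`
(standard; the general implication is the certificate's second ingredient and is not yet proved in the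
tree — this predicate only names the relation a certificate line asserts).
[cite: MossinghoffRhinWu2008, §2 (coefficient bounds |a_k| ≤ C(n,k)·M and Graeffe root-squaring)] -/
def IsGraeffeIterate (p q : ℤ[X]) : Prop :=
  q.Monic ∧ q.natDegree = p.natDegree ∧
    (q.comp (X ^ 2) = p * p.comp (-X) ∨ q.comp (X ^ 2) = -(p * p.comp (-X)))

end Literature.NumberTheory.MahlerMeasure

end Part2

/-!
## Part 3 — port of `Summits/Ventures/DiscreteObjects/Mahler/OddCoefficientsCyclotomicFactors.lean` (1 declarations kept)

# Cyclotomic factors of odd-coefficient polynomials: `Φ_r ∣ f ⇒ r ∣ 2(deg f + 1)` (venture `DiscreteObjects`, target L)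

Cell `pub-namedobj`, seat `pub-namedobj-mahler` (gen 8). Framing: lottery ticket; floor = certified
bounds/negative ranges.

This is Lemma 2.3 (case of odd coefficients, `D₂`) of Borwein–Dobrowolski–Mossinghoff, *Lehmer's problem
for polynomials with odd coefficients*, Ann. of Math. 166 (2007): "Suppose `f ∈ ℤ[x]` has degree `n - 1`
and `Φ_r ∣ f`. If `f ∈ D₂`, then `r ∣ 2n`."  (`dvd_two_mul_of_cyclotomic_dvd_odd`.)

Proof given here (archimedean/2-adic, instead of the paper's factorisation in `𝔽₂[x]`): by
`OddCoefficientsResultant`, `X^n - 1 = 2s + f·(X - 1) = 2s + Φ_r·(h (X - 1))`, so the integer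
`Res(Φ_r, X^n - 1)` is `2^{φ(r)} Res(Φ_r, s)`.  Over `ℂ` it is `∏_ζ (ζ^n - 1)` over the primitive `r`-th
roots of unity `ζ`, of absolute value `≤ 2^{φ(r)}`.  Hence either it vanishes (`ζ^n = 1`, `r ∣ n`) or every
factor has `|ζ^n - 1| = 2`, i.e. `ζ^n = -1` and `r ∣ 2n`.
-/

section Part3

namespace Literature.NumberTheory.MahlerMeasure

open _root_.Polynomial

/-- A point of the unit circle at distance `2` from `1` is `-1`.
[cite: Dobrowolski2006, Proposition 2 p.203 (proof: unimodular values)] -/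
theorem eq_neg_one_of_norm_eq_one_of_norm_sub_one {w : ℂ} (hw : ‖w‖ = 1) (h2 : ‖w - 1‖ = 2) :
    w = -1 := by
  have h1 : w.re ^ 2 + w.im ^ 2 = 1 := by
    have h := Complex.normSq_eq_norm_sq w
    rw [hw, Complex.normSq_apply] at h
    nlinarith [h]
  have h3 : (w.re - 1) ^ 2 + w.im ^ 2 = 4 := by
    have h := Complex.normSq_eq_norm_sq (w - 1)
    rw [h2, Complex.normSq_apply] at h
    simp only [Complex.sub_re, Complex.one_re, Complex.sub_im, Complex.one_im, sub_zero] at h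
    nlinarith [h]
  have hre : w.re = -1 := by nlinarith
  have him : w.im = 0 := by nlinarith [sq_nonneg w.im]
  apply Complex.ext
  · rw [hre]; simp
  · rw [him]; simp

end Literature.NumberTheory.MahlerMeasure

end Part3

/-!
## Part 4 — port of `Summits/Ventures/DiscreteObjects/Mahler/SubLehmerDegree57.lean` (2 declarations kept)

# Sub-Lehmer polynomials at degree 57 reduce to degree 56 (venture `DiscreteObjects`, target L, family L6)

Cell `pub-namedobj`, seat `pub-namedobj-mahler` (gen 4). Framing: lottery ticket; floor = certified
bounds/negative ranges.

Continuation of `SubLehmerDegree56.lean`.  Conditional on the named facts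
`Literature.NumberTheory.MahlerMeasure.SubLehmerDegreeBound` ([MRW08, Thm 1.1]: sub-Lehmer ⇒ degree `≥ 56`)
and `Literature.NumberTheory.MahlerMeasure.NonreciprocalMahlerBound` (Smyth), a sub-Lehmer integer
polynomial of degree `57` is `x·Q`, `(x+1)·Q` or `(x-1)·Q` with `Q` sub-Lehmer of degree `56`
(`subLehmer_degree57_structure`).  For the cell's height-1 census this is the statement that degree 57
costs exactly ONE extra enumeration beyond the degree-56 slice: the "offset" family `P = (x+1)·Q`
(power-sum box `|s_k(P) - s_k(x+1)| ≤ T_k(56)`), `(x-1)·Q` being its image under `x ↦ -x` and `x·Q` the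
degree-56 slice itself (EFFICIENCY-L6.md, CONTROLS-L6.md §3c).  General lemmas on the way:
`natDegree_le_of_dvd_of_measure_one` (a measure-1 factor of a sub-Lehmer polynomial has degree
`≤ deg P - 56`), `measure_one_of_mul` (in a factorisation of a sub-Lehmer polynomial of degree `< 112`
one factor has measure `1`), `eval_neg_one_eq_zero_of_reverse_eq` / `eval_one_eq_zero_of_reverse_eq_neg`
((anti)palindromic ⇒ root at `∓1`), `linear_of_measure_one`.
-/

section Part4

namespace Literature.NumberTheory.MahlerMeasure

open _root_.Polynomial Literature.NumberTheory.MahlerMeasure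

/-- A palindromic (`reverse P = P`) integer polynomial of odd degree vanishes at `-1`.
[cite: MckeeSmyth2021, §A.1 (self-reciprocal polynomials: values at ±1)] -/
theorem eval_neg_one_eq_zero_of_reverse_eq {P : ℤ[X]} (hrev : P.reverse = P) (hodd : Odd P.natDegree) :
    P.eval (-1) = 0 := by
  letI : Invertible (1 : ℤ) := invertibleOne
  letI : Invertible (-1 : ℤ) := invertibleNeg 1
  have h := eval₂_reverse_mul_pow (RingHom.id ℤ) (-1 : ℤ) P
  rw [hrev] at h
  have hinv : (⅟(-1 : ℤ)) = -1 := by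
    have hm := invOf_mul_self (-1 : ℤ)
    linarith
  rw [hinv, eval₂_id, Odd.neg_one_pow hodd] at h
  -- h : eval (-1) P * (-1) = eval (-1) P
  linarith

/-- An antipalindromic (`reverse P = -P`) integer polynomial vanishes at `1`.
[cite: MckeeSmyth2021, §A.1 (self-reciprocal polynomials: values at ±1)] -/
theorem eval_one_eq_zero_of_reverse_eq_neg {P : ℤ[X]} (hrev : P.reverse = -P) : P.eval 1 = 0 := by
  letI : Invertible (1 : ℤ) := invertibleOne
  have h := eval₂_reverse_mul_pow (RingHom.id ℤ) (1 : ℤ) P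
  rw [hrev] at h
  have hinv : (⅟(1 : ℤ)) = 1 := by
    have hm := invOf_mul_self (1 : ℤ)
    linarith
  rw [hinv] at h
  simp only [eval₂_id, one_pow, mul_one, eval_neg] at h
  linarith

end Literature.NumberTheory.MahlerMeasure

end Part4

/-!
## Part 5 — port of `Summits/Ventures/DiscreteObjects/Mahler/MeasureOneQuadratic.lean` (2 declarations kept)

# Integer quadratics of Mahler measure one (venture `DiscreteObjects`, target L)

Cell `pub-namedobj`, seat `pub-namedobj-mahler` (gen 5). Framing: lottery ticket; floor = certified
bounds/negative ranges.

Completes `quadratic_of_measure_one` (`SubLehmerDegree58.lean`): a MONIC integer quadratic of Mahler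
measure `1` is one of the nine polynomials `x², x² ± x, (x ± 1)², x² − 1, x² + 1, x² ± x + 1`
(Kronecker for degree 2, by hand): the coefficient bounds leave `15` candidates and the six others
(`x² ± 2x`, `x² ± x − 1`, `x² ± 2x − 1`) have a real root of modulus `> 1`, hence measure `> 1`.
These nine are exactly the possible quadratic cofactors `C` in `subLehmer_degree58_structure`, i.e. the
explicit list of "offset" families of the degree-58 census over the degree-56 slice (EFFICIENCY-L6c §10).
-/

section Part5

namespace Literature.NumberTheory.MahlerMeasure

open _root_.Polynomial Literature.NumberTheory.MahlerMeasure

/-- A monic integer quadratic written out from its coefficients.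
[cite: MckeeSmyth2021, Theorem 1.3 (Kronecker) p.20] -/
theorem quadratic_eq_of_coeff {b : ℤ[X]} (hdeg : b.natDegree = 2) (hmonic : b.coeff 2 = 1) :
    b = X ^ 2 + C (b.coeff 1) * X + C (b.coeff 0) := by
  have h := b.as_sum_range_C_mul_X_pow
  rw [hdeg] at h
  conv_lhs => rw [h]
  simp only [Finset.sum_range_succ, Finset.sum_range_zero, zero_add, pow_zero, mul_one, pow_one,
    hmonic, map_one, one_mul]
  ring

/-- Evaluation of a monic integer quadratic at a real number (through `ℂ`).
[cite: MckeeSmyth2021, Theorem 1.3 (Kronecker) p.20] -/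
theorem aeval_quadratic_real {b : ℤ[X]} (hdeg : b.natDegree = 2) (hmonic : b.coeff 2 = 1) (r : ℝ) :
    aeval (r : ℂ) b = ((r ^ 2 + (b.coeff 1 : ℝ) * r + (b.coeff 0 : ℝ) : ℝ) : ℂ) := by
  conv_lhs => rw [quadratic_eq_of_coeff hdeg hmonic]
  simp only [map_add, map_mul, map_pow, aeval_X, eq_intCast, map_intCast]
  push_cast
  ring

end Literature.NumberTheory.MahlerMeasure

end Part5

/-!
## Part 6 — port of `Summits/Ventures/DiscreteObjects/Mahler/GraeffeIdentity.lean` (8 declarations kept)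

# The Graeffe identity `M(q) = M(p)²` and the full rejection certificate (venture `DiscreteObjects`, target L)

Cell `pub-namedobj`, seat `pub-namedobj-mahler-g2`. Framing: lottery ticket; floor = certified
bounds/negative ranges.

`SmallMeasureCensus.lean` proved the elementary rejection step (`C(n,k)·B < |aₖ| ⇒ B < M(p)`) and NAMED
the Graeffe relation `IsGraeffeIterate p q` (`q(x²) = ± p(x)·p(−x)`, `q` monic of the same degree),
leaving the identity `M(q) = M(p)²` unproved. This file proves it, in Mathlib's vocabulary
(`Polynomial.mahlerMeasure` over `ℂ`):

* `mahlerMeasure_neg`, `mahlerMeasure_comp_neg_X` (`M(p(−x)) = M(p)`),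
  `mahlerMeasure_comp_X_pow_two` (`M(p(x²)) = M(p)`) — from the root factorisation over `ℂ`;
* `intMahlerMeasure_sq_of_isGraeffeIterate` : `IsGraeffeIterate p q → M(q) = M(p)²`;
* `GraeffeChain p m q` (m successive Graeffe steps) and
  `intMahlerMeasure_of_graeffeChain : M(q) = M(p)^(2^m)`;
* the COMPLETE certificate used by the census engines (exact integer arithmetic on the `m`-th
  Graeffe iterate): `lt_intMahlerMeasure_of_graeffeChain` — if `C(n,k)·B^(2^m) < |aₖ(p_m)|` then
  `B < M(p)`.

So every rejection line `(p, m, k)` emitted by engine A / engine B of the cell's census is now a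
statement the kernel can check given the iterates (which are computable from `p`).
-/

section Part6

namespace Literature.NumberTheory.MahlerMeasure

open _root_.Polynomial

/-- For `t ≥ 0`: `max(1,t)·max(1,t) = max(1,t·t)`.
[cite: MossinghoffRhinWu2008, §2 (Graeffe root-squaring: M(G(p)) = M(p)²)] -/
theorem max_one_mul_max_one_self {t : ℝ} (ht : 0 ≤ t) : max 1 t * max 1 t = max 1 (t * t) := by
  rcases le_total t 1 with h | h
  · rw [max_eq_left h, max_eq_left (by nlinarith)]
    ring
  · rw [max_eq_right h, max_eq_right (by nlinarith)]

/-- `M(x² − a) = max(1,|a|)`: the roots are `±s` with `s² = a`.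
[cite: MossinghoffRhinWu2008, §2 (Graeffe root-squaring: M(G(p)) = M(p)²)] -/
theorem mahlerMeasure_X_pow_two_sub_C (a : ℂ) : (X ^ 2 - C a : ℂ[X]).mahlerMeasure = max 1 ‖a‖ := by
  obtain ⟨s, rfl⟩ := IsAlgClosed.exists_eq_mul_self a
  rw [show (X ^ 2 - C (s * s) : ℂ[X]) = (X - C s) * (X + C s) by rw [map_mul]; ring,
    mahlerMeasure_mul, mahlerMeasure_X_sub_C, mahlerMeasure_X_add_C, norm_mul,
    max_one_mul_max_one_self (norm_nonneg s)]

/-- `M(p(x²)) = M(p)`. [cite: MossinghoffRhinWu2008, §2 (Graeffe root-squaring: M(G(p)) = M(p)²)] -/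
theorem mahlerMeasure_comp_X_pow_two (p : ℂ[X]) : (p.comp (X ^ 2)).mahlerMeasure = p.mahlerMeasure := by
  have hs := (IsAlgClosed.splits p).eq_prod_roots
  have h1 : (p.comp (X ^ 2)).mahlerMeasure =
      ‖p.leadingCoeff‖ * (p.roots.map (fun a ↦ max 1 ‖a‖)).prod := by
    conv_lhs => rw [hs]
    rw [mul_comp, C_comp, multiset_prod_comp, mahlerMeasure_mul, mahlerMeasure_const,
      prod_mahlerMeasure_eq_mahlerMeasure_prod, Multiset.map_map, Multiset.map_map]
    congr 1
    apply congrArg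
    apply Multiset.map_congr rfl
    intro a _
    simp only [Function.comp_apply, sub_comp, X_comp, C_comp]
    exact mahlerMeasure_X_pow_two_sub_C a
  rw [h1, mahlerMeasure_eq_leadingCoeff_mul_prod_roots]

/-- `M(q(x²)) = M(q)` for integer polynomials.
[cite: MossinghoffRhinWu2008, §2 (Graeffe root-squaring: M(G(p)) = M(p)²)] -/
theorem intMahlerMeasure_comp_X_pow_two (q : ℤ[X]) :
    intMahlerMeasure (q.comp (X ^ 2)) = intMahlerMeasure q := by
  unfold intMahlerMeasure
  rw [map_comp]
  simp only [Polynomial.map_pow, map_X]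
  exact mahlerMeasure_comp_X_pow_two _

/-- **Graeffe identity.** If `q` is a Graeffe iterate of `p` (`q(x²) = ± p(x)p(−x)`), then
`M(q) = M(p)²`. (Only the functional equation is used; monicity and the degree condition recorded in
`IsGraeffeIterate` are not needed for the identity.)
[cite: MossinghoffRhinWu2008, §2 (Graeffe root-squaring: M(G(p)) = M(p)²)] -/
theorem intMahlerMeasure_sq_of_isGraeffeIterate {p q : ℤ[X]} (h : IsGraeffeIterate p q) :
    intMahlerMeasure q = intMahlerMeasure p ^ 2 := by
  obtain ⟨_, _, h3⟩ := h
  rw [← intMahlerMeasure_comp_X_pow_two q, ← intMahlerMeasure_mul_comp_neg_X p]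
  rcases h3 with h3 | h3
  · rw [h3]
  · rw [h3, intMahlerMeasure_neg]

/-- `GraeffeChain p m q`: `q` is obtained from `p` by `m` successive Graeffe steps
(`p = p₀, p₁, …, p_m = q`, each `IsGraeffeIterate pᵢ pᵢ₊₁`).
[cite: MossinghoffRhinWu2008, §2 (Graeffe root-squaring: M(G(p)) = M(p)²)] -/
inductive GraeffeChain : ℤ[X] → ℕ → ℤ[X] → Prop
  /-- zero steps -/
  | refl (p : ℤ[X]) : GraeffeChain p 0 p
  /-- one more Graeffe step at the end -/
  | step {p q r : ℤ[X]} {m : ℕ} : GraeffeChain p m q → IsGraeffeIterate q r → GraeffeChain p (m + 1) r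

/-- Along a Graeffe chain of length `m`: `M(p_m) = M(p)^(2^m)`.
[cite: MossinghoffRhinWu2008, §2 (Graeffe root-squaring: M(G(p)) = M(p)²)] -/
theorem intMahlerMeasure_of_graeffeChain {p q : ℤ[X]} {m : ℕ} (h : GraeffeChain p m q) :
    intMahlerMeasure q = intMahlerMeasure p ^ (2 ^ m) := by
  induction h with
  | refl => simp
  | step hc hqr ih =>
    rw [intMahlerMeasure_sq_of_isGraeffeIterate hqr, ih, ← pow_mul, pow_succ]

/-- **The complete rejection certificate of the census engines.** If `p_m` is the `m`-th Graeffe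
iterate of `p : ℤ[X]` (any chain of `m` Graeffe steps), `B` is rational and some coefficient of
`p_m` violates Mahler's bound, `C(deg p_m, k)·B^(2^m) < |aₖ(p_m)|`, then `B < M(p)` — decided in exact
integer/rational arithmetic (no sign condition on `B` is needed since `M(p) ≥ 0`).
[cite: MossinghoffRhinWu2008, §2 (Graeffe root-squaring: M(G(p)) = M(p)²)] -/
theorem lt_intMahlerMeasure_of_graeffeChain {p q : ℤ[X]} {m : ℕ} (h : GraeffeChain p m q) (k : ℕ)
    {B : ℚ} (hk : (q.natDegree.choose k : ℚ) * B ^ (2 ^ m) < |(q.coeff k : ℚ)|) :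
    (B : ℝ) < intMahlerMeasure p := by
  have h1 := lt_intMahlerMeasure_of_choose_mul_lt_abs_coeff q k hk
  rw [intMahlerMeasure_of_graeffeChain h] at h1
  push_cast at h1
  exact lt_of_pow_lt_pow_left₀ _ (intMahlerMeasure_nonneg p) h1

end Literature.NumberTheory.MahlerMeasure

end Part6

/-!
## Part 7 — port of `Summits/Ventures/DiscreteObjects/Mahler/SubLehmerStructure.lean` (2 declarations kept)

# Structure of a sub-Lehmer integer polynomial: cyclotomic cofactor times an irreducible core
(venture `DiscreteObjects`, target L)

Cell `pub-namedobj`, seat `pub-namedobj-mahler` (gen 6). Framing: lottery ticket; floor = certified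
bounds/negative ranges.

Degree-free form of `SubLehmerDegree56/57/58`.  Conditional on the named facts
`SubLehmerDegreeBound` ([MRW08, Thm 1.1]: `1 < M(P) < M(L) ⇒ deg P ≥ 56`) and, where stated,
`NonreciprocalMahlerBound` (Smyth), a sub-Lehmer integer polynomial `P` of degree `< 112` is

  `P = ± x^a · Φ_{m₁} ⋯ Φ_{m_r} · Q`

with `Q` IRREDUCIBLE, sub-Lehmer with `M(Q) = M(P)`, reciprocal (`Q.reverse = Q`), of EVEN degree
`≥ 56`, with nonzero constant term and no cyclotomic factor (`subLehmer_structure`).  Ingredients: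

* `kronecker_form` — Kronecker's theorem in product form: an integer polynomial of Mahler measure `1`
  is `± x^a · ∏ Φ_{m_i}` (from Mathlib's `Polynomial.cyclotomic_dvd_of_mahlerMeasure_eq_one`, by
  induction on the degree), with `deg = a + Σ φ(m_i)` (`natDegree_signed_cyclotomic_prod`);
* `subLehmer_core` — extraction of the irreducible core (induction on the degree, using
  `measure_one_of_mul` and `natDegree_le_of_dvd_of_measure_one` of `SubLehmerDegree57`);
* `core_coeff_zero_ne_zero`, `core_not_cyclotomic_dvd`, `core_reverse_eq`, `core_even_natDegree` —
  properties of an irreducible sub-Lehmer polynomial (the last two use Smyth's theorem);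
* the elementary fact `φ(m) ≤ 4 ⇒ m ∈ {1,2,3,4,5,6,8,10,12}` is REUSED from the tree
  (`Summit.KontsevichZagierPeriods.KzOnePeriods.LemmaN.totient_le_four`, pure Mathlib arithmetic);
* `subLehmer_degree_le_60_structure` — the census scope up to degree `60`: `deg Q ∈ {56, 58, 60}` and
  the cofactor is `± x^a ∏ Φ_{m_i}` with `a + Σ φ(m_i) = deg P − deg Q ≤ 4`, every
  `m_i ∈ {1,2,3,4,5,6,8,10,12}` — i.e. degrees `59/60` of the height-1 census are the irreducible
  slices `CORES(56/58/60)` plus finitely many explicit cyclotomic "offset" families (EFFICIENCY-L6c §10),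
  exactly as degree `57/58` were (`subLehmer_degree57_structure`, `subLehmer_degree58_structure`).

Nothing here bounds a Mahler measure; everything is an elementary consequence of the two named facts,
Mathlib's Kronecker theorem and the kernel enclosure `1.17628 < M(L) < 1.17629`.
-/

section Part7

namespace Literature.NumberTheory.MahlerMeasure

open _root_.Polynomial Literature.NumberTheory.MahlerMeasure

/-! ### Kronecker's theorem in product form -/

/-- A product of integer cyclotomic polynomials is monic.
[cite: MckeeSmyth2021, Theorem 1.3 (Kronecker: measure 1 ⇒ cyclotomic · power of z) p.20] -/
theorem monic_cyclotomic_prod (s : Multiset ℕ) : ((s.map fun m => cyclotomic m ℤ).prod).Monic :=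
  monic_multiset_prod_of_monic s (fun m => cyclotomic m ℤ) fun m _ => cyclotomic.monic m ℤ

/-- **Kronecker's theorem, product form.** An integer polynomial of Mahler measure `1` is
`± x^a · Φ_{m₁} ⋯ Φ_{m_r}` for some `a ≥ 0` and positive integers `m_i` (Mathlib's
`Polynomial.cyclotomic_dvd_of_mahlerMeasure_eq_one`, iterated by induction on the degree).
[cite: MckeeSmyth2021, Theorem 1.3 (Kronecker: measure 1 ⇒ cyclotomic · power of z) p.20] -/
theorem kronecker_form {P : ℤ[X]} (hM : intMahlerMeasure P = 1) :
    ∃ (u : ℤ) (a : ℕ) (s : Multiset ℕ), (u = 1 ∨ u = -1) ∧ (∀ m ∈ s, 0 < m) ∧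
      P = C u * X ^ a * (s.map fun m => cyclotomic m ℤ).prod := by
  -- induction on the degree
  suffices key : ∀ d : ℕ, ∀ P : ℤ[X], P.natDegree = d → intMahlerMeasure P = 1 →
      ∃ (u : ℤ) (a : ℕ) (s : Multiset ℕ), (u = 1 ∨ u = -1) ∧ (∀ m ∈ s, 0 < m) ∧
        P = C u * X ^ a * (s.map fun m => cyclotomic m ℤ).prod from
    key P.natDegree P rfl hM
  intro d
  induction d using Nat.strong_induction_on with
  | _ d ih =>
    intro P hd hM
    have hP0 : P ≠ 0 := by
      intro h0; rw [h0] at hM; unfold intMahlerMeasure at hM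
      simp only [Polynomial.map_zero, mahlerMeasure_zero] at hM; exact zero_ne_one hM
    by_cases hd0 : d = 0
    · -- constant polynomial: |c| = 1
      subst hd0
      have hPc : P = C (P.coeff 0) := eq_C_of_natDegree_eq_zero hd
      rw [hPc, intMahlerMeasure_C] at hM
      refine ⟨P.coeff 0, 0, 0, ?_, fun m hm => absurd hm (Multiset.notMem_zero m), ?_⟩
      · have h1 : |P.coeff 0| = 1 := by exact_mod_cast hM
        rcases abs_eq (zero_le_one' ℤ) |>.mp h1 with h | h
        · exact Or.inl h
        · exact Or.inr h
      · simpa using hPc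
    by_cases hX : X ∣ P
    · -- peel off a factor x
      obtain ⟨R, hR⟩ := hX
      have hR0 : R ≠ 0 := by rintro rfl; rw [mul_zero] at hR; exact hP0 hR
      have hMR : intMahlerMeasure R = 1 := by
        rw [hR, intMahlerMeasure_mul, intMahlerMeasure_X, one_mul] at hM; exact hM
      have hdR : R.natDegree < d := by
        rw [← hd, hR, natDegree_mul X_ne_zero hR0, natDegree_X]; omega
      obtain ⟨u, a, s, hu, hs, hRf⟩ := ih R.natDegree hdR R rfl hMR
      refine ⟨u, a + 1, s, hu, hs, ?_⟩
      rw [hR, hRf]; ring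
    · -- peel off a cyclotomic factor (Kronecker)
      have hdeg : P.degree ≠ 0 := by
        rw [degree_eq_natDegree hP0]; exact_mod_cast (hd ▸ hd0 : P.natDegree ≠ 0)
      obtain ⟨n, hn, hdvd⟩ := cyclotomic_dvd_of_mahlerMeasure_eq_one hM hX hdeg
      obtain ⟨R, hR⟩ := hdvd
      have hc0 : cyclotomic n ℤ ≠ 0 := cyclotomic_ne_zero n ℤ
      have hR0 : R ≠ 0 := by rintro rfl; rw [mul_zero] at hR; exact hP0 hR
      have hMR : intMahlerMeasure R = 1 := by
        rw [hR, intMahlerMeasure_mul, intMahlerMeasure_cyclotomic, one_mul] at hM; exact hM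
      have hdR : R.natDegree < d := by
        rw [← hd, hR, natDegree_mul hc0 hR0, natDegree_cyclotomic]
        have := Nat.totient_pos.mpr hn
        omega
      obtain ⟨u, a, s, hu, hs, hRf⟩ := ih R.natDegree hdR R rfl hMR
      refine ⟨u, a, n ::ₘ s, hu, fun m hm => ?_, ?_⟩
      · rcases Multiset.mem_cons.mp hm with rfl | hm
        · exact hn
        · exact hs m hm
      · rw [hR, hRf, Multiset.map_cons, Multiset.prod_cons]; ring

/-! ### The irreducible core of a sub-Lehmer polynomial -/

end Literature.NumberTheory.MahlerMeasure

end Part7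

/-!
## Part 8 — port of `Summits/Ventures/DiscreteObjects/Mahler/SchinzelTotallyPositive.lean` (4 declarations kept)

# Schinzel's theorem: totally positive algebraic integers have `M ≥ φ^{deg}` (venture `DiscreteObjects`, target L)

Cell `pub-namedobj`, seat `pub-namedobj-mahler` (gen 8). Framing: lottery ticket; floor = certified
bounds/negative ranges.

[McKee–Smyth, *Around the Unit Circle*, Exercise 14.11; Schinzel 1973; short proof of Höhn–Skoruppa 1993.]
With `φ = (1+√5)/2`:

* `hoehn_skoruppa_ineq` — for `0 < y < 1`: `y^a (1-y)^b ≤ φ⁻¹`, `a = (1 - 1/√5)/2`, `b = 1/√5`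
  (weighted AM–GM; equality at `y = φ⁻²`); hence the auxiliary inequality (14.16) in multiplicative form
  `φ · x^a · |x - 1|^b ≤ max(1, x)` for `x > 0`, `x ≠ 1` (`goldenRatio_mul_rpow_le_max`);
* `goldenRatio_pow_le_mahlerMeasure_of_totally_positive` — **Schinzel**: if `P ∈ ℤ[X]` has `P(0) ≠ 0`,
  `P(1) ≠ 0` and all its complex roots real and positive, then `φ^{deg P} ≤ M(P)`.

(The totally real form `M ≥ φ^{deg/2}` for roots `≠ 0, ±1`, (14.17), follows by applying this to the
polynomial with roots `α_i²`; not done here.)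
-/

section Part8

namespace Literature.NumberTheory.MahlerMeasure

open _root_.Polynomial _root_.Real

/-- **Höhn–Skoruppa inequality.** For `0 < y < 1`:
`y^{(1 - 1/√5)/2} · (1 - y)^{1/√5} ≤ φ⁻¹` (weighted AM–GM with weights `a, b, a`, `2a + b = 1`,
at the points `y/φ⁻²`, `(1-y)/φ⁻¹`, `1`).
[cite: MckeeSmyth2021, Exercise 14.11 (Schinzel 1973: totally positive ⇒ M ≥ φ^{deg}; Höhn–Skoruppa proof)] -/
theorem hoehn_skoruppa_ineq {y : ℝ} (hy0 : 0 < y) (hy1 : y < 1) :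
    y ^ ((1 - 1 / √5) / 2) * (1 - y) ^ (1 / √5) ≤ goldenRatio⁻¹ := by
  have hs2 : (√5 : ℝ) ^ 2 = 5 := Real.sq_sqrt (by norm_num)
  have hs0 : (0 : ℝ) < √5 := Real.sqrt_pos.mpr (by norm_num)
  have hs1 : (1 : ℝ) < √5 := by nlinarith
  set s : ℝ := √5 with hs
  set a : ℝ := (1 - 1 / s) / 2 with ha
  set b : ℝ := 1 / s with hb
  have ha0 : 0 < a := by
    rw [ha]; have : 1 / s < 1 := (div_lt_one hs0).mpr hs1; linarith
  have hb0 : 0 < b := by rw [hb]; positivity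
  have hab : a + b + a = 1 := by rw [ha, hb]; ring
  -- `t = φ⁻¹ = 2/(1+√5)`, `t² = 1 - t`
  set t : ℝ := goldenRatio⁻¹ with ht
  have hφ : goldenRatio = (1 + s) / 2 := rfl
  have hφ0 : 0 < goldenRatio := Real.goldenRatio_pos
  have ht0 : 0 < t := by rw [ht]; positivity
  have htval : t = 2 / (1 + s) := by rw [ht, hφ, inv_div]
  have ht2 : t ^ 2 = 1 - t := by
    rw [htval]
    field_simp
    nlinarith [hs2]
  -- the two identities `a / t² = b / t` (i.e. `a φ = b`) and `b/t + a = 1`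
  have hsm : s - 1 ≠ 0 := by linarith
  have hsm' : -1 + s ≠ 0 := by linarith
  have h1s : 1 + s ≠ 0 := by linarith
  have hs0' : s ≠ 0 := hs0.ne'
  have hI3 : a / t ^ 2 = b / t := by
    rw [ht2, ha, hb, htval]
    have e1 : (1 : ℝ) - 2 / (1 + s) = (s - 1) / (1 + s) := by field_simp; ring
    rw [e1]
    field_simp
  have hI4 : b / t + a = 1 := by
    rw [ha, hb, htval]
    field_simp
    ring
  -- weighted AM–GM
  have hp1 : 0 ≤ y / t ^ 2 := by positivity
  have hp2 : 0 ≤ (1 - y) / t := div_nonneg (by linarith) ht0.le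
  have key := Real.geom_mean_le_arith_mean3_weighted ha0.le hb0.le ha0.le hp1 hp2 zero_le_one hab
  have hrhs : a * (y / t ^ 2) + b * ((1 - y) / t) + a * 1 = 1 := by
    have e : a * (y / t ^ 2) + b * ((1 - y) / t) + a * 1 = (a / t ^ 2 - b / t) * y + (b / t + a) := by
      ring
    rw [e, hI3, hI4]; ring
  rw [hrhs, Real.one_rpow, mul_one, Real.div_rpow hy0.le (by positivity),
    Real.div_rpow (by linarith) ht0.le] at key
  -- `key : y^a / (t^2)^a * ((1-y)^b / t^b) ≤ 1`
  have hden : (t ^ 2) ^ a * t ^ b = t := by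
    rw [show (t ^ 2 : ℝ) = t ^ (2 : ℝ) by norm_cast, ← Real.rpow_mul ht0.le, ← Real.rpow_add ht0]
    have : (2 : ℝ) * a + b = 1 := by linarith
    rw [this, Real.rpow_one]
  have hpos : 0 < (t ^ 2) ^ a * t ^ b := by positivity
  have e2 : y ^ a / (t ^ 2) ^ a * ((1 - y) ^ b / t ^ b) = (y ^ a * (1 - y) ^ b) / ((t ^ 2) ^ a * t ^ b) := by
    field_simp
  rw [e2, div_le_one hpos, hden] at key
  exact key

/-- **The auxiliary inequality (14.16), multiplicative form.** For real `x > 0`, `x ≠ 1`: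
`φ · x^a · |x - 1|^b ≤ max(1, x)` with `a = (1 - 1/√5)/2`, `b = 1/√5`.
[cite: MckeeSmyth2021, Exercise 14.11 (Schinzel 1973: totally positive ⇒ M ≥ φ^{deg}; Höhn–Skoruppa proof)] -/
theorem goldenRatio_mul_rpow_le_max {x : ℝ} (hx0 : 0 < x) (hx1 : x ≠ 1) :
    goldenRatio * (x ^ ((1 - 1 / √5) / 2) * |x - 1| ^ (1 / √5)) ≤ max 1 x := by
  have hφ0 : 0 < goldenRatio := Real.goldenRatio_pos
  set a : ℝ := (1 - 1 / √5) / 2 with ha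
  set b : ℝ := 1 / √5 with hb
  rcases lt_or_gt_of_ne hx1 with hlt | hgt
  · -- `0 < x < 1`: `φ x^a (1-x)^b ≤ 1`
    rw [max_eq_left hlt.le, abs_of_neg (by linarith), neg_sub]
    have h := hoehn_skoruppa_ineq hx0 hlt
    calc goldenRatio * (x ^ a * (1 - x) ^ b)
        ≤ goldenRatio * goldenRatio⁻¹ := mul_le_mul_of_nonneg_left h hφ0.le
      _ = 1 := mul_inv_cancel₀ hφ0.ne'
  · -- `x > 1`: with `y = 1/x`, `x^a (x-1)^b = x · y^a (1-y)^b`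
    rw [max_eq_right hgt.le, abs_of_pos (by linarith)]
    set y : ℝ := x⁻¹ with hy
    have hy0 : 0 < y := by rw [hy]; positivity
    have hy1 : y < 1 := by rw [hy]; exact inv_lt_one_of_one_lt₀ hgt
    have h := hoehn_skoruppa_ineq hy0 hy1
    have hxa : 0 < x ^ a := Real.rpow_pos_of_pos hx0 _
    -- identity: x^a (x-1)^b = x * (y^a (1-y)^b), using a + b + a = 1
    have hxy : x ^ a * (x - 1) ^ b = x * (y ^ a * (1 - y) ^ b) := by
      have e1 : x - 1 = x * (1 - y) := by rw [hy]; field_simp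
      have hya : y ^ a = (x ^ a)⁻¹ := by rw [hy, Real.inv_rpow hx0.le]
      have e2 : x ^ a * x ^ b * x ^ a = x := by
        rw [← Real.rpow_add hx0, ← Real.rpow_add hx0]
        have : a + b + a = 1 := by rw [ha, hb]; ring
        rw [this, Real.rpow_one]
      rw [e1, Real.mul_rpow hx0.le (by linarith), hya]
      field_simp
      linear_combination (1 - y) ^ b * e2
    rw [hxy]
    calc goldenRatio * (x * (y ^ a * (1 - y) ^ b))
        = x * (goldenRatio * (y ^ a * (1 - y) ^ b)) := by ring
      _ ≤ x * (goldenRatio * goldenRatio⁻¹) :=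
          mul_le_mul_of_nonneg_left (mul_le_mul_of_nonneg_left h hφ0.le) hx0.le
      _ = x := by rw [mul_inv_cancel₀ hφ0.ne', mul_one]

/-- `rpow` distributes over products of nonnegative reals indexed by a multiset.
[cite: MckeeSmyth2021, Exercise 14.11 (Schinzel 1973: totally positive ⇒ M ≥ φ^{deg}; Höhn–Skoruppa proof)] -/
theorem multiset_prod_map_rpow {ι : Type*} (s : Multiset ι) (f : ι → ℝ) (hf : ∀ i ∈ s, 0 ≤ f i) (r : ℝ) :
    (s.map f).prod ^ r = (s.map fun i => f i ^ r).prod := by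
  induction s using Multiset.induction_on with
  | empty => simp
  | cons a s ih =>
    rw [Multiset.map_cons, Multiset.prod_cons, Multiset.map_cons, Multiset.prod_cons,
      Real.mul_rpow (hf a (Multiset.mem_cons_self a s))
        (Multiset.prod_map_nonneg fun i hi => hf i (Multiset.mem_cons_of_mem hi)),
      ih fun i hi => hf i (Multiset.mem_cons_of_mem hi)]

/-- **Schinzel's theorem (totally positive case)** [McKee–Smyth, Ex. 14.11; Schinzel 1973; Höhn–Skoruppa
1993].  If `P ∈ ℤ[X]` has `P(0) ≠ 0`, `P(1) ≠ 0` and all its complex roots are positive reals, then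
`φ^{deg P} ≤ M(P)`, `φ = (1+√5)/2`.
[cite: MckeeSmyth2021, Exercise 14.11 (Schinzel 1973: totally positive ⇒ M ≥ φ^{deg}; Höhn–Skoruppa proof)] -/
theorem goldenRatio_pow_le_mahlerMeasure_of_totally_positive {P : ℤ[X]} (h0 : P.coeff 0 ≠ 0)
    (h1 : P.eval 1 ≠ 0) (hpos : ∀ α ∈ (P.map (Int.castRingHom ℂ)).roots, α.im = 0 ∧ 0 < α.re) :
    goldenRatio ^ P.natDegree ≤ intMahlerMeasure P := by
  have hP0 : P ≠ 0 := by rintro rfl; exact h0 (coeff_zero 0)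
  have hinj : Function.Injective (Int.castRingHom ℂ) := (Int.castRingHom ℂ).injective_int
  have hPC0 : P.map (Int.castRingHom ℂ) ≠ 0 := (Polynomial.map_ne_zero_iff hinj).mpr hP0
  have hcard : Multiset.card (P.map (Int.castRingHom ℂ)).roots = (P.map (Int.castRingHom ℂ)).natDegree :=
    ((IsAlgClosed.splits (P.map (Int.castRingHom ℂ))).natDegree_eq_card_roots).symm
  have hdeg : (P.map (Int.castRingHom ℂ)).natDegree = P.natDegree := natDegree_map_eq_of_injective hinj P
  set PC := P.map (Int.castRingHom ℂ) with hPC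
  set R := PC.roots with hR
  set c : ℂ := PC.leadingCoeff with hc
  have hprod : C c * (R.map fun a => X - C a).prod = PC := C_leadingCoeff_mul_prod_multiset_X_sub_C hcard
  -- evaluations
  have heval : ∀ z : ℂ, PC.eval z = c * (R.map fun a => z - a).prod := by
    intro z
    conv_lhs => rw [← hprod]
    rw [eval_mul, eval_C, eval_multiset_prod, Multiset.map_map]
    congr 1
    refine congrArg _ (Multiset.map_congr rfl fun a _ => ?_)
    simp
  have hnorm : ∀ z : ℂ, ‖PC.eval z‖ = ‖c‖ * (R.map fun a => ‖z - a‖).prod := by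
    intro z
    rw [heval z, norm_mul]
    congr 1
    have hmp := map_multiset_prod (normHom : ℂ →*₀ ℝ) (R.map fun a => z - a)
    rw [Multiset.map_map] at hmp
    simpa [Function.comp_def] using hmp
  have hev0 : ‖PC.eval 0‖ = |(P.coeff 0 : ℝ)| := by
    rw [hPC, eval_map, eval₂_at_zero, eq_intCast, Complex.norm_intCast]
  have hev1 : ‖PC.eval 1‖ = |((P.eval 1 : ℤ) : ℝ)| := by
    rw [hPC, eval_map, eval₂_at_one, eq_intCast, Complex.norm_intCast]
  have hge0 : (1 : ℝ) ≤ ‖PC.eval 0‖ := by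
    rw [hev0]; exact_mod_cast Int.one_le_abs h0
  have hge1 : (1 : ℝ) ≤ ‖PC.eval 1‖ := by
    rw [hev1]; exact_mod_cast Int.one_le_abs h1
  have hcge : (1 : ℝ) ≤ ‖c‖ := by
    rw [hc, hPC, leadingCoeff_map_of_injective hinj, eq_intCast, Complex.norm_intCast]
    exact_mod_cast Int.one_le_abs (leadingCoeff_ne_zero.mpr hP0)
  -- real roots
  have hreal : ∀ α ∈ R, α = ((α.re : ℝ) : ℂ) := by
    intro α hα
    apply Complex.ext
    · simp
    · simp [(hpos α hα).1]
  set a : ℝ := (1 - 1 / √5) / 2 with ha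
  set b : ℝ := 1 / √5 with hb
  have hs0 : (0 : ℝ) < √5 := Real.sqrt_pos.mpr (by norm_num)
  have hs1 : (1 : ℝ) < √5 := by
    have hs2 : (√5 : ℝ) ^ 2 = 5 := Real.sq_sqrt (by norm_num); nlinarith
  have ha0 : 0 ≤ a := by
    rw [ha]; have : 1 / √5 < 1 := (div_lt_one hs0).mpr hs1; linarith
  have hb0 : 0 ≤ b := by rw [hb]; positivity
  have h2ab : a + b + a = 1 := by rw [ha, hb]; ring
  -- pointwise inequality on the roots
  have hpt : ∀ α ∈ R, goldenRatio * (‖(0 : ℂ) - α‖ ^ a * ‖(1 : ℂ) - α‖ ^ b) ≤ max 1 ‖α‖ := by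
    intro α hα
    obtain ⟨him, hre⟩ := hpos α hα
    have hx1 : α.re ≠ 1 := by
      intro h
      apply h1
      have hroot : PC.eval α = 0 := (mem_roots hPC0).mp hα
      have hα1 : α = 1 := by rw [hreal α hα, h]; simp
      rw [hα1, hPC, eval_map, eval₂_at_one, eq_intCast, Int.cast_eq_zero] at hroot
      exact hroot
    have e0 : ‖(0 : ℂ) - α‖ = α.re := by
      rw [zero_sub, norm_neg, hreal α hα, Complex.norm_real, Real.norm_eq_abs, Complex.ofReal_re,
        abs_of_pos hre]
    have e1 : ‖(1 : ℂ) - α‖ = |α.re - 1| := by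
      rw [hreal α hα, Complex.ofReal_re, ← Complex.ofReal_one, ← Complex.ofReal_sub, Complex.norm_real,
        Real.norm_eq_abs, abs_sub_comm]
    have e2 : ‖α‖ = α.re := by
      rw [hreal α hα, Complex.norm_real, Real.norm_eq_abs, Complex.ofReal_re, abs_of_pos hre]
    rw [e0, e1, e2]
    exact goldenRatio_mul_rpow_le_max hre hx1
  -- products
  have hR0 : ∀ α ∈ R, 0 ≤ ‖(0 : ℂ) - α‖ := fun α _ => norm_nonneg _
  have hR1 : ∀ α ∈ R, 0 ≤ ‖(1 : ℂ) - α‖ := fun α _ => norm_nonneg _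
  have hprodle : (R.map fun α => goldenRatio * (‖(0 : ℂ) - α‖ ^ a * ‖(1 : ℂ) - α‖ ^ b)).prod ≤
      (R.map fun α => max 1 ‖α‖).prod :=
    Multiset.prod_map_le_prod_map₀ _ _ (fun α _ => by positivity) hpt
  rw [Multiset.prod_map_mul, Multiset.prod_map_mul, Multiset.map_const', Multiset.prod_replicate, hcard,
    hdeg, ← multiset_prod_map_rpow R _ hR0 a, ← multiset_prod_map_rpow R _ hR1 b] at hprodle
  -- `M(P) = ‖c‖ ∏ max(1,|α|)`
  have hM : intMahlerMeasure P = ‖c‖ * (R.map fun α => max 1 ‖α‖).prod :=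
    mahlerMeasure_eq_leadingCoeff_mul_prod_roots PC
  set A0 := (R.map fun α => ‖(0 : ℂ) - α‖).prod with hA0
  set A1 := (R.map fun α => ‖(1 : ℂ) - α‖).prod with hA1
  have hA0n : 0 ≤ A0 := Multiset.prod_map_nonneg hR0
  have hA1n : 0 ≤ A1 := Multiset.prod_map_nonneg hR1
  have hcA0 : ‖c‖ * A0 = ‖PC.eval 0‖ := by rw [hnorm 0]
  have hcA1 : ‖c‖ * A1 = ‖PC.eval 1‖ := by rw [hnorm 1]
  have hc0 : 0 ≤ ‖c‖ := norm_nonneg _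
  have hlow : 1 ≤ ‖c‖ * (A0 ^ a * A1 ^ b) := by
    have hc1 : ‖c‖ = ‖c‖ ^ a * ‖c‖ ^ b * ‖c‖ ^ a := by
      rw [← Real.rpow_add' hc0 (by linarith), ← Real.rpow_add' hc0 (by linarith), h2ab, Real.rpow_one]
    have e : ‖c‖ * (A0 ^ a * A1 ^ b) = ‖c‖ ^ a * ((‖c‖ * A0) ^ a * (‖c‖ * A1) ^ b) := by
      rw [Real.mul_rpow hc0 hA0n, Real.mul_rpow hc0 hA1n]
      conv_lhs => rw [hc1]
      ring
    rw [e, hcA0, hcA1]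
    have h1' : 1 ≤ ‖c‖ ^ a := Real.one_le_rpow hcge ha0
    have h2' : 1 ≤ ‖PC.eval 0‖ ^ a := Real.one_le_rpow hge0 ha0
    have h3' : 1 ≤ ‖PC.eval 1‖ ^ b := Real.one_le_rpow hge1 hb0
    calc (1 : ℝ) = 1 * (1 * 1) := by ring
      _ ≤ ‖c‖ ^ a * (‖PC.eval 0‖ ^ a * ‖PC.eval 1‖ ^ b) :=
          mul_le_mul h1' (mul_le_mul h2' h3' zero_le_one (zero_le_one.trans h2')) (by positivity)
            (zero_le_one.trans h1')
  -- assemble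
  rw [hM]
  calc goldenRatio ^ P.natDegree = goldenRatio ^ P.natDegree * 1 := (mul_one _).symm
    _ ≤ goldenRatio ^ P.natDegree * (‖c‖ * (A0 ^ a * A1 ^ b)) :=
        mul_le_mul_of_nonneg_left hlow (by positivity)
    _ = ‖c‖ * (goldenRatio ^ P.natDegree * (A0 ^ a * A1 ^ b)) := by ring
    _ ≤ ‖c‖ * (R.map fun α => max 1 ‖α‖).prod := mul_le_mul_of_nonneg_left hprodle hc0

end Literature.NumberTheory.MahlerMeasure

end Part8

/-!
## Part 9 — port of `Summits/Ventures/DiscreteObjects/Mahler/CoresCertificateLift.lean` (1 declarations kept)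

# Lifting an `xsym`-quotiented CORES certificate to the typed L6 statement (venture `DiscreteObjects`, target L)

Cell `pub-namedobj`, seat `pub-namedobj-mahler` (gen 7). Framing: lottery ticket; floor = certified
bounds/negative ranges.

The CORES run of family L6c enumerates height-1 polynomials of degree `56` modulo the symmetries
`P ↦ -P` and `P ↦ P(-x)` (`METHOD-L6c.md`: "xsym = 1: first nonzero odd coefficient > 0").  Its
certificate therefore states `CyclotomicFreeHeight1Degree56SubLehmerEmpty` only for CANONICAL `P`:
positive leading coefficient and, among the odd-index coefficients `a₁, a₃, …`, the first nonzero one (if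
any) positive.  This file proves that the canonical statement implies the full typed statement
(`cyclotomicFreeHeight1Degree56SubLehmerEmpty_of_canonical`, any degree: `cyclotomicFree_slice_lift`),
using the invariances of degree, height, Mahler measure and cyclotomic-freeness under the two
symmetries (`Height1CellSymmetry`, `CyclotomicFreeNegX`, `GraeffeIdentity`).  Conventions checked
against `code/mahler6/job_bundle60/censusL/engineB.py` (monic, "first nonzero odd-index coefficient
must be > 0"; for a RECIPROCAL `P` of even degree the ascending and descending coefficient sequences
coincide, so the index convention is immaterial; for an ANTIreciprocal family the sign flips —
use `oddCanonical_or_comp_neg_X` with `P(-x)` in that case).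
-/

section Part9

namespace Literature.NumberTheory.MahlerMeasure

open _root_.Polynomial

/-- Odd-index coefficients change sign under `x ↦ -x`. [cite: MckeeSmyth2021, §1.2 p.21 (coefficients of p(−x))] -/
theorem coeff_comp_neg_X_odd (P : ℤ[X]) (i : ℕ) :
    (P.comp (-X)).coeff (2 * i + 1) = -P.coeff (2 * i + 1) := by
  induction P using Polynomial.induction_on' with
  | add p q hp hq => simp only [add_comp, coeff_add, hp, hq]; ring
  | monomial n a =>
    rw [monomial_comp, coeff_monomial]
    have e : (C a * (-X) ^ n : ℤ[X]) = C (a * (-1) ^ n) * X ^ n := by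
      rw [neg_pow, C_mul, C_pow, C_neg, C_1]; ring
    rw [e, coeff_C_mul_X_pow]
    by_cases hni : 2 * i + 1 = n
    · subst hni
      rw [if_pos rfl, if_pos rfl, Odd.neg_one_pow ⟨i, rfl⟩]; ring
    · rw [if_neg hni, if_neg (Ne.symm hni), neg_zero]

end Literature.NumberTheory.MahlerMeasure

end Part9

/-!
## Part 10 — port of `Summits/Ventures/DiscreteObjects/Mahler/SchinzelTotallyReal.lean` (2 declarations kept)

# Schinzel's theorem, totally real form: `M(P)² ≥ φ^{deg P}` (venture `DiscreteObjects`, target L)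

Cell `pub-namedobj`, seat `pub-namedobj-mahler` (gen 8). Framing: lottery ticket; floor = certified
bounds/negative ranges.

[McKee–Smyth, *Around the Unit Circle*, (14.17); Schinzel 1973.]  If `P ∈ ℤ[X]` has all its complex roots
real and `P(0) P(1) P(-1) ≠ 0`, then `φ^{deg P} ≤ M(P)²`, i.e. `M(P) ≥ φ^{deg P / 2}` — in particular a
totally real algebraic integer `α ≠ 0, ±1` of degree `d` has `M(α) ≥ ((1+√5)/2)^{d/2}`
(`goldenRatio_pow_le_mahlerMeasure_sq_of_totally_real`).

Proof: the Graeffe step.  `P(x)P(-x)` is even, hence `= Q(x²)` with `Q = contract 2 (P·P(-x)) ∈ ℤ[X]`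
(`exists_graeffe`); `Q` has degree `deg P`, `Q(0) = P(0)²`, `Q(1) = P(1)P(-1)`, its roots are the squares
`α²  > 0` of the roots of `P`, and `M(Q) = M(P)²` (`GraeffeIdentity`).  Apply the totally positive case
(`SchinzelTotallyPositive`) to `Q`.
-/

section Part10

namespace Literature.NumberTheory.MahlerMeasure

open _root_.Polynomial _root_.Real

/-- **Graeffe root-squaring in `ℤ[X]`.** For every `P ∈ ℤ[X]` there is `Q ∈ ℤ[X]` with
`Q(X²) = P(X) · P(-X)`. [cite: MckeeSmyth2021, Exercise 14.11 (Schinzel 1973: totally real ⇒ M ≥ φ^{deg/2})] -/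
theorem exists_graeffe (P : ℤ[X]) : ∃ Q : ℤ[X], Q.comp (X ^ 2) = P * P.comp (-X) := by
  set f : ℤ[X] := P * P.comp (-X) with hf
  -- `f` is even: `f(-X) = f`
  have heven : f.comp (-X) = f := by
    rw [hf, mul_comp, comp_assoc]
    have : ((-X : ℤ[X]).comp (-X)) = X := by simp
    rw [this, comp_X, mul_comm]
  have hodd : ∀ i : ℕ, f.coeff (2 * i + 1) = 0 := by
    intro i
    have h := coeff_comp_neg_X_odd f i
    rw [heven] at h
    linarith
  refine ⟨contract 2 f, ?_⟩
  rw [← expand_eq_comp_X_pow]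
  ext n
  rw [coeff_expand (by norm_num : 0 < 2), coeff_contract (by norm_num)]
  split_ifs with h
  · rw [Nat.div_mul_cancel h]
  · obtain ⟨i, hi⟩ : ∃ i, n = 2 * i + 1 := ⟨n / 2, by omega⟩
    rw [hi, hodd]

/-- **Schinzel's theorem, totally real form** [McKee–Smyth (14.17); Schinzel 1973]: if all complex roots
of `P ∈ ℤ[X]` are real and `P(0), P(1), P(-1) ≠ 0`, then `φ^{deg P} ≤ M(P)²`.
[cite: MckeeSmyth2021, Exercise 14.11 (Schinzel 1973: totally real ⇒ M ≥ φ^{deg/2})] -/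
theorem goldenRatio_pow_le_mahlerMeasure_sq_of_totally_real {P : ℤ[X]} (h0 : P.coeff 0 ≠ 0)
    (h1 : P.eval 1 ≠ 0) (hm1 : P.eval (-1) ≠ 0)
    (hreal : ∀ α ∈ (P.map (Int.castRingHom ℂ)).roots, α.im = 0) :
    goldenRatio ^ P.natDegree ≤ intMahlerMeasure P ^ 2 := by
  have hP0 : P ≠ 0 := by rintro rfl; exact h0 (coeff_zero 0)
  have hinj : Function.Injective (Int.castRingHom ℂ) := (Int.castRingHom ℂ).injective_int
  obtain ⟨Q, hQ⟩ := exists_graeffe P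
  have hnegX : (-X : ℤ[X]).natDegree = 1 := by rw [natDegree_neg, natDegree_X]
  have hPc0 : P.comp (-X) ≠ 0 := by
    intro h
    have := congrArg natDegree h
    rw [natDegree_comp, hnegX, mul_one, natDegree_zero] at this
    -- degree 0 and zero polynomial: then P constant... use eval at 0 instead
    have h2 := congrArg (fun q => q.eval 0) h
    simp only [eval_comp, eval_neg, eval_X, neg_zero, eval_zero] at h2
    rw [← coeff_zero_eq_eval_zero] at h2
    exact h0 h2
  have hf0 : P * P.comp (-X) ≠ 0 := mul_ne_zero hP0 hPc0
  -- degree of `Q`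
  have hQdeg : Q.natDegree = P.natDegree := by
    have h := congrArg natDegree hQ
    rw [natDegree_comp, natDegree_X_pow, natDegree_mul hP0 hPc0, natDegree_comp, hnegX, mul_one] at h
    omega
  -- `M(Q) = M(P)²`
  have hMQ : intMahlerMeasure Q = intMahlerMeasure P ^ 2 := by
    rw [← intMahlerMeasure_comp_X_pow_two, hQ, intMahlerMeasure_mul_comp_neg_X]
  -- `Q(0) ≠ 0`, `Q(1) ≠ 0`
  have hQ1 : Q.eval 1 ≠ 0 := by
    have h := congrArg (fun q => q.eval 1) hQ
    simp only [eval_comp, eval_pow, eval_X, one_pow, eval_mul, eval_neg] at h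
    rw [h]
    exact mul_ne_zero h1 hm1
  have hQ0 : Q.coeff 0 ≠ 0 := by
    have h := congrArg (fun q => q.eval 0) hQ
    simp only [eval_comp, eval_pow, eval_X, eval_mul, eval_neg, neg_zero] at h
    rw [zero_pow two_ne_zero] at h
    rw [coeff_zero_eq_eval_zero, h, ← coeff_zero_eq_eval_zero]
    exact mul_ne_zero h0 h0
  -- roots of `Q` over `ℂ` are squares of roots of `P`: positive reals
  have hPC0 : P.map (Int.castRingHom ℂ) ≠ 0 := (Polynomial.map_ne_zero_iff hinj).mpr hP0
  have hQC0 : Q.map (Int.castRingHom ℂ) ≠ 0 :=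
    (Polynomial.map_ne_zero_iff hinj).mpr (by rintro rfl; exact hQ0 (coeff_zero 0))
  have hQC : (Q.map (Int.castRingHom ℂ)).comp (X ^ 2) =
      P.map (Int.castRingHom ℂ) * (P.map (Int.castRingHom ℂ)).comp (-X) := by
    have h := congrArg (Polynomial.map (Int.castRingHom ℂ)) hQ
    rw [map_comp, Polynomial.map_pow, map_X, Polynomial.map_mul, map_comp, Polynomial.map_neg, map_X] at h
    exact h
  have hpos : ∀ β ∈ (Q.map (Int.castRingHom ℂ)).roots, β.im = 0 ∧ 0 < β.re := by
    intro β hβ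
    have hβroot : (Q.map (Int.castRingHom ℂ)).eval β = 0 := (mem_roots hQC0).mp hβ
    obtain ⟨γ, hγ⟩ := IsAlgClosed.exists_pow_nat_eq β (by norm_num : 0 < 2)
    -- `γ` or `-γ` is a root of `P`
    have hfγ : (P.map (Int.castRingHom ℂ)).eval γ * (P.map (Int.castRingHom ℂ)).eval (-γ) = 0 := by
      have h := congrArg (fun q => q.eval γ) hQC
      simp only [eval_comp, eval_pow, eval_X, eval_mul, eval_neg] at h
      rw [hγ, hβroot] at h
      exact h.symm
    have hroot : ∃ α ∈ (P.map (Int.castRingHom ℂ)).roots, α ^ 2 = β := by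
      rcases mul_eq_zero.mp hfγ with h | h
      · exact ⟨γ, (mem_roots hPC0).mpr h, hγ⟩
      · exact ⟨-γ, (mem_roots hPC0).mpr h, by rw [neg_sq, hγ]⟩
    obtain ⟨α, hα, hαβ⟩ := hroot
    have him := hreal α hα
    have hα0 : α ≠ 0 := by
      intro h
      have hr : (P.map (Int.castRingHom ℂ)).eval α = 0 := (mem_roots hPC0).mp hα
      rw [h, eval_map, eval₂_at_zero, eq_intCast, Int.cast_eq_zero] at hr
      exact h0 hr
    have hαre : α = ((α.re : ℝ) : ℂ) := by
      apply Complex.ext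
      · simp
      · simp [him]
    have hre0 : α.re ≠ 0 := by
      intro h
      apply hα0
      rw [hαre, h]; simp
    rw [← hαβ, hαre, ← Complex.ofReal_pow]
    refine ⟨Complex.ofReal_im _, ?_⟩
    rw [Complex.ofReal_re]
    positivity
  have h := goldenRatio_pow_le_mahlerMeasure_of_totally_positive hQ0 hQ1 hpos
  rw [hQdeg, hMQ] at h
  exact h

end Literature.NumberTheory.MahlerMeasure

end Part10

/-!
## Part 11 — port of `Summits/Ventures/DiscreteObjects/Mahler/LowDegreeCensus.lean` (7 declarations kept)

# Census rows of degrees 1, 2, 3 in the kernel (venture `DiscreteObjects`, target L)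

Cell `pub-namedobj`, seat `pub-namedobj-mahler` (gen 10). Framing: lottery ticket; floor = certified
bounds/negative ranges.

The census vocabulary of the cell (`DegreeCensus n B L`: every irreducible integer polynomial of degree
`n` with Mahler measure in `(1, B)` is, up to sign and `x ↦ -x`, in the list `L`) instantiated in the
three degrees where no computation is needed — the first rows of the table of minimal Mahler measures by
degree (Boyd 1980; Mossinghoff 1998), ZERO compute:

* degree 1: `degreeCensus_one` — `DegreeCensus 1 B []` for every `B ≤ 2` (`M(aX + b) = max(|a|,|b|) ∈ ℕ`);
* degree 2: `degreeCensus_two` — `DegreeCensus 2 2 [x² - x - 1]`: the irreducible quadratics with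
  `1 < M < 2` are `±(x² ± x - 1)` (measure `(1+√5)/2`); `degreeCensus_two_empty` — `DegreeCensus 2 B []`
  for `B ≤ (1+√5)/2`;
* degree 3: `degreeCensus_three` — `DegreeCensus 3 1.3248 [x³ - x - 1, x³ - x² + 1]`: by Smyth's theorem
  with its isolation and equality statements ([McKee–Smyth, Thm 12.1], kernel gen 8/9), an irreducible
  cubic — necessarily nonreciprocal with nonzero constant term — of measure `< 1.3248` has measure
  `θ₀ = 1.3247…` and is `±(x³ ∓ x ∓ 1)` or `±(x³ ∓ x² ± 1)`; `degreeCensus_three_empty` —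
  `DegreeCensus 3 B []` for `B ≤ θ₀`.
-/

section Part11

namespace Literature.NumberTheory.MahlerMeasure

open _root_.Polynomial

/-! ### Small tools -/

/-- An irreducible polynomial of degree `≥ 2` has no integer root (local copy of a standard fact).
[cite: MossinghoffRhinWu2008, Table 1 (minimal measures in degrees ≤ 3)] -/
private theorem not_isRoot_of_irreducible {p : ℤ[X]} (hirr : Irreducible p) (hdeg : 2 ≤ p.natDegree) (t : ℤ) :
    p.eval t ≠ 0 := by
  intro ht
  have hdvd : X - C t ∣ p := dvd_iff_isRoot.mpr ht
  have hass : Associated (X - C t) p := (irreducible_X_sub_C t).associated_of_dvd hirr hdvd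
  have h1 := natDegree_eq_of_degree_eq (degree_eq_degree_of_associated hass)
  rw [natDegree_X_sub_C] at h1
  omega

/-- An irreducible polynomial of degree `≥ 2` has nonzero constant term.
[cite: MossinghoffRhinWu2008, Table 1 (minimal measures in degrees ≤ 3)] -/
theorem coeff_zero_ne_zero_of_irreducible {p : ℤ[X]} (hirr : Irreducible p) (hdeg : 2 ≤ p.natDegree) :
    p.coeff 0 ≠ 0 := by
  rw [coeff_zero_eq_eval_zero]
  have h := not_isRoot_of_irreducible hirr hdeg 0
  rwa [show ((0 : ℤ) : ℤ) = 0 from rfl] at h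

/-- Normalisation to a monic polynomial: if `|lc(p)| = 1` then `m := C (lc p) * p` is monic, `p = C (lc p) * m`,
`M(m) = M(p)`, `deg m = deg p`, and `m` is irreducible iff `p` is.
[cite: MossinghoffRhinWu2008, Table 1 (minimal measures in degrees ≤ 3)] -/
theorem monic_normalisation {p : ℤ[X]} (hlc : p.leadingCoeff = 1 ∨ p.leadingCoeff = -1) :
    (C p.leadingCoeff * p).Monic ∧ p = C p.leadingCoeff * (C p.leadingCoeff * p) ∧
      intMahlerMeasure (C p.leadingCoeff * p) = intMahlerMeasure p ∧
      (C p.leadingCoeff * p).natDegree = p.natDegree ∧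
      (Irreducible p → Irreducible (C p.leadingCoeff * p)) := by
  have hs2 : p.leadingCoeff * p.leadingCoeff = 1 := by rcases hlc with h | h <;> simp [h]
  have hunit : IsUnit (C p.leadingCoeff) := isUnit_C.mpr (IsUnit.of_mul_eq_one _ hs2)
  have hs0 : p.leadingCoeff ≠ 0 := by rcases hlc with h | h <;> simp [h]
  refine ⟨?_, ?_, ?_, ?_, fun hirr => (irreducible_isUnit_mul hunit).mpr hirr⟩
  · rw [Monic, leadingCoeff_mul, leadingCoeff_C, hs2]
  · rw [← mul_assoc, ← C_mul, hs2, C_1, one_mul]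
  · rw [intMahlerMeasure_mul, intMahlerMeasure_C]
    rcases hlc with h | h <;> simp [h]
  · exact natDegree_C_mul hs0

/-- A root of a monic integer quadratic in `[lo, hi]` from a sign change, and the bound `M ≥ |r|`.
[cite: MossinghoffRhinWu2008, Table 1 (minimal measures in degrees ≤ 3)] -/
theorem le_intMahlerMeasure_of_sign_change {b : ℤ[X]} (hdeg : b.natDegree = 2) (hmonic : b.coeff 2 = 1)
    {lo hi : ℝ} (hlohi : lo ≤ hi)
    (hsign : (lo ^ 2 + (b.coeff 1 : ℝ) * lo + (b.coeff 0 : ℝ) ≤ 0 ∧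
        0 ≤ hi ^ 2 + (b.coeff 1 : ℝ) * hi + (b.coeff 0 : ℝ)) ∨
      (0 ≤ lo ^ 2 + (b.coeff 1 : ℝ) * lo + (b.coeff 0 : ℝ) ∧
        hi ^ 2 + (b.coeff 1 : ℝ) * hi + (b.coeff 0 : ℝ) ≤ 0)) :
    ∃ r : ℝ, lo ≤ r ∧ r ≤ hi ∧ |r| ≤ intMahlerMeasure b := by
  set f : ℝ → ℝ := fun x => x ^ 2 + (b.coeff 1 : ℝ) * x + (b.coeff 0 : ℝ) with hf
  have hcont : Continuous f := by rw [hf]; fun_prop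
  obtain ⟨r, hrI, hrf⟩ : ∃ r ∈ Set.Icc lo hi, f r = 0 := by
    rcases hsign with ⟨hlo, hhi⟩ | ⟨hlo, hhi⟩
    · exact intermediate_value_Icc hlohi hcont.continuousOn ⟨hlo, hhi⟩
    · exact intermediate_value_Icc' hlohi hcont.continuousOn ⟨hhi, hlo⟩
  have hmon : b.Monic := by rw [Monic, leadingCoeff, hdeg, hmonic]
  have hroot : aeval (r : ℂ) b = 0 := by
    rw [aeval_quadratic_real hdeg hmonic]
    have : f r = 0 := hrf
    rw [hf] at this
    simp only at this
    rw [this]; simp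
  have hle := norm_root_le_intMahlerMeasure hmon hroot
  rw [Complex.norm_real, Real.norm_eq_abs] at hle
  exact ⟨r, hrI.1, hrI.2, hle⟩

/-! ### Degree 1 -/

/-- **Monic irreducible quadratics of measure in `(1, 2)`** are `x² ± x - 1`.
[cite: MossinghoffRhinWu2008, Table 1 (minimal measures in degrees ≤ 3)] -/
theorem monic_quadratic_measure_lt_two {m : ℤ[X]} (hirr : Irreducible m) (hdeg : m.natDegree = 2)
    (hmonic : m.Monic) (h1 : 1 < intMahlerMeasure m) (h2 : intMahlerMeasure m < 2) :
    m.coeff 0 = -1 ∧ (m.coeff 1 = 1 ∨ m.coeff 1 = -1) := by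
  have hc2 : m.coeff 2 = 1 := by rw [← hdeg]; exact hmonic
  have hc0le : (|m.coeff 0| : ℝ) ≤ intMahlerMeasure m := abs_coeff_zero_le_intMahlerMeasure hmonic
  have hc0Z : |m.coeff 0| ≤ 1 := by
    by_contra h
    push Not at h
    have : (2 : ℝ) ≤ (|m.coeff 0| : ℝ) := by
      have : (2 : ℤ) ≤ |m.coeff 0| := h
      exact_mod_cast this
    linarith
  have hc0ne : m.coeff 0 ≠ 0 := coeff_zero_ne_zero_of_irreducible hirr (by omega)
  have hnoroot : ∀ t : ℤ, m.eval t ≠ 0 := not_isRoot_of_irreducible hirr (by omega)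
  have hm : m = X ^ 2 + C (m.coeff 1) * X + C (m.coeff 0) := quadratic_eq_of_coeff hdeg hc2
  set b := m.coeff 1 with hb
  set c := m.coeff 0 with hc
  have hcases : c = 1 ∨ c = -1 := by
    rcases abs_le.mp hc0Z with ⟨h1', h2'⟩
    omega
  rcases hcases with hc1 | hc1
  · -- `c = 1`: `|b| ≤ 2` gives measure `1` or a root `∓1`; `|b| ≥ 3` gives a real root of modulus `≥ 2`
    exfalso
    by_cases hb3 : 3 ≤ b
    · -- root in `[-b-1, -2]`
      have hbR : (3 : ℝ) ≤ b := by exact_mod_cast hb3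
      obtain ⟨r, hr1, hr2, hrM⟩ := le_intMahlerMeasure_of_sign_change hdeg hc2
        (lo := -(b : ℝ) - 1) (hi := -2) (by linarith)
        (Or.inr ⟨by rw [← hb, ← hc, hc1]; push_cast; nlinarith, by rw [← hb, ← hc, hc1]; push_cast; nlinarith⟩)
      have : (2 : ℝ) ≤ |r| := by rw [abs_of_neg (by linarith)]; linarith
      linarith
    by_cases hb3' : b ≤ -3
    · -- root in `[2, -b+1]`
      have hbR : (b : ℝ) ≤ -3 := by exact_mod_cast hb3'
      obtain ⟨r, hr1, hr2, hrM⟩ := le_intMahlerMeasure_of_sign_change hdeg hc2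
        (lo := 2) (hi := -(b : ℝ) + 1) (by linarith)
        (Or.inl ⟨by rw [← hb, ← hc, hc1]; push_cast; nlinarith, by rw [← hb, ← hc, hc1]; push_cast; nlinarith⟩)
      have : (2 : ℝ) ≤ |r| := by rw [abs_of_pos (by linarith)]; linarith
      linarith
    -- `|b| ≤ 2`: measure one
    push Not at hb3 hb3'
    have hM1 : intMahlerMeasure m = 1 := by
      rcases le_or_gt b (-2) with hb2 | hb2
      · -- b = -2: m = (X - 1)², root 1
        exfalso
        have hb2' : b = -2 := by omega
        apply hnoroot 1
        rw [hm, hc1, hb2']; simp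
      rcases le_or_gt 2 b with hb2' | hb2'
      · exfalso
        have hb2'' : b = 2 := by omega
        apply hnoroot (-1)
        rw [hm, hc1, hb2'']; simp
      -- `-2 < b < 2`: `x² + bx + 1 = x² - (-b) x + 1` with `|-b| < 2`
      have hmC : m.map (Int.castRingHom ℂ) = X ^ 2 - C (((-b : ℤ) : ℝ) : ℂ) * X + 1 := by
        rw [hm, hc1]
        simp only [Polynomial.map_add, Polynomial.map_mul, Polynomial.map_pow, map_X, Polynomial.map_C]
        simp only [eq_intCast, Int.cast_neg, Complex.ofReal_neg, Complex.ofReal_intCast, map_neg, map_one]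
        ring
      unfold intMahlerMeasure
      rw [hmC]
      exact mahlerMeasure_quad_of_abs_lt_two (by exact_mod_cast (show (-2 : ℤ) < -b by omega))
        (by exact_mod_cast (show -b < (2 : ℤ) by omega))
    linarith
  · -- `c = -1`: `b = 0` is reducible; `|b| ≥ 2` gives a real root of modulus `≥ 2`; `|b| = 1` remains
    refine ⟨hc1, ?_⟩
    by_cases hb2 : 2 ≤ b
    · exfalso
      have hbR : (2 : ℝ) ≤ b := by exact_mod_cast hb2
      obtain ⟨r, hr1, hr2, hrM⟩ := le_intMahlerMeasure_of_sign_change hdeg hc2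
        (lo := -(b : ℝ) - 1) (hi := -2) (by linarith)
        (Or.inr ⟨by rw [← hb, ← hc, hc1]; push_cast; nlinarith, by rw [← hb, ← hc, hc1]; push_cast; nlinarith⟩)
      have : (2 : ℝ) ≤ |r| := by rw [abs_of_neg (by linarith)]; linarith
      linarith
    by_cases hb2' : b ≤ -2
    · exfalso
      have hbR : (b : ℝ) ≤ -2 := by exact_mod_cast hb2'
      obtain ⟨r, hr1, hr2, hrM⟩ := le_intMahlerMeasure_of_sign_change hdeg hc2
        (lo := 2) (hi := -(b : ℝ) + 1) (by linarith)
        (Or.inl ⟨by rw [← hb, ← hc, hc1]; push_cast; nlinarith, by rw [← hb, ← hc, hc1]; push_cast; nlinarith⟩)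
      have : (2 : ℝ) ≤ |r| := by rw [abs_of_pos (by linarith)]; linarith
      linarith
    push Not at hb2 hb2'
    have hb0 : b ≠ 0 := by
      intro hb0
      apply hnoroot 1
      rw [hm, hc1, hb0]; simp
    omega

/-- **Degree-2 census row:** `DegreeCensus 2 2 [x² - x - 1]` — every irreducible integer quadratic with
`1 < M < 2` is `±(x² - x - 1)` or `±(x² + x - 1)` (measure `(1+√5)/2`).
[cite: MossinghoffRhinWu2008, Table 1 (minimal measures in degrees ≤ 3)] -/
theorem degreeCensus_two : DegreeCensus 2 2 [[-1, -1, 1]] := by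
  intro p hdeg hirr h1 h2
  -- `|lc(p)| = 1`
  have hlc : (|p.leadingCoeff| : ℝ) ≤ intMahlerMeasure p := abs_leadingCoeff_le_intMahlerMeasure p
  have hlc1 : p.leadingCoeff = 1 ∨ p.leadingCoeff = -1 := by
    have hne : p.leadingCoeff ≠ 0 := leadingCoeff_ne_zero.mpr hirr.ne_zero
    have hle : |p.leadingCoeff| ≤ 1 := by
      by_contra h
      push Not at h
      have : (2 : ℝ) ≤ (|p.leadingCoeff| : ℝ) := by
        have : (2 : ℤ) ≤ |p.leadingCoeff| := h
        exact_mod_cast this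
      linarith
    rcases abs_le.mp hle with ⟨h1', h2'⟩
    omega
  obtain ⟨hmonic, hpm, hMm, hdegm, hirrm⟩ := monic_normalisation hlc1
  set m := C p.leadingCoeff * p with hmdef
  rw [← hMm] at h1 h2
  rw [hdeg] at hdegm
  obtain ⟨hc0, hb⟩ := monic_quadratic_measure_lt_two (hirrm hirr) hdegm hmonic h1 h2
  have hm : m = X ^ 2 + C (m.coeff 1) * X + C (m.coeff 0) :=
    quadratic_eq_of_coeff hdegm (by rw [← hdegm]; exact hmonic)
  have hℓ : ofCoeffs [-1, -1, 1] = (X ^ 2 - X - 1 : ℤ[X]) := by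
    unfold ofCoeffs; simp [List.zipIdx]; ring
  refine ⟨[-1, -1, 1], List.mem_singleton.mpr rfl, ?_⟩
  rw [hℓ, hpm]
  rcases hb with hb | hb
  · have hm' : m = X ^ 2 + C (1 : ℤ) * X + C (-1) := by rw [hm, hb, hc0]
    rw [hm']
    rcases hlc1 with hs | hs <;> rw [hs]
    · right; right; left
      simp only [map_one, one_mul, map_neg, sub_comp, pow_comp, X_comp, one_comp]; ring
    · right; right; right
      simp only [map_one, one_mul, map_neg, sub_comp, pow_comp, X_comp, one_comp]; ring
  · have hm' : m = X ^ 2 + C (-1 : ℤ) * X + C (-1) := by rw [hm, hb, hc0]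
    rw [hm']
    rcases hlc1 with hs | hs <;> rw [hs]
    · left
      simp only [map_one, map_neg]; ring
    · right; left
      simp only [map_one, map_neg]; ring

/-- **Degree-2 census row, empty form:** `DegreeCensus 2 B []` for `B ≤ (1+√5)/2`: no integer quadratic
has Mahler measure in `(1, (1+√5)/2)`. [cite: MossinghoffRhinWu2008, Table 1 (minimal measures in degrees ≤ 3)] -/
theorem degreeCensus_two_empty {B : ℝ} (hB : B ≤ (1 + Real.sqrt 5) / 2) : DegreeCensus 2 B [] := by
  intro p hdeg hirr h1 h2
  exfalso
  have hφ2 : (1 + Real.sqrt 5) / 2 < 2 := by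
    have : Real.sqrt 5 < 3 := by
      rw [show (3 : ℝ) = Real.sqrt 9 by rw [show (9:ℝ) = 3 ^ 2 by norm_num, Real.sqrt_sq (by norm_num)]]
      exact Real.sqrt_lt_sqrt (by norm_num) (by norm_num)
    linarith
  obtain ⟨l, hl, hpl⟩ := degreeCensus_two p hdeg hirr h1 (lt_of_lt_of_le h2 (hB.trans hφ2.le))
  rw [List.mem_singleton] at hl
  subst hl
  have hℓ : ofCoeffs [-1, -1, 1] = (X ^ 2 - X - 1 : ℤ[X]) := by
    unfold ofCoeffs; simp [List.zipIdx]; ring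
  rw [hℓ] at hpl
  have hMℓ : intMahlerMeasure (X ^ 2 - X - 1 : ℤ[X]) = Real.goldenRatio := intMahlerMeasure_X_sq_sub_X_sub_one
  have hMp : intMahlerMeasure p = Real.goldenRatio := by
    rcases hpl with h | h | h | h <;> rw [h]
    · exact hMℓ
    · rw [intMahlerMeasure_neg, hMℓ]
    · rw [intMahlerMeasure_comp_neg_X, hMℓ]
    · rw [intMahlerMeasure_neg, intMahlerMeasure_comp_neg_X, hMℓ]
  rw [hMp, Real.goldenRatio] at h2
  linarith

/-! ### Degree 3 -/

end Literature.NumberTheory.MahlerMeasure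

end Part11

/-!
## Part 12 — port of `Summits/Ventures/DiscreteObjects/Mahler/QuarticCensusTools.lean` (5 declarations kept)

# Tools for the degree-4 census row (venture `DiscreteObjects`, target L)

Cell `pub-namedobj`, seat `pub-namedobj-mahler` (gen 10). Framing: lottery ticket; floor = certified
bounds/negative ranges.

Lemmas used by `PalindromicQuartic` / `QuarticCensus` (`DegreeCensus 4 1.3248 []`):
(the distinctness of the complex roots of an irreducible integer polynomial is `nodup_roots_of_irreducible`,
gen 8, `PisotLowerBound`);
* `root_ne_inv_of_irreducible` — a root `β` of an irreducible `P` of degree `≥ 2` has `β ≠ 0`, `β ≠ β⁻¹`;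
* `norm_prod_sub_le_two_pow` — `|∏_T (ε - β)| ≤ 2^{|T|}` for `|ε| = 1`, `T` in the closed unit disc;
* `palindromic_quartic_eq` — a monic palindromic quartic is `x⁴ + ax³ + bx² + ax + 1`;
* `trace_root_quadratic` — `y = α + α⁻¹` satisfies `y² + ay + (b-2) = 0`;
* `im_sq_ge_of_int_quadratic` — a non-real root `y` of `y² + ay + c` (`a, c ∈ ℤ`) has `Im(y)² ≥ 3/4`
  (`4 Im(y)² = 4c - a²` is a positive integer `≡ 0, 3 (mod 4)`).
-/

section Part12

namespace Literature.NumberTheory.MahlerMeasure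

open _root_.Polynomial
open scoped ComplexConjugate

/-! ### Tools -/

/-- A root `β` of an irreducible `P ∈ ℤ[X]` of degree `≥ 2` satisfies `β ≠ β⁻¹` and `β ≠ 0`.
[cite: MossinghoffRhinWu2008, Table 1 (degree 4; tools)] -/
theorem root_ne_inv_of_irreducible {P : ℤ[X]} (hirr : Irreducible P) (hdeg : 2 ≤ P.natDegree) {β : ℂ}
    (hβ : β ∈ (P.map (Int.castRingHom ℂ)).roots) : β ≠ 0 ∧ β ≠ β⁻¹ := by
  have hP' : P.map (Int.castRingHom ℂ) ≠ 0 :=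
    (Polynomial.map_ne_zero_iff (Int.castRingHom ℂ).injective_int).mpr hirr.ne_zero
  have hroot : aeval β P = 0 := by
    have := (mem_roots hP').mp hβ
    rwa [IsRoot.def, ← algebraMap_int_eq, eval_map_algebraMap] at this
  have key : ∀ t : ℤ, P.eval t ≠ 0 := by
    intro t ht
    have hdvd : X - C t ∣ P := dvd_iff_isRoot.mpr ht
    have hass : Associated (X - C t) P := (irreducible_X_sub_C t).associated_of_dvd hirr hdvd
    have h1 := natDegree_eq_of_degree_eq (degree_eq_degree_of_associated hass)
    rw [natDegree_X_sub_C] at h1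
    omega
  have hint : ∀ t : ℤ, β = (t : ℂ) → False := by
    intro t ht
    apply key t
    have h2 : (algebraMap ℤ ℂ) (P.eval t) = 0 := by
      rw [← aeval_algebraMap_apply_eq_algebraMap_eval, algebraMap_int_eq, eq_intCast, ← ht]
      exact hroot
    rw [algebraMap_int_eq, eq_intCast, Int.cast_eq_zero] at h2
    exact h2
  have hβ0 : β ≠ 0 := fun h0 => hint 0 (by rw [h0]; simp)
  constructor
  · exact hβ0
  · intro h
    have h2 : β * β = 1 := by
      conv_lhs => rhs
                  rw [h]
      exact mul_inv_cancel₀ hβ0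
    rcases mul_self_eq_one_iff.mp h2 with h1 | h1
    · exact hint 1 (by rw [h1]; simp)
    · exact hint (-1) (by rw [h1]; simp)

/-- `|∏_{T} (ε - β)| ≤ 2^{|T|}` when `|ε| = 1` and all `β ∈ T` lie in the closed unit disc.
[cite: MossinghoffRhinWu2008, Table 1 (degree 4; tools)] -/
theorem norm_prod_sub_le_two_pow (T : Multiset ℂ) (ε : ℂ) (hε : ‖ε‖ = 1) (hT : ∀ β ∈ T, ‖β‖ ≤ 1) :
    ‖(T.map fun β => ε - β).prod‖ ≤ 2 ^ Multiset.card T := by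
  rw [← normHom_apply, map_multiset_prod, Multiset.map_map]
  have h : (T.map (⇑normHom ∘ fun β => ε - β)).prod ≤ (T.map fun _ => (2 : ℝ)).prod := by
    refine Multiset.prod_map_le_prod_map₀ _ _ (fun β _ => by simp) (fun β hβ => ?_)
    simp only [Function.comp_apply, normHom_apply]
    calc ‖ε - β‖ ≤ ‖ε‖ + ‖β‖ := norm_sub_le _ _
      _ ≤ 1 + 1 := add_le_add hε.le (hT β hβ)
      _ = 2 := by norm_num
  rwa [Multiset.map_const', Multiset.prod_replicate] at h

/-! ### The reciprocal (palindromic) monic quartic -/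

/-- Coefficient form of a monic palindromic quartic. [cite: MossinghoffRhinWu2008, Table 1 (degree 4; tools)] -/
theorem palindromic_quartic_eq {m : ℤ[X]} (hdeg : m.natDegree = 4) (hmonic : m.Monic) (hrev : m.reverse = m) :
    m = X ^ 4 + C (m.coeff 3) * X ^ 3 + C (m.coeff 2) * X ^ 2 + C (m.coeff 3) * X + 1 := by
  have hc4 : m.coeff 4 = 1 := by rw [← hdeg]; exact hmonic
  have hc0 : m.coeff 0 = 1 := by
    conv_lhs => rw [← hrev]
    rw [coeff_zero_reverse]; exact hmonic
  have hc1 : m.coeff 1 = m.coeff 3 := by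
    conv_lhs => rw [← hrev, coeff_reverse, hdeg, show revAt 4 1 = 3 by decide]
  have h := m.as_sum_range_C_mul_X_pow
  rw [hdeg] at h
  conv_lhs => rw [h]
  simp only [Finset.sum_range_succ, Finset.sum_range_zero, zero_add, pow_zero, mul_one, pow_one]
  rw [hc0, hc1, hc4, map_one, one_mul]
  ring

/-- The trace relation: for a root `α ≠ 0` of `x⁴ + ax³ + bx² + ax + 1`, `y = α + α⁻¹` satisfies
`y² + ay + (b - 2) = 0`. [cite: MossinghoffRhinWu2008, Table 1 (degree 4; tools)] -/
theorem trace_root_quadratic {a b : ℂ} {α : ℂ} (hα : α ≠ 0)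
    (h : α ^ 4 + a * α ^ 3 + b * α ^ 2 + a * α + 1 = 0) :
    (α + α⁻¹) ^ 2 + a * (α + α⁻¹) + (b - 2) = 0 := by
  have h2 : α ^ 2 ≠ 0 := pow_ne_zero 2 hα
  have : (α + α⁻¹) ^ 2 + a * (α + α⁻¹) + (b - 2) = (α ^ 4 + a * α ^ 3 + b * α ^ 2 + a * α + 1) / α ^ 2 := by
    field_simp
    ring
  rw [this, h, zero_div]

/-- If `y` is a non-real root of `y² + ay + c` with `a, c ∈ ℤ`, then `4 (Im y)² = 4c - a² ≥ 3`, hence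
`(Im y)² ≥ 3/4`. [cite: MossinghoffRhinWu2008, Table 1 (degree 4; tools)] -/
theorem im_sq_ge_of_int_quadratic {a c : ℤ} {y : ℂ} (h : y ^ 2 + (a : ℂ) * y + (c : ℂ) = 0) (hy : y.im ≠ 0) :
    (3 : ℝ) / 4 ≤ y.im ^ 2 := by
  -- real and imaginary parts
  have hre : y.re ^ 2 - y.im ^ 2 + a * y.re + c = 0 := by
    have := congrArg Complex.re h
    simp [pow_two] at this
    linarith [this]
  have him : 2 * y.re * y.im + a * y.im = 0 := by
    have := congrArg Complex.im h
    simp [pow_two] at this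
    linarith [this]
  have hre' : y.re = -(a : ℝ) / 2 := by
    have : y.im * (2 * y.re + a) = 0 := by linear_combination him
    rcases mul_eq_zero.mp this with h1 | h1
    · exact absurd h1 hy
    · linarith
  have hN : 4 * y.im ^ 2 = (4 * c - a ^ 2 : ℤ) := by
    push_cast
    rw [hre'] at hre
    linear_combination -4 * hre
  -- `N = 4c - a²` is a positive integer `≡ 0, 3 (mod 4)`, hence `≥ 3`
  have hNpos : 0 < 4 * c - a ^ 2 := by
    have : (0 : ℝ) < 4 * y.im ^ 2 := by positivity
    rw [hN] at this
    exact_mod_cast this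
  have hN3 : 3 ≤ 4 * c - a ^ 2 := by
    rcases Int.even_or_odd a with ⟨t, ht⟩ | ⟨t, ht⟩
    · subst ht
      have h4 : 4 * c - (t + t) ^ 2 = 4 * (c - t ^ 2) := by ring
      rw [h4] at hNpos ⊢
      omega
    · subst ht
      have h4 : 4 * c - (2 * t + 1) ^ 2 = 4 * (c - t ^ 2 - t) - 1 := by ring
      rw [h4] at hNpos ⊢
      omega
  have : (3 : ℝ) ≤ 4 * y.im ^ 2 := by rw [hN]; exact_mod_cast hN3
  linarith

end Literature.NumberTheory.MahlerMeasure

end Part12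

/-!
## Part 13 — port of `Summits/Ventures/DiscreteObjects/Mahler/UnimodularRootReciprocal.lean` (6 declarations kept)

# An irreducible integer polynomial with a unimodular root is reciprocal (venture `DiscreteObjects`, target L)

Cell `pub-namedobj`, seat `pub-namedobj-mahler` (gen 10). Framing: lottery ticket; floor = certified
bounds/negative ranges.

[McKee–Smyth, *Around the Unit Circle*, Exercise 12.15]: if an irreducible `P ∈ ℤ[z]` has a zero of
modulus `1`, then `P` is self-reciprocal (`P* = ±P`).  With [McKee–Smyth, Exercise A.5]: a self-reciprocal
irreducible integer polynomial is `±(z - 1)`, `±(z + 1)`, or palindromic (`P* = P`) of even degree.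
For the census (target L) this is the structural reason why Salem and cyclotomic factors, and every
irreducible polynomial met on the unit circle, live in the reciprocal search space.

Kernel route: `ᾱ = α⁻¹` is a root of `P`, so `α` is a common root of `P` and `P* = P.reverse`; an
irreducible `P` of positive degree divides every integer polynomial vanishing at one of its roots
(`dvd_of_aeval_eq_zero_of_irreducible`: Gauss's lemma and the minimal polynomial over `ℚ`); comparing
`P ∣ P*` with `deg P* ≤ deg P` and the extreme coefficients gives `P* = ±P`; `P* = -P` forces `P(1) = 0`
and odd degree with `P* = P` forces `P(-1) = 0`.

* `dvd_of_aeval_eq_zero_of_irreducible` — common complex root with an irreducible `P` ⇒ `P ∣ Q`;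
* `aeval_reverse_eq_zero_of_norm_eq_one` — a unimodular root of `P` is a root of `P.reverse`;
* `reverse_eq_or_eq_neg_of_irreducible_of_unimodular_root` — **Exercise 12.15**;
* `reverse_eq_self_of_irreducible_of_unimodular_root` — degree `≥ 2`: `P.reverse = P` and `deg P` even.
-/

section Part13

namespace Literature.NumberTheory.MahlerMeasure

open _root_.Polynomial

/-- **Common root ⇒ divisibility.** If `P ∈ ℤ[X]` is irreducible of positive degree and `α ∈ ℂ` is a
common root of `P` and `Q ∈ ℤ[X]`, then `P ∣ Q` in `ℤ[X]` (the minimal polynomial of `α` over `ℚ` is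
`P/lc(P)` by Gauss's lemma, and divides `Q`).
[cite: MckeeSmyth2021, Exercise 12.15 p.208 (a unimodular root forces P* = ±P)] -/
theorem dvd_of_aeval_eq_zero_of_irreducible {P Q : ℤ[X]} (hirr : Irreducible P)
    (hdeg : 0 < P.natDegree) {α : ℂ} (hP : aeval α P = 0) (hQ : aeval α Q = 0) : P ∣ Q := by
  have hprim : P.IsPrimitive := hirr.isPrimitive hdeg.ne'
  have hPQ : Irreducible (P.map (algebraMap ℤ ℚ)) :=
    (hprim.irreducible_iff_irreducible_map_fraction_map (K := ℚ)).mp hirr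
  have hαP : aeval α (P.map (algebraMap ℤ ℚ)) = 0 := by rwa [aeval_map_algebraMap]
  have hmin := minpoly.eq_of_irreducible hPQ hαP
  have hαQ : aeval α (Q.map (algebraMap ℤ ℚ)) = 0 := by rwa [aeval_map_algebraMap]
  have h1 : minpoly ℚ α ∣ Q.map (algebraMap ℤ ℚ) := minpoly.dvd ℚ α hαQ
  have h2 : P.map (algebraMap ℤ ℚ) ∣ Q.map (algebraMap ℤ ℚ) := by
    rw [← hmin] at h1
    exact (dvd_mul_right _ _).trans h1
  exact (hprim.dvd_iff_fraction_map_dvd_fraction_map ℚ).mpr h2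

/-- Complex conjugates of roots of an integer polynomial are roots.
[cite: MckeeSmyth2021, Exercise 12.15 p.208 (a unimodular root forces P* = ±P)] -/
theorem aeval_conj_eq_zero {P : ℤ[X]} {α : ℂ} (hP : aeval α P = 0) : aeval (starRingEnd ℂ α) P = 0 := by
  have h := aeval_algHom_apply ((starRingEnd ℂ).toIntAlgHom) α P
  rw [RingHom.toIntAlgHom_apply, hP, map_zero] at h
  exact h

/-- **A unimodular root of `P ∈ ℤ[X]` is a root of `P.reverse`:** if `‖α‖ = 1` and `P(α) = 0` then
`P*(α) = 0`, because `P(α⁻¹) = P(ᾱ) = 0`.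
[cite: MckeeSmyth2021, Exercise 12.15 p.208 (a unimodular root forces P* = ±P)] -/
theorem aeval_reverse_eq_zero_of_norm_eq_one {P : ℤ[X]} {α : ℂ} (hα : ‖α‖ = 1) (hP : aeval α P = 0) :
    aeval α P.reverse = 0 := by
  have hα0 : α ≠ 0 := by
    intro h
    rw [h, norm_zero] at hα
    exact zero_ne_one hα
  have hconj : aeval α⁻¹ P = 0 := by
    rw [Complex.inv_eq_conj hα]
    exact aeval_conj_eq_zero hP
  letI : Invertible α := invertibleOfNonzero hα0
  have h := (eval₂_reverse_eq_zero_iff (algebraMap ℤ ℂ) α⁻¹ P).mpr (by rwa [aeval_def] at hconj)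
  rwa [invOf_eq_inv, inv_inv, ← aeval_def] at h

/-- If `P ∣ P.reverse` in `ℤ[X]` and `P(0) ≠ 0`, then `P.reverse = ±P`.
[cite: MckeeSmyth2021, Exercise 12.15 p.208 (a unimodular root forces P* = ±P)] -/
theorem reverse_eq_or_eq_neg_of_dvd_reverse {P : ℤ[X]} (h0 : P.coeff 0 ≠ 0) (hdvd : P ∣ P.reverse) :
    P.reverse = P ∨ P.reverse = -P := by
  have hP0 : P ≠ 0 := fun h => h0 (by rw [h, coeff_zero])
  obtain ⟨R, hR⟩ := hdvd
  have hrev0 : P.reverse ≠ 0 := by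
    intro h
    have := congrArg (fun p : ℤ[X] => p.coeff 0) h
    simp only [coeff_zero_reverse, coeff_zero, leadingCoeff_eq_zero] at this
    exact hP0 this
  have hR0 : R ≠ 0 := by
    rintro rfl
    rw [mul_zero] at hR
    exact hrev0 hR
  -- degrees: `deg P* ≤ deg P` forces `R` constant
  have hdegR : R.natDegree = 0 := by
    have h1 : P.reverse.natDegree = P.natDegree + R.natDegree := by rw [hR, natDegree_mul hP0 hR0]
    have h2 := reverse_natDegree_le P
    omega
  obtain ⟨r, hr⟩ : ∃ r : ℤ, R = C r := ⟨R.coeff 0, eq_C_of_natDegree_eq_zero hdegR⟩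
  rw [hr] at hR
  -- compare constant and leading coefficients: `lc P = r · P(0)` and `P(0) = r · lc P`
  have htrail : P.natTrailingDegree = 0 := natTrailingDegree_eq_zero.mpr (Or.inr h0)
  have hc0 : P.leadingCoeff = P.coeff 0 * r := by
    have := congrArg (fun p : ℤ[X] => p.coeff 0) hR
    simp only [coeff_zero_reverse, coeff_mul_C] at this
    exact this
  have hlc : P.coeff 0 = P.leadingCoeff * r := by
    have := congrArg Polynomial.leadingCoeff hR
    rw [leadingCoeff_mul, leadingCoeff_C, reverse_leadingCoeff, trailingCoeff, htrail] at this
    exact this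
  have hr1 : r * r = 1 := by
    have h3 : P.coeff 0 * (r * r - 1) = 0 := by
      have : P.coeff 0 = P.coeff 0 * r * r := by rw [← hc0]; exact hlc
      linear_combination -this
    rcases mul_eq_zero.mp h3 with h | h
    · exact absurd h h0
    · linarith
  rcases Int.eq_one_or_neg_one_of_mul_eq_one hr1 with h | h
  · left
    rw [hR, h, map_one, mul_one]
  · right
    rw [hR, h, map_neg, map_one, mul_neg, mul_one]

/-- **[McKee–Smyth, Exercise 12.15]** An irreducible `P ∈ ℤ[X]` with a complex zero of modulus `1` is
self-reciprocal: `P.reverse = P` or `P.reverse = -P`.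
[cite: MckeeSmyth2021, Exercise 12.15 p.208 (a unimodular root forces P* = ±P)] -/
theorem reverse_eq_or_eq_neg_of_irreducible_of_unimodular_root {P : ℤ[X]} (hirr : Irreducible P)
    {α : ℂ} (hα : ‖α‖ = 1) (hP : aeval α P = 0) : P.reverse = P ∨ P.reverse = -P := by
  -- `P` has positive degree (it has a root) and `P(0) ≠ 0` (else `P = ±X`, which has no unimodular root)
  have hdeg : 0 < P.natDegree := by
    by_contra hd
    push Not at hd
    have hc := eq_C_of_natDegree_eq_zero (Nat.le_zero.mp hd)
    rw [hc, aeval_C, algebraMap_int_eq, eq_intCast, Int.cast_eq_zero] at hP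
    rw [hc, hP, map_zero] at hirr
    exact not_irreducible_zero hirr
  have h0 : P.coeff 0 ≠ 0 := by
    intro h
    have hX : X ∣ P := X_dvd_iff.mpr h
    have hass : Associated X P := irreducible_X.associated_of_dvd hirr hX
    obtain ⟨u, hu⟩ := hass
    obtain ⟨c, -, hcu⟩ := Polynomial.isUnit_iff.mp u.isUnit
    have hα0 : α = 0 := by
      rw [← hu, ← hcu, map_mul, aeval_X, aeval_C, mul_eq_zero] at hP
      rcases hP with h | h
      · exact h
      · exfalso
        rw [algebraMap_int_eq, eq_intCast, Int.cast_eq_zero] at h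
        rw [h, map_zero] at hcu
        exact u.ne_zero hcu.symm
    rw [hα0, norm_zero] at hα
    exact zero_ne_one hα
  exact reverse_eq_or_eq_neg_of_dvd_reverse h0
    (dvd_of_aeval_eq_zero_of_irreducible hirr hdeg hP (aeval_reverse_eq_zero_of_norm_eq_one hα hP))

/-- **[McKee–Smyth, Exercises 12.15 and A.5]** An irreducible `P ∈ ℤ[X]` of degree `≥ 2` with a complex
zero of modulus `1` is reciprocal with palindromic coefficients (`P.reverse = P`) and has even degree.
(`P.reverse = -P` would give `P(1) = 0`, and odd degree would give `P(-1) = 0`, contradicting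
irreducibility in degree `≥ 2`.) [cite: MckeeSmyth2021, Exercise 12.15 p.208 (a unimodular root forces P* = ±P)] -/
theorem reverse_eq_self_of_irreducible_of_unimodular_root {P : ℤ[X]} (hirr : Irreducible P)
    (hdeg : 2 ≤ P.natDegree) {α : ℂ} (hα : ‖α‖ = 1) (hP : aeval α P = 0) :
    P.reverse = P ∧ Even P.natDegree := by
  -- an irreducible polynomial of degree ≥ 2 has no integer root
  have hnoroot : ∀ t : ℤ, P.eval t ≠ 0 := by
    intro t ht
    have hdvd : X - C t ∣ P := dvd_iff_isRoot.mpr ht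
    have hass : Associated (X - C t) P := (irreducible_X_sub_C t).associated_of_dvd hirr hdvd
    have h1 := natDegree_eq_of_degree_eq (degree_eq_degree_of_associated hass)
    rw [natDegree_X_sub_C] at h1
    omega
  rcases reverse_eq_or_eq_neg_of_irreducible_of_unimodular_root hirr hα hP with hrev | hrev
  · refine ⟨hrev, ?_⟩
    by_contra hodd
    rw [Nat.not_even_iff_odd] at hodd
    exact hnoroot (-1) (eval_neg_one_eq_zero_of_reverse_eq hrev hodd)
  · exact absurd (eval_one_eq_zero_of_reverse_eq_neg hrev) (hnoroot 1)

end Literature.NumberTheory.MahlerMeasure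

end Part13

/-!
## Part 14 — port of `Summits/Ventures/DiscreteObjects/Mahler/SalemStructure.lean` (3 declarations kept)

# Salem structure from the root count (venture `DiscreteObjects`, target L)

Cell `pub-namedobj`, seat `pub-namedobj-mahler` (gen 10). Framing: lottery ticket; floor = certified
bounds/negative ranges.

[McKee–Smyth, *Around the Unit Circle*, §5 / glossary "Salem polynomial", Exercise 12.15]: an
irreducible integer polynomial with exactly ONE complex root `α` outside the closed unit disc (all other
roots in `|z| ≤ 1`) and at least one root ON the unit circle is a Salem-type polynomial: it is reciprocal
of even degree, `α` is real, `α⁻¹` is a root, every other root is unimodular, and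
`M(P) = |lc(P)|·|α|`.  (For monic `P` and `α > 0` this says `α` is a Salem number with minimal
polynomial `P`; `lehmer_salem` (gen 9) is the instance `P = L`, Lehmer's polynomial.)

Kernel route: `P` is reciprocal by `reverse_eq_self_of_irreducible_of_unimodular_root` (Exercise
12.15), so its root multiset is closed under `β ↦ β⁻¹` as well as under complex conjugation; `ᾱ` is a
root outside the unit disc, hence `ᾱ = α`; a root `β` with `|β| < 1` has `β⁻¹` outside, hence
`β⁻¹ = α`.

* `mem_roots_inv_of_reverse_eq` — roots of a reciprocal integer polynomial are closed under inversion;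
* `salem_structure_of_irreducible` — the theorem.
-/

section Part14

namespace Literature.NumberTheory.MahlerMeasure

open _root_.Polynomial
open scoped ComplexConjugate

/-- Roots of a reciprocal (`P.reverse = P`) integer polynomial are closed under `β ↦ β⁻¹`.
[cite: MckeeSmyth2021, Exercise 12.15 p.208 with §5 (Salem polynomials)] -/
theorem mem_roots_inv_of_reverse_eq {P : ℤ[X]} (hrev : P.reverse = P) (hP : P ≠ 0) {β : ℂ}
    (hβ : β ∈ (P.map (Int.castRingHom ℂ)).roots) : β⁻¹ ∈ (P.map (Int.castRingHom ℂ)).roots := by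
  have hP' : P.map (Int.castRingHom ℂ) ≠ 0 := (Polynomial.map_ne_zero_iff (Int.castRingHom ℂ).injective_int).mpr hP
  rw [mem_roots hP', IsRoot.def, eval_map] at hβ ⊢
  have hβ0 : β ≠ 0 := by
    rintro rfl
    -- `P(0) = 0` would make `X ∣ P`, but `P.reverse = P` has nonzero constant term `lc(P)`
    have h0 : P.coeff 0 = 0 := by
      have : ((P.coeff 0 : ℤ) : ℂ) = 0 := by rwa [eval₂_at_zero, eq_intCast] at hβ
      exact_mod_cast this
    have : P.leadingCoeff = 0 := by rw [← coeff_zero_reverse, hrev, h0]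
    exact hP (leadingCoeff_eq_zero.mp this)
  letI : Invertible β := invertibleOfNonzero hβ0
  have h := (eval₂_reverse_eq_zero_iff (Int.castRingHom ℂ) β P).mpr hβ
  rwa [hrev, invOf_eq_inv] at h

/-- Roots of an integer polynomial are closed under complex conjugation (multiset membership form).
[cite: MckeeSmyth2021, Exercise 12.15 p.208 with §5 (Salem polynomials)] -/
theorem mem_roots_conj {P : ℤ[X]} (hP : P ≠ 0) {β : ℂ} (hβ : β ∈ (P.map (Int.castRingHom ℂ)).roots) :
    conj β ∈ (P.map (Int.castRingHom ℂ)).roots := by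
  have hP' : P.map (Int.castRingHom ℂ) ≠ 0 := (Polynomial.map_ne_zero_iff (Int.castRingHom ℂ).injective_int).mpr hP
  rw [mem_roots hP', IsRoot.def, ← algebraMap_int_eq, eval_map_algebraMap] at hβ ⊢
  exact aeval_conj_eq_zero hβ

/-- **Salem structure from the root count.**  Let `P ∈ ℤ[X]` be irreducible with a complex root `α`,
`|α| > 1`, such that every other root (the multiset of roots with one copy of `α` removed) lies in the
closed unit disc, and some root `ζ` lies on the unit circle.  Then `P` is reciprocal (`P.reverse = P`)
of even degree, `α` is real, `α⁻¹` is a root, every root other than `α, α⁻¹` is unimodular, and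
`M(P) = |lc(P)| · |α|`. [cite: MckeeSmyth2021, Exercise 12.15 p.208 with §5 (Salem polynomials)] -/
theorem salem_structure_of_irreducible {P : ℤ[X]} (hirr : Irreducible P) {α ζ : ℂ}
    (hα : α ∈ (P.map (Int.castRingHom ℂ)).roots) (hα1 : 1 < ‖α‖)
    (hothers : ∀ β ∈ ((P.map (Int.castRingHom ℂ)).roots).erase α, ‖β‖ ≤ 1)
    (hζ : ζ ∈ (P.map (Int.castRingHom ℂ)).roots) (hζ1 : ‖ζ‖ = 1) :
    P.reverse = P ∧ Even P.natDegree ∧ conj α = α ∧ α⁻¹ ∈ (P.map (Int.castRingHom ℂ)).roots ∧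
      (∀ β ∈ (P.map (Int.castRingHom ℂ)).roots, β ≠ α → β ≠ α⁻¹ → ‖β‖ = 1) ∧
      intMahlerMeasure P = |(P.leadingCoeff : ℝ)| * ‖α‖ := by
  classical
  set R := (P.map (Int.castRingHom ℂ)).roots with hR
  have hP : P ≠ 0 := hirr.ne_zero
  have hP' : P.map (Int.castRingHom ℂ) ≠ 0 :=
    (Polynomial.map_ne_zero_iff (Int.castRingHom ℂ).injective_int).mpr hP
  -- degree ≥ 2: `α ≠ ζ` are two roots
  have hαζ : α ≠ ζ := by
    intro h; rw [h, hζ1] at hα1; exact lt_irrefl _ hα1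
  have hdeg : 2 ≤ P.natDegree := by
    have h1 : ({α, ζ} : Multiset ℂ) ≤ R := by
      rw [Multiset.le_iff_count]
      intro x
      rw [Multiset.insert_eq_cons, Multiset.count_cons, Multiset.count_singleton]
      by_cases hxα : x = α
      · subst hxα
        rw [if_neg hαζ, if_pos rfl, zero_add]
        exact Multiset.one_le_count_iff_mem.mpr hα
      · rw [if_neg hxα, add_zero]
        by_cases hxζ : x = ζ
        · subst hxζ; rw [if_pos rfl]; exact Multiset.one_le_count_iff_mem.mpr hζ
        · rw [if_neg hxζ]; exact Nat.zero_le _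
    have h2 := Multiset.card_le_card h1
    rw [Multiset.card_pair] at h2
    have h3 : Multiset.card R ≤ P.natDegree := by
      rw [hR, ← natDegree_map_eq_of_injective (Int.castRingHom ℂ).injective_int P]
      exact card_roots' _
    omega
  -- Exercise 12.15: `P` is reciprocal of even degree
  have hζroot : aeval ζ P = 0 := by
    have := (mem_roots hP').mp hζ
    rwa [IsRoot.def, ← algebraMap_int_eq, eval_map_algebraMap] at this
  obtain ⟨hrev, heven⟩ := reverse_eq_self_of_irreducible_of_unimodular_root hirr hdeg hζ1 hζroot
  -- `α` is real
  have hconj : conj α = α := by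
    by_contra hne
    have hmem : conj α ∈ R.erase α := (Multiset.mem_erase_of_ne hne).mpr (mem_roots_conj hP hα)
    have := hothers _ hmem
    rw [Complex.norm_conj] at this
    linarith
  -- `α⁻¹` is a root
  have hinv : α⁻¹ ∈ R := mem_roots_inv_of_reverse_eq hrev hP hα
  -- the other roots are unimodular
  have hunit : ∀ β ∈ R, β ≠ α → β ≠ α⁻¹ → ‖β‖ = 1 := by
    intro β hβ hβα hβα'
    have hle : ‖β‖ ≤ 1 := hothers β ((Multiset.mem_erase_of_ne hβα).mpr hβ)
    by_contra hne
    have hlt : ‖β‖ < 1 := lt_of_le_of_ne hle hne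
    have hβ0 : β ≠ 0 := by
      intro h
      have h0 := mem_roots_inv_of_reverse_eq hrev hP hβ
      -- `β = 0` ⇒ `0⁻¹ = 0` is a root; but then `α`-count: use `P(0) ≠ 0` via reverse
      rw [h, inv_zero, mem_roots hP', IsRoot.def, eval_map, eval₂_at_zero, eq_intCast] at h0
      have hc0 : P.coeff 0 = 0 := by exact_mod_cast h0
      have : P.leadingCoeff = 0 := by rw [← coeff_zero_reverse, hrev, hc0]
      exact hP (leadingCoeff_eq_zero.mp this)
    have hβinv : β⁻¹ ∈ R := mem_roots_inv_of_reverse_eq hrev hP hβ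
    have hβinvα : β⁻¹ ≠ α := by
      intro h; exact hβα' (by rw [← h, inv_inv])
    have h1 := hothers _ ((Multiset.mem_erase_of_ne hβinvα).mpr hβinv)
    rw [norm_inv] at h1
    have h2 : 1 < ‖β‖⁻¹ := one_lt_inv_iff₀.mpr ⟨norm_pos_iff.mpr hβ0, hlt⟩
    linarith
  -- the Mahler measure
  have hM : intMahlerMeasure P = |(P.leadingCoeff : ℝ)| * ‖α‖ := by
    unfold intMahlerMeasure
    rw [mahlerMeasure_eq_leadingCoeff_mul_prod_roots,
      leadingCoeff_map_of_injective (Int.castRingHom ℂ).injective_int, eq_intCast, Complex.norm_intCast,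
      ← hR, ← Multiset.cons_erase hα, Multiset.map_cons, Multiset.prod_cons, max_eq_right hα1.le]
    have hprod : ((R.erase α).map fun a => max 1 ‖a‖).prod = 1 := by
      rw [Multiset.map_congr rfl (fun β hβ => max_eq_left (hothers β hβ)), Multiset.map_const',
        Multiset.prod_replicate, one_pow]
    rw [hprod, mul_one]
  exact ⟨hrev, heven, hconj, hinv, hunit, hM⟩

end Literature.NumberTheory.MahlerMeasure

end Part14

/-!
## Part 15 — port of `Summits/Ventures/DiscreteObjects/Mahler/PalindromicQuartic.lean` (1 declarations kept)

# Monic palindromic irreducible quartics have `M = 1` or `M ≥ 1.3248` (venture `DiscreteObjects`, target L)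

Cell `pub-namedobj`, seat `pub-namedobj-mahler` (gen 10). Framing: lottery ticket; floor = certified
bounds/negative ranges.

`palindromic_quartic_measure`: an irreducible monic palindromic `m = x⁴ + ax³ + bx² + ax + 1 ∈ ℤ[x]`
cannot have `1 < M(m) < 1.3248` (the true minimum over such `m` with `M > 1` is the Salem number
`1.7221`; we prove what the census row `DegreeCensus 4 1.3248 []` needs).  The four roots are distinct
and closed under `β ↦ β⁻¹`, `β ↦ β̄`; cases:
* a unimodular root exists (Salem case): the dominant root `τ` is real (`salem_structure_of_irreducible`)
  and `1 ≤ |m(±1)| ≤ 4(|τ|-1)²/|τ|`, impossible for `|τ| < 1.3248`;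
* no unimodular root, two real dominant roots: all roots real, Schinzel's theorem gives `M ≥ φ²`;
* no unimodular root, a conjugate pair `α, ᾱ` outside: `y = α + α⁻¹` is a non-real root of
  `y² + ay + (b-2)`, so `Im(y)² ≥ 3/4`, while `Im(y)² ≤ (|α|² - 1)²/|α|² < 3/4`.
-/

section Part15

namespace Literature.NumberTheory.MahlerMeasure

open _root_.Polynomial
open scoped ComplexConjugate

/-- **Monic palindromic irreducible quartics have `M = 1` or `M ≥ 1.3248`** (in fact `≥ 1.722`; we
prove what the census row needs). [cite: MossinghoffRhinWu2008, Table 1 (degree 4: palindromic quartics)] -/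
theorem palindromic_quartic_measure {m : ℤ[X]} (hirr : Irreducible m) (hdeg : m.natDegree = 4)
    (hmonic : m.Monic) (hrev : m.reverse = m) (h1 : 1 < intMahlerMeasure m)
    (h2 : intMahlerMeasure m < 13248 / 10000) : False := by
  classical
  have hm0 : m ≠ 0 := hirr.ne_zero
  have hinj := (Int.castRingHom ℂ).injective_int
  set mc := m.map (Int.castRingHom ℂ) with hmc
  have hmc0 : mc ≠ 0 := (Polynomial.map_ne_zero_iff hinj).mpr hm0
  set R := mc.roots with hR
  have hnodup : R.Nodup := nodup_roots_of_irreducible hirr (by omega)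
  have hcard : Multiset.card R = 4 := by
    have hsp := (IsAlgClosed.splits mc).natDegree_eq_card_roots
    rw [hmc, natDegree_map_eq_of_injective hinj, hdeg] at hsp
    exact hsp.symm
  have hsplit : mc = (R.map fun β => X - C β).prod := (IsAlgClosed.splits mc).eq_prod_roots_of_monic (hmonic.map _)
  -- root facts
  have hinvR : ∀ β ∈ R, β⁻¹ ∈ R := fun β hβ => mem_roots_inv_of_reverse_eq hrev hm0 hβ
  have hconjR : ∀ β ∈ R, conj β ∈ R := fun β hβ => mem_roots_conj hm0 hβ
  have hne : ∀ β ∈ R, β ≠ 0 ∧ β ≠ β⁻¹ := fun β hβ => root_ne_inv_of_irreducible hirr (by omega) hβ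
  have hnoroot : ∀ t : ℤ, m.eval t ≠ 0 := by
    intro t ht
    have hdvd : X - C t ∣ m := dvd_iff_isRoot.mpr ht
    have hass : Associated (X - C t) m := (irreducible_X_sub_C t).associated_of_dvd hirr hdvd
    have h1 := natDegree_eq_of_degree_eq (degree_eq_degree_of_associated hass)
    rw [natDegree_X_sub_C] at h1
    omega
  -- `M(m) = ∏ max(1, |β|)`
  have hM : intMahlerMeasure m = (R.map fun β => max 1 ‖β‖).prod := by
    unfold intMahlerMeasure
    rw [mahlerMeasure_eq_leadingCoeff_mul_prod_roots, (hmonic.map _).leadingCoeff, norm_one, one_mul]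
  -- `|m(ε)| = ∏ |ε - β| ≥ 1` for `ε = ±1`
  have heval : ∀ ε : ℤ, ((m.eval ε : ℤ) : ℂ) = (R.map fun β => (ε : ℂ) - β).prod := by
    intro ε
    have : ((m.eval ε : ℤ) : ℂ) = mc.eval (ε : ℂ) := by
      rw [hmc, eval_intCast_map, eq_intCast, Int.cast_id]
    rw [this, hsplit, eval_multiset_prod, Multiset.map_map]
    exact congrArg _ (Multiset.map_congr rfl fun β _ => by simp)
  have heval1 : ∀ ε : ℤ, (1 : ℝ) ≤ ‖(R.map fun β => (ε : ℂ) - β).prod‖ := by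
    intro ε
    rw [← heval ε, Complex.norm_intCast]
    exact_mod_cast Int.one_le_abs (hnoroot ε)
  -- there is a root outside the unit circle
  have hout : ∃ α ∈ R, 1 < ‖α‖ := by
    by_contra hno
    push Not at hno
    have : intMahlerMeasure m = 1 := by
      rw [hM, Multiset.map_congr rfl (fun β hβ => max_eq_left (hno β hβ)), Multiset.map_const',
        Multiset.prod_replicate, one_pow]
    linarith
  obtain ⟨α, hαR, hα1⟩ := hout
  have hα0 : α ≠ 0 := (hne α hαR).1
  have hαinvR : α⁻¹ ∈ R := hinvR α hαR
  have hαinv1 : ‖α⁻¹‖ < 1 := by rw [norm_inv]; exact inv_lt_one_of_one_lt₀ hα1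
  by_cases hU : ∃ ζ ∈ R, ‖ζ‖ = 1
  · /- **Salem case.** Every root other than `α` lies in the closed disc (else five distinct roots),
    so `α` is real by `salem_structure_of_irreducible`, `M = |α|`, and `|m(±1)| ≤ 4 (|α|-1)²/|α| < 1`. -/
    obtain ⟨ζ, hζR, hζ1⟩ := hU
    have hζinvR : ζ⁻¹ ∈ R := hinvR ζ hζR
    have hζne : ζ ≠ ζ⁻¹ := (hne ζ hζR).2
    have hothers : ∀ β ∈ R.erase α, ‖β‖ ≤ 1 := by
      intro β hβ
      have hβα : β ≠ α := ((Multiset.Nodup.mem_erase_iff hnodup).mp hβ).1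
      have hβR : β ∈ R := Multiset.mem_of_mem_erase hβ
      by_contra hβ1
      push Not at hβ1
      -- five distinct roots `α, β, α⁻¹, β⁻¹, ζ`
      have hβinvR : β⁻¹ ∈ R := hinvR β hβR
      have hβinv1 : ‖β⁻¹‖ < 1 := by rw [norm_inv]; exact inv_lt_one_of_one_lt₀ hβ1
      have hs : ({α, β, α⁻¹, β⁻¹, ζ} : Multiset ℂ) ≤ R := by
        rw [Multiset.le_iff_subset]
        · intro x hx
          simp only [Multiset.insert_eq_cons, Multiset.mem_cons, Multiset.mem_singleton] at hx
          rcases hx with rfl | rfl | rfl | rfl | rfl <;> assumption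
        · simp only [Multiset.insert_eq_cons, Multiset.nodup_cons, Multiset.mem_cons, Multiset.mem_singleton,
            Multiset.nodup_singleton, and_true, not_or]
          refine ⟨⟨hβα.symm, ?_, ?_, ?_⟩, ⟨?_, ?_, ?_⟩, ⟨?_, ?_⟩, ?_⟩
          · intro h; rw [h] at hα1; linarith
          · intro h; rw [h] at hα1; linarith
          · intro h; rw [h, hζ1] at hα1; linarith
          · intro h; rw [h] at hβ1; linarith
          · intro h; rw [h] at hβ1; linarith
          · intro h; rw [h, hζ1] at hβ1; linarith
          · intro h; exact hβα.symm (inv_injective h)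
          · intro h; rw [h, hζ1] at hαinv1; linarith
          · intro h; rw [h, hζ1] at hβinv1; linarith
      have := Multiset.card_le_card hs
      rw [hcard] at this
      simp at this
    obtain ⟨-, -, hconj, -, hunit, hMα⟩ :=
      salem_structure_of_irreducible hirr hαR hα1 hothers hζR hζ1
    rw [hmonic.leadingCoeff, Int.cast_one, abs_one, one_mul] at hMα
    -- `α` is real: `α = ±‖α‖`
    have hαre : α = (α.re : ℂ) := (Complex.conj_eq_iff_re.mp hconj).symm
    have hαabs : |α.re| = ‖α‖ := by
      conv_rhs => rw [hαre]
      rw [Complex.norm_real, Real.norm_eq_abs]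
    -- the two remaining roots are in the closed disc
    set T := (R.erase α).erase α⁻¹ with hT
    have hαinvRe : α⁻¹ ∈ R.erase α := (Multiset.mem_erase_of_ne (hne α hαR).2.symm).mpr hαinvR
    have hRT : R = α ::ₘ α⁻¹ ::ₘ T := by rw [hT, Multiset.cons_erase hαinvRe, Multiset.cons_erase hαR]
    have hTcard : Multiset.card T = 2 := by
      have := congrArg Multiset.card hRT
      rw [hcard, Multiset.card_cons, Multiset.card_cons] at this; omega
    have hTle : ∀ β ∈ T, ‖β‖ ≤ 1 := fun β hβ => hothers β (Multiset.mem_of_mem_erase hβ)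
    -- `1 ≤ |m(ε)| ≤ |ε - α| · (|ε - α| / ‖α‖) · 4` for `ε = ±1`
    have hbound : ∀ ε : ℤ, ε = 1 ∨ ε = -1 → (1 : ℝ) ≤ ‖(ε : ℂ) - α‖ * (‖(ε : ℂ) - α‖ / ‖α‖) * 4 := by
      intro ε hε
      have hε1 : ‖(ε : ℂ)‖ = 1 := by rcases hε with h | h <;> simp [h]
      have h := heval1 ε
      rw [hRT, Multiset.map_cons, Multiset.map_cons, Multiset.prod_cons, Multiset.prod_cons, norm_mul,
        norm_mul] at h
      have hT2 := norm_prod_sub_le_two_pow T (ε : ℂ) hε1 hTle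
      rw [hTcard] at hT2
      have hinv : ‖(ε : ℂ) - α⁻¹‖ = ‖(ε : ℂ) - α‖ / ‖α‖ := by
        have : (ε : ℂ) - α⁻¹ = ((ε : ℂ) * α - 1) / α := by field_simp
        rw [this, norm_div]
        congr 1
        have hεα : (ε : ℂ) * α - 1 = (ε : ℂ) * (α - (ε : ℂ)) := by
          rcases hε with h | h
          · simp [h]
          · simp [h]; ring
        rw [hεα, norm_mul, hε1, one_mul, norm_sub_rev]
      rw [hinv] at h
      calc (1 : ℝ) ≤ ‖(ε : ℂ) - α‖ * (‖(ε : ℂ) - α‖ / ‖α‖) * ‖(T.map fun β => (ε : ℂ) - β).prod‖ := by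
            rw [mul_assoc]; exact h
        _ ≤ ‖(ε : ℂ) - α‖ * (‖(ε : ℂ) - α‖ / ‖α‖) * 4 := by
            apply mul_le_mul_of_nonneg_left (by norm_num at hT2 ⊢; exact hT2)
            positivity
    -- choose the sign of `α`
    have hr2 : ‖α‖ < 13248 / 10000 := by rw [← hMα]; exact h2
    have hrpos : 0 < ‖α‖ := by linarith
    have key : ∀ ε : ℤ, (ε = 1 ∨ ε = -1) → ‖(ε : ℂ) - α‖ = ‖α‖ - 1 → False := by
      intro ε hε hn
      have h := hbound ε hε
      rw [hn] at h
      have h3 : (‖α‖ - 1) * ((‖α‖ - 1) / ‖α‖) * 4 = 4 * (‖α‖ - 1) ^ 2 / ‖α‖ := by ring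
      rw [h3, le_div_iff₀ hrpos] at h
      nlinarith
    rcases le_or_gt 0 α.re with hpos | hneg
    · have hx : α.re = ‖α‖ := by rw [← hαabs, abs_of_nonneg hpos]
      apply key 1 (Or.inl rfl)
      have : ((1 : ℤ) : ℂ) - α = (((1 - α.re : ℝ)) : ℂ) := by
        conv_lhs => rw [hαre]
        push_cast; ring
      rw [this, Complex.norm_real, Real.norm_eq_abs, hx, abs_of_nonpos (by linarith)]
      ring
    · have hx : α.re = -‖α‖ := by
        rw [abs_of_neg hneg] at hαabs; linarith
      apply key (-1) (Or.inr rfl)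
      have : ((-1 : ℤ) : ℂ) - α = (((-1 - α.re : ℝ)) : ℂ) := by
        conv_lhs => rw [hαre]
        push_cast; ring
      rw [this, Complex.norm_real, Real.norm_eq_abs, hx, abs_of_nonneg (by linarith)]
      ring
  · /- **No unimodular root.** Then exactly two roots `α, β` lie outside the unit circle. -/
    push Not at hU
    set O := R.filter fun β => 1 < ‖β‖ with hO
    set I := R.filter fun β => ‖β‖ < 1 with hI
    have hOI : O + I = R := by
      rw [hO, hI]
      have : R.filter (fun β => ‖β‖ < 1) = R.filter (fun β => ¬ 1 < ‖β‖) :=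
        Multiset.filter_congr fun β hβ => by
          constructor
          · intro h; linarith
          · intro h; exact lt_of_le_of_ne (not_lt.mp h) (hU β hβ)
      rw [this, Multiset.filter_add_not]
    have hOnodup : O.Nodup := hnodup.filter _
    have hInodup : I.Nodup := hnodup.filter _
    have hOI_le : Multiset.card O ≤ Multiset.card I := by
      have h : O.map (fun β => β⁻¹) ≤ I := by
        rw [Multiset.le_iff_subset (hOnodup.map inv_injective)]
        intro x hx
        obtain ⟨β, hβ, rfl⟩ := Multiset.mem_map.mp hx
        rw [hO, Multiset.mem_filter] at hβ
        rw [hI, Multiset.mem_filter]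
        exact ⟨hinvR β hβ.1, by rw [norm_inv]; exact inv_lt_one_of_one_lt₀ hβ.2⟩
      simpa using Multiset.card_le_card h
    have hIO_le : Multiset.card I ≤ Multiset.card O := by
      have h : I.map (fun β => β⁻¹) ≤ O := by
        rw [Multiset.le_iff_subset (hInodup.map inv_injective)]
        intro x hx
        obtain ⟨β, hβ, rfl⟩ := Multiset.mem_map.mp hx
        rw [hI, Multiset.mem_filter] at hβ
        rw [hO, Multiset.mem_filter]
        have hβ0 : β ≠ 0 := (hne β hβ.1).1
        exact ⟨hinvR β hβ.1, by rw [norm_inv]; exact one_lt_inv_iff₀.mpr ⟨norm_pos_iff.mpr hβ0, hβ.2⟩⟩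
      simpa using Multiset.card_le_card h
    have hOcard : Multiset.card O = 2 := by
      have := congrArg Multiset.card hOI
      rw [Multiset.card_add, hcard] at this
      omega
    obtain ⟨a₁, a₂, hOeq⟩ := Multiset.card_eq_two.mp hOcard
    have ha₁₂ : a₁ ≠ a₂ := by
      have := hOnodup; rw [hOeq] at this
      simpa using this
    have hmemO : ∀ x, x ∈ O ↔ x ∈ R ∧ 1 < ‖x‖ := fun x => by rw [hO, Multiset.mem_filter]
    have ha₁ := (hmemO a₁).mp (by rw [hOeq]; simp)
    have ha₂ := (hmemO a₂).mp (by rw [hOeq]; simp)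
    -- `M = |a₁| |a₂|`
    have hMO : intMahlerMeasure m = ‖a₁‖ * ‖a₂‖ := by
      rw [hM, ← hOI, Multiset.map_add, Multiset.prod_add]
      have h1 : (O.map fun β => max 1 ‖β‖) = O.map fun β => ‖β‖ :=
        Multiset.map_congr rfl fun β hβ => max_eq_right ((hmemO β).mp hβ).2.le
      have h2 : (I.map fun β => max 1 ‖β‖) = I.map fun _ => (1 : ℝ) :=
        Multiset.map_congr rfl fun β hβ => by
          rw [hI, Multiset.mem_filter] at hβ; exact max_eq_left hβ.2.le
      rw [h1, h2, Multiset.map_const', Multiset.prod_replicate, one_pow, mul_one, hOeq]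
      simp
    -- conjugation preserves `O`
    have hconjO : ∀ x ∈ O, conj x ∈ O := by
      intro x hx
      rw [hmemO] at hx ⊢
      exact ⟨hconjR x hx.1, by rw [Complex.norm_conj]; exact hx.2⟩
    have hconj_cases : ∀ x ∈ O, conj x = a₁ ∨ conj x = a₂ := by
      intro x hx
      have := hconjO x hx
      rw [hOeq] at this
      simpa using this
    by_cases hreal : conj a₁ = a₁
    · /- both dominant roots real ⇒ all roots real ⇒ Schinzel: `M² ≥ φ⁴` -/
      have hreal₂ : conj a₂ = a₂ := by
        rcases hconj_cases a₂ (by rw [hOeq]; simp) with h | h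
        · exfalso; apply ha₁₂
          have := congrArg conj h
          rw [Complex.conj_conj, hreal] at this
          exact this.symm
        · exact h
      have hallreal : ∀ γ ∈ R, γ.im = 0 := by
        intro γ hγ
        have hrealO : ∀ x ∈ O, conj x = x := by
          intro x hx; rw [hOeq] at hx
          simp at hx
          rcases hx with rfl | rfl
          · exact hreal
          · exact hreal₂
        rw [← hOI, Multiset.mem_add] at hγ
        rcases hγ with hγ | hγ
        · exact Complex.conj_eq_iff_im.mp (hrealO γ hγ)
        · -- `γ⁻¹ ∈ O` is real, hence so is `γ`
          rw [hI, Multiset.mem_filter] at hγ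
          have hγ0 : γ ≠ 0 := (hne γ hγ.1).1
          have hγinvO : γ⁻¹ ∈ O := by
            rw [hmemO]
            exact ⟨hinvR γ hγ.1, by rw [norm_inv]; exact one_lt_inv_iff₀.mpr ⟨norm_pos_iff.mpr hγ0, hγ.2⟩⟩
          have h := hrealO _ hγinvO
          rw [map_inv₀, inv_inj] at h
          exact Complex.conj_eq_iff_im.mp h
      have hc0 : m.coeff 0 ≠ 0 := by
        rw [coeff_zero_eq_eval_zero]; exact_mod_cast hnoroot 0
      have hS := goldenRatio_pow_le_mahlerMeasure_sq_of_totally_real hc0 (hnoroot 1)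
        (by exact_mod_cast hnoroot (-1)) hallreal
      rw [hdeg] at hS
      have hφ : (16 : ℝ) / 10 < Real.goldenRatio := by
        rw [Real.goldenRatio]
        have : (22 : ℝ) / 10 < Real.sqrt 5 := by
          rw [show (22 : ℝ) / 10 = Real.sqrt ((22/10)^2) by rw [Real.sqrt_sq (by norm_num)]]
          exact Real.sqrt_lt_sqrt (by norm_num) (by norm_num)
        linarith
      have hM0 : 0 ≤ intMahlerMeasure m := by linarith
      nlinarith [pow_le_pow_left₀ (by norm_num : (0:ℝ) ≤ 16/10) hφ.le 4]
    · /- `a₂ = conj a₁`: a complex pair outside; the trace `y = a₁ + a₁⁻¹` is a non-real root of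
      `y² + ay + (b-2)` -/
      have hconj₁ : conj a₁ = a₂ := by
        rcases hconj_cases a₁ (by rw [hOeq]; simp) with h | h
        · exact absurd h hreal
        · exact h
      have hnorm₂ : ‖a₂‖ = ‖a₁‖ := by rw [← hconj₁, Complex.norm_conj]
      set s := ‖a₁‖ with hs
      have hs1 : 1 < s := ha₁.2
      have hMs : intMahlerMeasure m = s ^ 2 := by rw [hMO, hnorm₂, sq]
      -- the quartic relation at `a₁`
      have hform := palindromic_quartic_eq hdeg hmonic hrev
      set a := m.coeff 3 with ha
      set b := m.coeff 2 with hb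
      have ha₁0 : a₁ ≠ 0 := (hne a₁ ha₁.1).1
      have hroot : a₁ ^ 4 + (a : ℂ) * a₁ ^ 3 + (b : ℂ) * a₁ ^ 2 + (a : ℂ) * a₁ + 1 = 0 := by
        have h := (mem_roots hmc0).mp ha₁.1
        rw [IsRoot.def, hmc, hform] at h
        simpa using h
      have hy := trace_root_quadratic ha₁0 hroot
      set y := a₁ + a₁⁻¹ with hydef
      have hy' : y ^ 2 + (a : ℂ) * y + ((b - 2 : ℤ) : ℂ) = 0 := by push_cast; exact hy
      -- `Im y = Im a₁ · (1 - 1/s²) ≠ 0` and `|Im y| ≤ s - 1/s`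
      have hyim : y.im = a₁.im * (1 - (s ^ 2)⁻¹) := by
        rw [hydef, Complex.add_im, Complex.inv_im, Complex.normSq_eq_norm_sq, ← hs]
        ring
      have ha₁im : a₁.im ≠ 0 := by
        intro h0
        apply hreal
        exact Complex.conj_eq_iff_im.mpr h0
      have hs2 : 1 < s ^ 2 := by nlinarith
      have hyim0 : y.im ≠ 0 := by
        rw [hyim]
        refine mul_ne_zero ha₁im ?_
        have : (s ^ 2)⁻¹ < 1 := inv_lt_one_of_one_lt₀ hs2
        linarith
      have him := im_sq_ge_of_int_quadratic hy' hyim0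
      -- `|Im a₁| ≤ s`
      have hima : a₁.im ^ 2 ≤ s ^ 2 := by
        rw [hs, ← Complex.normSq_eq_norm_sq, Complex.normSq_apply]
        nlinarith [sq_nonneg a₁.re]
      have hfac : 0 ≤ 1 - (s ^ 2)⁻¹ ∧ 1 - (s ^ 2)⁻¹ < 1 := by
        constructor
        · have : (s ^ 2)⁻¹ ≤ 1 := inv_le_one_of_one_le₀ hs2.le
          linarith
        · have : 0 < (s ^ 2)⁻¹ := by positivity
          linarith
      -- `(Im y)² = (Im a₁)² (1 - 1/s²)² ≤ s² (1 - 1/s²)² = (s² - 1)²/s² < (0.3248)²/1`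
      have hs2' : s ^ 2 < 13248 / 10000 := by rw [← hMs]; exact h2
      have hyim2 : y.im ^ 2 ≤ s ^ 2 * (1 - (s ^ 2)⁻¹) ^ 2 := by
        rw [hyim, mul_pow]
        exact mul_le_mul_of_nonneg_right hima (sq_nonneg _)
      have hcalc : s ^ 2 * (1 - (s ^ 2)⁻¹) ^ 2 = (s ^ 2 - 1) ^ 2 / s ^ 2 := by
        field_simp
      rw [hcalc] at hyim2
      have hlt : (s ^ 2 - 1) ^ 2 / s ^ 2 < 3 / 4 := by
        rw [div_lt_iff₀ (by positivity)]
        nlinarith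
      linarith

end Literature.NumberTheory.MahlerMeasure

end Part15

/-!
## Part 16 — port of `Summits/Ventures/DiscreteObjects/Mahler/QuarticCensusRow.lean` (1 declarations kept)

# The degree-4 census row below `1.3248` in the kernel (venture `DiscreteObjects`, target L)

Cell `pub-namedobj`, seat `pub-namedobj-mahler` (gen 10). Framing: lottery ticket; floor = certified
bounds/negative ranges.

**Theorem** (`degreeCensus_four`): `DegreeCensus 4 1.3248 []` — no irreducible integer polynomial of
degree `4` has Mahler measure in `(1, 1.3248)` (the smallest degree-4 measure in Boyd's / Mossinghoff's
tables is `M(x⁴ - x³ - 1) = 1.3803`).  Zero compute: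
* a NONRECIPROCAL irreducible quartic has `M = θ₀` or `M > 1.3248` (Smyth's theorem with isolation), and
  `M = θ₀` forces degree `3k` (equality case) — impossible;
* an antireciprocal one vanishes at `1`; a RECIPROCAL one is `±m` with `m` monic palindromic, handled by
  `palindromic_quartic_measure`.
With `degreeCensus_one/two/three` (gen 10, `LowDegreeCensus`) and the odd-degree rows (`OddDegreeCensus`):
every irreducible integer polynomial of degree `≤ 5` with `1 < M < 1.3248` is one of the eight Smyth
trinomials of degree `3`.
-/

section Part16

namespace Literature.NumberTheory.MahlerMeasure

open _root_.Polynomial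

/-- **Degree-4 census row below `1.3248`:** `DegreeCensus 4 1.3248 []` — no irreducible integer polynomial
of degree `4` has Mahler measure in `(1, 1.3248)`.
[cite: MossinghoffRhinWu2008, Table 1 (no degree-4 measure in (1, 1.3248))] -/
theorem degreeCensus_four : DegreeCensus 4 (13248 / 10000) [] := by
  intro p hdeg hirr h1 h2
  exfalso
  have h0 : p.coeff 0 ≠ 0 := coeff_zero_ne_zero_of_irreducible hirr (by omega)
  have hnoroot : ∀ t : ℤ, p.eval t ≠ 0 := by
    intro t ht
    have hdvd : X - C t ∣ p := dvd_iff_isRoot.mpr ht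
    have hass : Associated (X - C t) p := (irreducible_X_sub_C t).associated_of_dvd hirr hdvd
    have h1 := natDegree_eq_of_degree_eq (degree_eq_degree_of_associated hass)
    rw [natDegree_X_sub_C] at h1
    omega
  by_cases hrec : p.reverse = p ∨ p.reverse = -p
  · rcases hrec with hrev | hrev
    · -- reciprocal: normalise to monic
      have hlc : (|p.leadingCoeff| : ℝ) ≤ intMahlerMeasure p := abs_leadingCoeff_le_intMahlerMeasure p
      have hlc1 : p.leadingCoeff = 1 ∨ p.leadingCoeff = -1 := by
        have hne : p.leadingCoeff ≠ 0 := leadingCoeff_ne_zero.mpr hirr.ne_zero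
        have hle : |p.leadingCoeff| ≤ 1 := by
          by_contra h
          push Not at h
          have : (2 : ℝ) ≤ (|p.leadingCoeff| : ℝ) := by
            have : (2 : ℤ) ≤ |p.leadingCoeff| := h
            exact_mod_cast this
          linarith
        rcases abs_le.mp hle with ⟨h1', h2'⟩
        omega
      obtain ⟨hmonic, hpm, hMm, hdegm, hirrm⟩ := monic_normalisation hlc1
      have hrevm : (C p.leadingCoeff * p).reverse = C p.leadingCoeff * p := by
        rw [reverse_mul_of_domain, reverse_C, hrev]
      rw [← hMm] at h1 h2
      rw [hdeg] at hdegm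
      exact palindromic_quartic_measure (hirrm hirr) hdegm hmonic hrevm h1 h2
    · exact hnoroot 1 (eval_one_eq_zero_of_reverse_eq_neg hrev)
  · -- nonreciprocal: Smyth with isolation and the equality case
    push Not at hrec
    have hMθ := intMahlerMeasure_eq_smythTheta_of_lt hirr h0 hrec.1 hrec.2 h2
    obtain ⟨k, hk, a, ha, s, hs, hform⟩ :=
      (intMahlerMeasure_eq_smythTheta_iff_eq hirr h0 hrec.1 hrec.2).mp hMθ
    have ha0 : a ≠ 0 := by rcases ha with h | h <;> simp [h]
    have hs0 : s ≠ 0 := by rcases hs with h | h <;> simp [h]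
    have hdegP : (1 - X ^ (2 * k) + C a * X ^ (3 * k) : ℤ[X]).natDegree = 3 * k := by
      have : (1 - X ^ (2 * k) + C a * X ^ (3 * k) : ℤ[X]) = trinomial 0 (2 * k) (3 * k) 1 (-1) a := by
        rw [trinomial_def]; simp; ring
      rw [this]; exact trinomial_natDegree (by omega) (by omega) ha0
    have hdegQ : (1 - C a * X ^ k + C a * X ^ (3 * k) : ℤ[X]).natDegree = 3 * k := by
      have : (1 - C a * X ^ k + C a * X ^ (3 * k) : ℤ[X]) = trinomial 0 k (3 * k) 1 (-a) a := by
        rw [trinomial_def]; simp; ring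
      rw [this]; exact trinomial_natDegree (by omega) (by omega) ha0
    rcases hform with h | h
    · have := congrArg natDegree h
      rw [hdeg, natDegree_C_mul hs0, hdegP] at this
      omega
    · have := congrArg natDegree h
      rw [hdeg, natDegree_C_mul hs0, hdegQ] at this
      omega

end Literature.NumberTheory.MahlerMeasure

end Part16

/-!
## Part 17 — port of `Summits/Ventures/DiscreteObjects/Mahler/MahlerMeasureUnit.lean` (1 declarations kept)

# `M(P)` is an algebraic unit when `P` is monic with `P(0) = ±1`; irreducible self-reciprocal polynomials
(venture `DiscreteObjects`, target L)

Cell `pub-namedobj`, seat `pub-namedobj-mahler` (gen 10). Framing: lottery ticket; floor = certified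
bounds/negative ranges.

1. **Units.** For a monic `P ∈ ℤ[X]` with `P(0) = ±1` — in particular for every candidate of the
   small-measure census (reciprocal, monic) — the Mahler measure `M(P)` is a UNIT of the ring of
   algebraic integers: both `M(P)` and `M(P)⁻¹` are algebraic integers.  Indeed `M(P) = |β|`,
   `β = ∏_{|α|>1} α`, and `β⁻¹ = ±∏_{|α|≤1} α` is again a sub-product of the roots, integral by
   `isIntegral_leadingCoeff_mul_prod_roots` ([McKee–Smyth, proof of Prop. 1.9]).
   `isIntegral_inv_intMahlerMeasure`, `intMahlerMeasure_unit`.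
2. **[McKee–Smyth, Exercise A.5]** An irreducible `P ∈ ℤ[X]` with `P.reverse = ±P` is `±(X - 1)`,
   `±(X + 1)`, or palindromic (`P.reverse = P`) of even degree: `self_reciprocal_irreducible_classification`.
-/

section Part17

namespace Literature.NumberTheory.MahlerMeasure

open _root_.Polynomial
open scoped ComplexConjugate

/-! ### `M(P)⁻¹` is an algebraic integer for monic `P` with `P(0) = ±1` -/

/-- **[McKee–Smyth, Exercise A.5]** An irreducible `P ∈ ℤ[X]` which is self-reciprocal
(`P.reverse = P` or `P.reverse = -P`) is `±(X - 1)`, `±(X + 1)`, or palindromic of even degree.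
[cite: MckeeSmyth2021, Theorem 1.3 (Kronecker) p.20 with §A.1] -/
theorem self_reciprocal_irreducible_classification {P : ℤ[X]} (hirr : Irreducible P)
    (hrec : P.reverse = P ∨ P.reverse = -P) :
    (P = X - 1 ∨ P = -(X - 1)) ∨ (P = X + 1 ∨ P = -(X + 1)) ∨ (P.reverse = P ∧ Even P.natDegree) := by
  -- an irreducible polynomial divisible by `X - c` is `±(X - c)`
  have key : ∀ t : ℤ, P.eval t = 0 → P = X - C t ∨ P = -(X - C t) := by
    intro t ht
    have hdvd : X - C t ∣ P := dvd_iff_isRoot.mpr ht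
    have hass : Associated (X - C t) P := (irreducible_X_sub_C t).associated_of_dvd hirr hdvd
    obtain ⟨u, hu⟩ := hass
    obtain ⟨c, hc, hcu⟩ := Polynomial.isUnit_iff.mp u.isUnit
    rcases Int.isUnit_iff.mp hc with h | h
    · left; rw [← hu, ← hcu, h, map_one, mul_one]
    · right; rw [← hu, ← hcu, h, map_neg, map_one, mul_neg, mul_one]
  rcases hrec with hrev | hrev
  · by_cases heven : Even P.natDegree
    · exact Or.inr (Or.inr ⟨hrev, heven⟩)
    · rw [Nat.not_even_iff_odd] at heven
      have h1 := key (-1) (eval_neg_one_eq_zero_of_reverse_eq hrev heven)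
      rw [map_neg, map_one, sub_neg_eq_add] at h1
      exact Or.inr (Or.inl h1)
  · have h1 := key 1 (eval_one_eq_zero_of_reverse_eq_neg hrev)
    rw [map_one] at h1
    exact Or.inl h1

end Literature.NumberTheory.MahlerMeasure

end Part17

/-!
## Part 18 — port of `Summits/Ventures/DiscreteObjects/Mahler/SmallMeasureReciprocal.lean` (2 declarations kept)

# Irreducible polynomials of measure `< 1.3248` are reciprocal or Smyth trinomials (venture `DiscreteObjects`, target L)

Cell `pub-namedobj`, seat `pub-namedobj-mahler` (gen 10). Framing: lottery ticket; floor = certified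
bounds/negative ranges.

The census space reduction, kernel version with the exact exceptional list: an irreducible `P ∈ ℤ[X]` with
`1 < M(P) < 1.3248` is EITHER palindromic (`P.reverse = P`) of even degree `≥ 2`, OR has `M(P) = θ₀` and
is one of the eight Smyth trinomials `±(1 - X^{2k} + aX^{3k})`, `±(1 - aX^k + aX^{3k})` (`a = ±1`,
`k ≥ 1`) — by Smyth's theorem with isolation and equality case ([McKee–Smyth, Thm 12.1], kernel gens 8–9)
and [McKee–Smyth, Ex. A.5] (`self_reciprocal_irreducible_classification`).  In particular (`< θ₀`):
every irreducible `P` with `1 < M(P) < θ₀` — e.g. every irreducible sub-Lehmer polynomial — is palindromic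
of even degree, unconditionally.

* `reciprocal_or_smyth_of_measure_lt` — the dichotomy below `1.3248`;
* `reciprocal_of_measure_lt_smythTheta` — below `θ₀`: palindromic of even degree `≥ 2`.
-/

section Part18

namespace Literature.NumberTheory.MahlerMeasure

open _root_.Polynomial

/-- `M(±(X - 1)) = M(±(X + 1)) = 1`.
[cite: MckeeSmyth2021, Theorem 12.1 p.205 (consequence: M(P) < θ₀ ⇒ P reciprocal)] -/
theorem intMahlerMeasure_eq_one_of_linear_cyclotomic {P : ℤ[X]}
    (h : (P = X - 1 ∨ P = -(X - 1)) ∨ (P = X + 1 ∨ P = -(X + 1))) : intMahlerMeasure P = 1 := by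
  have h1 : intMahlerMeasure (X - 1 : ℤ[X]) = 1 := by
    rw [← cyclotomic_one]; exact intMahlerMeasure_cyclotomic 1
  have h2 : intMahlerMeasure (X + 1 : ℤ[X]) = 1 := by
    rw [← cyclotomic_two]; exact intMahlerMeasure_cyclotomic 2
  rcases h with (h | h) | (h | h) <;> rw [h]
  · exact h1
  · rw [intMahlerMeasure_neg]; exact h1
  · exact h2
  · rw [intMahlerMeasure_neg]; exact h2

/-- **Below `1.3248`: reciprocal or a Smyth trinomial.**  An irreducible `P ∈ ℤ[X]` with
`1 < M(P) < 1.3248` is palindromic (`P.reverse = P`) of even degree `≥ 2`, or `M(P) = θ₀` and `P` is one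
of the eight Smyth trinomials of degree `3k`.
[cite: MckeeSmyth2021, Theorem 12.1 p.205 (consequence: M(P) < θ₀ ⇒ P reciprocal)] -/
theorem reciprocal_or_smyth_of_measure_lt {P : ℤ[X]} (hirr : Irreducible P) (h1 : 1 < intMahlerMeasure P)
    (h2 : intMahlerMeasure P < 13248 / 10000) :
    (P.reverse = P ∧ Even P.natDegree ∧ 2 ≤ P.natDegree) ∨
      (intMahlerMeasure P = smythTheta ∧ ∃ k : ℕ, 1 ≤ k ∧ ∃ a : ℤ, (a = 1 ∨ a = -1) ∧
        ∃ s : ℤ, (s = 1 ∨ s = -1) ∧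
          (P = C s * (1 - X ^ (2 * k) + C a * X ^ (3 * k)) ∨
            P = C s * (1 - C a * X ^ k + C a * X ^ (3 * k)))) := by
  -- `P` is nonconstant with `P(0) ≠ 0`
  have hdeg : 0 < P.natDegree := by
    by_contra hd
    push Not at hd
    have hC := eq_C_of_natDegree_eq_zero (Nat.le_zero.mp hd)
    have hM : intMahlerMeasure P = |(P.coeff 0 : ℝ)| := by rw [hC, intMahlerMeasure_C, coeff_C_zero]
    rw [hM] at h1 h2
    have h3 : (1 : ℤ) < |P.coeff 0| := by exact_mod_cast h1
    have h4 : (2 : ℝ) ≤ |(P.coeff 0 : ℝ)| := by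
      have : (2 : ℤ) ≤ |P.coeff 0| := h3
      exact_mod_cast this
    linarith
  have h0 : P.coeff 0 ≠ 0 := by
    intro h
    have hX : X ∣ P := X_dvd_iff.mpr h
    have hass : Associated X P := irreducible_X.associated_of_dvd hirr hX
    obtain ⟨u, hu⟩ := hass
    obtain ⟨c, hc, hcu⟩ := Polynomial.isUnit_iff.mp u.isUnit
    have hM : intMahlerMeasure P = 1 := by
      rw [← hu, intMahlerMeasure_mul, intMahlerMeasure_X, ← hcu, intMahlerMeasure_C]
      rcases Int.isUnit_iff.mp hc with h' | h' <;> simp [h']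
    linarith
  by_cases hrec : P.reverse = P ∨ P.reverse = -P
  · -- self-reciprocal: `±(X ∓ 1)` (measure 1) or palindromic of even degree
    left
    rcases self_reciprocal_irreducible_classification hirr hrec with h | h | ⟨hrev, heven⟩
    · have := intMahlerMeasure_eq_one_of_linear_cyclotomic (Or.inl h); linarith
    · have := intMahlerMeasure_eq_one_of_linear_cyclotomic (Or.inr h); linarith
    · refine ⟨hrev, heven, ?_⟩
      obtain ⟨j, hj⟩ := heven
      omega
  · right
    push Not at hrec
    have hMθ := intMahlerMeasure_eq_smythTheta_of_lt hirr h0 hrec.1 hrec.2 h2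
    exact ⟨hMθ, (intMahlerMeasure_eq_smythTheta_iff_eq hirr h0 hrec.1 hrec.2).mp hMθ⟩

end Literature.NumberTheory.MahlerMeasure

end Part18

/-!
## Part 19 — port of `Summits/Ventures/DiscreteObjects/Mahler/LowDegreeMeasures.lean` (5 declarations kept)

# All integer polynomials of degree `≤ 5`: `M = 1`, `M = θ₀`, or `M ≥ 1.3248` (venture `DiscreteObjects`, target L)

Cell `pub-namedobj`, seat `pub-namedobj-mahler` (gen 10). Framing: lottery ticket; floor = certified
bounds/negative ranges.

From the irreducible rows (`degreeCensus_two_empty`, `degreeCensus_four`, `reciprocal_or_smyth_of_measure_lt`)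
and multiplicativity of the Mahler measure over a factorisation into irreducibles: for EVERY `p ∈ ℤ[X]`
(reducible or not) of degree `≤ 5` with `1 < M(p) < 1.3248`, one has `M(p) = θ₀ = 1.3247…` (a Smyth cubic
times cyclotomic/monomial factors).  Hence the cell's census rows in the engines' own format
`HeightBoundedCensus n h B L` are EMPTY for every `n ≤ 5`, every height `h` and every `B ≤ θ₀` — in
particular for the table's bound `B = 1.3` — certified in the kernel with zero compute.

* `intMahlerMeasure_multiset_prod` — `M(∏ F) = ∏ M(f)`;
* `measure_irreducible_factor_le_five` — irreducible `f`, `deg f ≤ 5`: `M(f) = 1 ∨ M(f) = θ₀ ∨ M(f) ≥ 1.3248`;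
* `intMahlerMeasure_eq_smythTheta_of_natDegree_le_five` — `deg p ≤ 5`, `1 < M(p) < 1.3248` ⇒ `M(p) = θ₀`;
* `heightBoundedCensus_of_le_five` — `HeightBoundedCensus n h B []` for `n ≤ 5`, `B ≤ θ₀`;
  `heightBoundedCensus_of_le_five_thirteen` — the table's bound `13/10`.
-/

section Part19

namespace Literature.NumberTheory.MahlerMeasure

open _root_.Polynomial

/-- `M(∏ F) = ∏_{f ∈ F} M(f)`.
[cite: MckeeSmyth2021, Theorem 12.1 p.205 with MossinghoffRhinWu2008 Table 1 (measures of factors of degree ≤ 5)] -/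
theorem intMahlerMeasure_multiset_prod (F : Multiset ℤ[X]) :
    intMahlerMeasure F.prod = (F.map intMahlerMeasure).prod := by
  induction F using Multiset.induction_on with
  | empty =>
    simp only [Multiset.prod_zero, Multiset.map_zero]
    unfold intMahlerMeasure
    rw [Polynomial.map_one, mahlerMeasure_one]
  | cons f F ih => rw [Multiset.prod_cons, Multiset.map_cons, Multiset.prod_cons, intMahlerMeasure_mul, ih]

/-- An irreducible integer polynomial of degree `≤ 5` has `M = 1`... more precisely `M ≤ 1`, or `M = θ₀`,
or `M ≥ 1.3248`.
[cite: MckeeSmyth2021, Theorem 12.1 p.205 with MossinghoffRhinWu2008 Table 1 (measures of factors of degree ≤ 5)] -/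
theorem measure_irreducible_factor_le_five {f : ℤ[X]} (hirr : Irreducible f) (hdeg : f.natDegree ≤ 5) :
    intMahlerMeasure f ≤ 1 ∨ intMahlerMeasure f = smythTheta ∨ 13248 / 10000 ≤ intMahlerMeasure f := by
  by_cases h1 : intMahlerMeasure f ≤ 1
  · exact Or.inl h1
  by_cases h2 : 13248 / 10000 ≤ intMahlerMeasure f
  · exact Or.inr (Or.inr h2)
  push Not at h1 h2
  right; left
  rcases reciprocal_or_smyth_of_measure_lt hirr h1 h2 with ⟨hrev, heven, hd2⟩ | ⟨hM, -⟩
  · -- palindromic of even degree `2` or `4`: excluded by the degree-2 and degree-4 rows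
    exfalso
    obtain ⟨j, hj⟩ := heven
    rcases (by omega : f.natDegree = 2 ∨ f.natDegree = 4) with hd | hd
    · have hφ : (13248 : ℝ) / 10000 ≤ (1 + Real.sqrt 5) / 2 := by
        have : (165 : ℝ) / 100 < Real.sqrt 5 := by
          rw [show (165 : ℝ) / 100 = Real.sqrt ((165/100)^2) by rw [Real.sqrt_sq (by norm_num)]]
          exact Real.sqrt_lt_sqrt (by norm_num) (by norm_num)
        linarith
      obtain ⟨l, hl, -⟩ := degreeCensus_two_empty (le_refl _) f hd hirr h1 (lt_of_lt_of_le h2 hφ)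
      simp at hl
    · obtain ⟨l, hl, -⟩ := degreeCensus_four f hd hirr h1 h2
      simp at hl
  · exact hM

/-- A multiset of reals each `= 1` or `= θ₀` has product `θ₀^k`, `k` = number of entries `≠ 1`.
[cite: MckeeSmyth2021, Theorem 12.1 p.205 with MossinghoffRhinWu2008 Table 1 (measures of factors of degree ≤ 5)] -/
theorem prod_eq_smythTheta_pow {G : Multiset ℝ} (hG : ∀ x ∈ G, x = 1 ∨ x = smythTheta) :
    G.prod = smythTheta ^ Multiset.card (G.filter fun x => x ≠ 1) := by
  induction G using Multiset.induction_on with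
  | empty => simp
  | cons x G ih =>
    have hx := hG x (Multiset.mem_cons_self x G)
    rw [Multiset.prod_cons, ih (fun y hy => hG y (Multiset.mem_cons_of_mem hy)), Multiset.filter_cons]
    rcases hx with rfl | rfl
    · simp
    · have hθ1 : smythTheta ≠ 1 := by linarith [smythTheta_gt]
      rw [if_pos hθ1, Multiset.singleton_add, Multiset.card_cons, pow_succ, mul_comm]

/-- **Degree `≤ 5`, any integer polynomial:** `1 < M(p) < 1.3248` forces `M(p) = θ₀`.
[cite: MckeeSmyth2021, Theorem 12.1 p.205 with MossinghoffRhinWu2008 Table 1 (measures of factors of degree ≤ 5)] -/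
theorem intMahlerMeasure_eq_smythTheta_of_natDegree_le_five {p : ℤ[X]} (hdeg : p.natDegree ≤ 5)
    (h1 : 1 < intMahlerMeasure p) (h2 : intMahlerMeasure p < 13248 / 10000) :
    intMahlerMeasure p = smythTheta := by
  classical
  have hp : p ≠ 0 := by
    intro h
    rw [h] at h1
    unfold intMahlerMeasure at h1
    rw [Polynomial.map_zero, mahlerMeasure_zero] at h1
    linarith
  -- factorisation into irreducibles: `p = (∏ F) · u`
  obtain ⟨u, hu⟩ := UniqueFactorizationMonoid.factors_prod hp
  obtain ⟨c, hc, hcu⟩ := Polynomial.isUnit_iff.mp u.isUnit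
  set F := UniqueFactorizationMonoid.factors p with hF
  have hFirr : ∀ f ∈ F, Irreducible f := fun f hf => UniqueFactorizationMonoid.irreducible_of_factor f hf
  have hMu : intMahlerMeasure (↑u : ℤ[X]) = 1 := by
    rw [← hcu, intMahlerMeasure_C]
    rcases Int.isUnit_iff.mp hc with h | h <;> simp [h]
  have hMp : intMahlerMeasure p = (F.map intMahlerMeasure).prod := by
    rw [← hu, intMahlerMeasure_mul, hMu, mul_one, intMahlerMeasure_multiset_prod]
  -- each factor: `M ∈ {1, θ₀}` (a factor `≥ 1.3248` would make the product too large)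
  have hdvd : ∀ f ∈ F, f ∣ p := fun f hf => (Multiset.dvd_prod hf).trans ⟨↑u, hu.symm⟩
  have hge1 : ∀ x ∈ F.map intMahlerMeasure, 1 ≤ x := by
    intro x hx
    obtain ⟨f, hf, rfl⟩ := Multiset.mem_map.mp hx
    exact one_le_intMahlerMeasure (hFirr f hf).ne_zero
  have hprod_ge : ∀ x ∈ F.map intMahlerMeasure, x ≤ (F.map intMahlerMeasure).prod := by
    intro x hx
    obtain ⟨T, hT⟩ := Multiset.exists_cons_of_mem hx
    rw [hT, Multiset.prod_cons]
    have hT1 : 1 ≤ T.prod := Multiset.one_le_prod (fun y hy => hge1 y (by rw [hT]; exact Multiset.mem_cons_of_mem hy))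
    have hx0 : 0 ≤ x := le_trans zero_le_one (hge1 x hx)
    nlinarith
  have hvals : ∀ x ∈ F.map intMahlerMeasure, x = 1 ∨ x = smythTheta := by
    intro x hx
    obtain ⟨f, hf, rfl⟩ := Multiset.mem_map.mp hx
    have hfdeg : f.natDegree ≤ 5 := (natDegree_le_of_dvd (hdvd f hf) hp).trans hdeg
    rcases measure_irreducible_factor_le_five (hFirr f hf) hfdeg with h | h | h
    · exact Or.inl (le_antisymm h (hge1 _ hx))
    · exact Or.inr h
    · exfalso
      have := hprod_ge _ hx
      rw [← hMp] at this
      linarith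
  -- the product is `θ₀^k` with `1 < θ₀^k < 1.3248`, so `k = 1`
  have hpow := prod_eq_smythTheta_pow hvals
  rw [← hMp] at hpow
  set k := Multiset.card ((F.map intMahlerMeasure).filter fun x => x ≠ 1) with hk
  have hθ := smythTheta_gt
  have hθ' := smythTheta_lt
  rcases Nat.lt_trichotomy k 1 with hk0 | hk1 | hk2
  · have : k = 0 := by omega
    rw [this, pow_zero] at hpow
    linarith
  · rw [hpow, hk1, pow_one]
  · have h3 : smythTheta ^ 2 ≤ smythTheta ^ k := pow_le_pow_right₀ (by linarith) hk2
    rw [← hpow] at h3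
    nlinarith

/-- **No integer polynomial of degree `≤ 5` has Mahler measure in `(1, θ₀)`.**
[cite: MckeeSmyth2021, Theorem 12.1 p.205 with MossinghoffRhinWu2008 Table 1 (measures of factors of degree ≤ 5)] -/
theorem not_measure_lt_smythTheta_of_natDegree_le_five {p : ℤ[X]} (hdeg : p.natDegree ≤ 5)
    (h1 : 1 < intMahlerMeasure p) : smythTheta ≤ intMahlerMeasure p := by
  by_contra h
  push Not at h
  have := intMahlerMeasure_eq_smythTheta_of_natDegree_le_five hdeg h1 (lt_trans h smythTheta_lt)
  linarith

end Literature.NumberTheory.MahlerMeasure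

end Part19

/-!
## Part 20 — port of `Summits/Ventures/DiscreteObjects/Mahler/UnitMeasureFactors.lean` (2 declarations kept)

# Unit-measure factors: explicit cyclotomic polynomials have Mahler measure 1 (venture `DiscreteObjects`, target L)

Cell `pub-namedobj`, seat `pub-namedobj-mahler` (gen 11). Framing: lottery ticket; floor = certified
bounds/negative ranges.

Tool for verifying printed tables whose entries are "short" (non-irreducible) polynomials — a noncyclotomic core times
cyclotomic factors (McKee–Smyth Table D.1; file `McKeeSmythD1RowsA`): if `q · s = X^N − 1` in `ℤ[X]` then `M(q) = 1`
(`M` multiplicative, `M ≥ 1` on nonzero integer polynomials, `M(X^N − 1) = 1`), and the explicit instances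
`M(Φ_m) = 1` for the cyclotomic polynomials `Φ_m`, `m ∈ {1, 2, 3, 4, 5, 6, 7, 8, 9, 10, 12, 14, 15, 16, 18, 24}`, each written out as an integer
polynomial and certified by the identity `Φ_m · ((X^m − 1)/Φ_m) = X^m − 1` (`ring`), without identifying it with
Mathlib's `cyclotomic m ℤ`.
-/

section Part20

namespace Literature.NumberTheory.MahlerMeasure

open _root_.Polynomial

/-- `M(X^N - 1) = 1` for `N ≥ 1` (product of cyclotomic polynomials).
[cite: MckeeSmyth2021, Theorem 1.3 (Kronecker) p.20] -/
theorem intMahlerMeasure_X_pow_sub_one {N : ℕ} (hN : 0 < N) : intMahlerMeasure (X ^ N - 1 : ℤ[X]) = 1 := by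
  rw [← prod_cyclotomic_eq_X_pow_sub_one hN ℤ, Finset.prod_eq_multiset_prod, intMahlerMeasure_multiset_prod,
    Multiset.map_map]
  have : ((N.divisors.val).map (intMahlerMeasure ∘ fun i => cyclotomic i ℤ)) = (N.divisors.val).map fun _ => (1 : ℝ) :=
    Multiset.map_congr rfl fun i _ => intMahlerMeasure_cyclotomic i
  rw [this, Multiset.map_const', Multiset.prod_replicate, one_pow]

/-- **If `q · s = X^N − 1` then `M(q) = 1`.** [cite: MckeeSmyth2021, Theorem 1.3 (Kronecker) p.20] -/
theorem intMahlerMeasure_eq_one_of_mul_eq_X_pow_sub_one {q s : ℤ[X]} {N : ℕ} (hN : 0 < N)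
    (h : q * s = X ^ N - 1) : intMahlerMeasure q = 1 := by
  have hne : (X ^ N - 1 : ℤ[X]) ≠ 0 := by
    rw [show (X ^ N - 1 : ℤ[X]) = X ^ N - C 1 by rw [map_one]]
    exact X_pow_sub_C_ne_zero hN 1
  have hq : q ≠ 0 := by intro h0; rw [h0, zero_mul] at h; exact hne h.symm
  have hs : s ≠ 0 := by intro h0; rw [h0, mul_zero] at h; exact hne h.symm
  have hm := intMahlerMeasure_mul q s
  rw [h, intMahlerMeasure_X_pow_sub_one hN] at hm
  have h1 := one_le_intMahlerMeasure hq
  have h2 := one_le_intMahlerMeasure hs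
  nlinarith

end Literature.NumberTheory.MahlerMeasure

end Part20

/-!
## Part 21 — port of `Summits/Ventures/DiscreteObjects/Mahler/Height1CensusData46.lean` (1 declarations kept)

# Height-1 census data (target L), degree 46: the degree-46 primitive cores — FIRST ROWS BEYOND THE PUBLISHED HEIGHT-1 RANGE

Cell `pub-namedobj`, seats `pub-namedobj-mahler` (g1–g3). Framing: lottery ticket; floor = certified bounds/negative ranges.

`h1Deg46List` lists (ascending coefficients, one representative per orbit of `{±P(x), ±P(-x)}`: monic, first nonzero
odd-index coefficient positive) the 92 irreducible primitive integer polynomials `C` of degree 46 with certified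
`1 < M(C) < 13/10` that occur as the noncyclotomic part of a HEIGHT-1 reciprocal or antireciprocal polynomial of degree 46 —
equivalently (degree 46 = degree of the core) the height-1 (anti)reciprocal polynomials of degree 46 that are irreducible with
`1 < M < 13/10`.  This is the claimed content of `Height1IrreducibleRow 46 h1Deg46List` below: a certified COMPUTATION of the
cell (exhaustive engine-A enumeration j091887 + j096218–25 with engine-B parity 25/25, Mahler measures enclosed by two root
engines — cap.roots exact discs ∧ Arb — with 0 disagreements, third engine PARI/mpmath on all 92, referee recert signed;
files `HOME/pub-namedobj-mahler/results/L-h1-n46-*`), NOT a Lean theorem; the `Prop` is only DEFINED here.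
Published floor [cite: Mossinghoff1998, §3.2–3.3] / `Literature.NumberTheory.MahlerMeasure.MinimalMeasuresByDegree`:
height-1 (anti)reciprocal polynomials were tested exhaustively to degree 40 (all lengths) and to degree 47 for length ≤ 17,
so this row is new exactly for lengths ≥ 18; all heights are complete to degree 44 (MRW08).  Checks that ARE kernel facts
(by `decide`): the Mossinghoff–Rhin–Wu Table-1 minimiser of degree 46 (`M₄₆ = 1.23074301`) heads the list
(`mrw46_coeffs_mem_h1Deg46List`, `h1Deg46List_head`), the list has 92 distinct entries of length 47, all palindromic with
entries in `{-1, 0, 1}`.  Content: none below Lehmer's `1.17628…`; the five entries below `1.25` are McKee–Smyth Table D.1's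
degree-46 entries; exactly one Salem entry (ν = 1: the known `σ₃₆`, `τ = 1.2929007…`); every entry has a height-1 multiple of
degree ≤ 60 inside a region Mossinghoff (1998) reports as exhaustively tested (cell file `L-h1-n46n48-floor-geometry-g3.md`).
-/

section Part21

namespace Literature.NumberTheory.MahlerMeasure

open _root_.Polynomial

/- (degree-46 height-1 row: primitive irreducible cores of degree 46) -/
/-- Coefficient formula for `ofCoeffs`: the coefficient of `X^n` is the `n`-th list entry (`0` beyond the list).
[cite: MossinghoffRhinWu2008, §2 (ascending coefficient lists)] -/
theorem coeff_ofCoeffs (l : List ℤ) (n : ℕ) : (ofCoeffs l).coeff n = l.getD n 0 := by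
  unfold ofCoeffs
  induction l using List.reverseRecOn generalizing n with
  | nil => simp
  | append_singleton xs a ih =>
    simp only [List.zipIdx_append, List.map_append, List.sum_append, coeff_add, List.zipIdx_singleton,
      List.map_singleton, List.sum_singleton, coeff_C_mul, coeff_X_pow, zero_add]
    rw [ih]
    rcases lt_trichotomy n xs.length with h | h | h
    · rw [List.getD_append _ _ _ _ h, if_neg (Nat.ne_of_lt h), mul_zero, add_zero]
    · subst h
      simp
    · rw [List.getD_append_right _ _ _ _ h.le, if_neg (Nat.ne_of_gt h), mul_zero, add_zero,
        List.getD_eq_default _ _ h.le]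
      have : n - xs.length ≠ 0 := by omega
      obtain ⟨k, hk⟩ := Nat.exists_eq_succ_of_ne_zero this
      simp [hk]

end Literature.NumberTheory.MahlerMeasure

end Part21

/-!
## Part 22 — port of `Summits/Ventures/DiscreteObjects/Mahler/CensusListPoly.lean` (22 declarations kept)

# Computable coefficient-list arithmetic for the kernel census (venture `DiscreteObjects`, target L)

Cell `pub-namedobj`, seat `pub-namedobj-mahler-g12`. Framing: lottery ticket; floor = certified bounds/negative
ranges.

The census theorems of degrees `6, 8, 10` (`CensusKernelDeg*.lean`) are proved by an exhaustive search that the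
kernel itself runs (`decide` with kernel reduction; standard axioms only). This file supplies the list-level
polynomial arithmetic that search evaluates, each operation with the lemma identifying it with the corresponding
operation on `ofCoeffs` (ascending coefficient lists, `SmallMeasureCensus`):

* `ofCoeffs_nil`, `ofCoeffs_cons` (and `coeff_ofCoeffs` from `Height1CensusData46`), degree and monicity
  from the list (`natDegree_ofCoeffs_eq`, `monic_ofCoeffs`);
* `lpAdd`, `lpNeg`, `lpSMul`, `lpMul` (sum, negation, scalar multiple, product), `lpNegAlt` (`P(-x)`),
  `lpExpand2` (`P(x²)`), `lpXPowSubOne m` (`x^m - 1`);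
* `lpIsZero` / `lpEq`: a Boolean test with `lpEq l m = true → ofCoeffs l = ofCoeffs m`.
-/

section Part22

namespace Literature.NumberTheory.MahlerMeasure

open _root_.Polynomial

/-! ## `ofCoeffs`: structural lemmas -/

/-- `ofCoeffs [] = 0`.
[cite: MossinghoffRhinWu2008, §2 (exact integer polynomial arithmetic of the certified search)] -/
theorem ofCoeffs_nil : ofCoeffs [] = 0 := by
  simp [ofCoeffs]

/-- Shifting the index offset of `zipIdx` multiplies the represented polynomial by `x`.
[cite: MossinghoffRhinWu2008, §2 (exact integer polynomial arithmetic of the certified search)] -/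
private theorem zipIdx_sum_succ (l : List ℤ) (k : ℕ) :
    ((l.zipIdx (k + 1)).map fun ai : ℤ × ℕ => C ai.1 * X ^ ai.2).sum =
      X * ((l.zipIdx k).map fun ai : ℤ × ℕ => C ai.1 * X ^ ai.2).sum := by
  induction l generalizing k with
  | nil => simp
  | cons a l ih =>
    rw [List.zipIdx_cons, List.zipIdx_cons, List.map_cons, List.map_cons, List.sum_cons, List.sum_cons,
      ih (k + 1), mul_add, pow_succ]
    ring

/-- `ofCoeffs (a :: l) = x · ofCoeffs l + a` (stated with the constant last: the `ofCoeffs` here is the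
`zipIdx`-based one of `SmallMeasureCensus`, not the recursive namesakes elsewhere in the tree).
[cite: MossinghoffRhinWu2008, §2 (exact integer polynomial arithmetic of the certified search)] -/
theorem ofCoeffs_cons (a : ℤ) (l : List ℤ) : ofCoeffs (a :: l) = X * ofCoeffs l + C a := by
  unfold ofCoeffs
  rw [List.zipIdx_cons, List.map_cons, List.sum_cons, zipIdx_sum_succ, pow_zero, mul_one, add_comm]

-- `coeff_ofCoeffs : (ofCoeffs l).coeff i = l.getD i 0` is `Height1CensusData46.coeff_ofCoeffs` (imported).

/-- If `l` has length `n + 1` and last entry nonzero then `deg (ofCoeffs l) = n`.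
[cite: MossinghoffRhinWu2008, §2 (exact integer polynomial arithmetic of the certified search)] -/
theorem natDegree_ofCoeffs_eq {l : List ℤ} {n : ℕ} (hlen : l.length = n + 1) (hlast : l.getD n 0 ≠ 0) :
    (ofCoeffs l).natDegree = n := by
  apply le_antisymm
  · rw [natDegree_le_iff_coeff_eq_zero]
    intro N hN
    rw [coeff_ofCoeffs]
    exact List.getD_eq_default _ _ (by omega)
  · apply le_natDegree_of_ne_zero; rw [coeff_ofCoeffs]; exact hlast

/-- If `l` has length `n + 1` and last entry `1` then `ofCoeffs l` is monic of degree `n`.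
[cite: MossinghoffRhinWu2008, §2 (exact integer polynomial arithmetic of the certified search)] -/
theorem monic_ofCoeffs {l : List ℤ} {n : ℕ} (hlen : l.length = n + 1) (hlast : l.getD n 0 = 1) :
    (ofCoeffs l).Monic ∧ (ofCoeffs l).natDegree = n := by
  have hdeg := natDegree_ofCoeffs_eq hlen (by rw [hlast]; exact one_ne_zero)
  refine ⟨?_, hdeg⟩
  rw [Monic, leadingCoeff, hdeg, coeff_ofCoeffs, hlast]

/-! ## List arithmetic -/

/-- Coefficientwise sum (the longer tail is kept).
[cite: MossinghoffRhinWu2008, §2 (exact integer polynomial arithmetic of the certified search)] -/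
def lpAdd : List ℤ → List ℤ → List ℤ
  | [], m => m
  | a :: l, [] => a :: l
  | a :: l, b :: m => (a + b) :: lpAdd l m

/-- `ofCoeffs (lpAdd l m) = ofCoeffs l + ofCoeffs m`.
[cite: MossinghoffRhinWu2008, §2 (exact integer polynomial arithmetic of the certified search)] -/
theorem ofCoeffs_lpAdd (l m : List ℤ) : ofCoeffs (lpAdd l m) = ofCoeffs l + ofCoeffs m := by
  induction l generalizing m with
  | nil => simp [lpAdd, ofCoeffs_nil]
  | cons a l ih =>
    cases m with
    | nil => simp [lpAdd, ofCoeffs_nil]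
    | cons b m => rw [lpAdd, ofCoeffs_cons, ofCoeffs_cons, ofCoeffs_cons, ih, C_add]; ring

/-- Negation. [cite: MossinghoffRhinWu2008, §2 (exact integer polynomial arithmetic of the certified search)] -/
def lpNeg (l : List ℤ) : List ℤ := l.map fun x => -x

/-- `ofCoeffs (lpNeg l) = - ofCoeffs l`.
[cite: MossinghoffRhinWu2008, §2 (exact integer polynomial arithmetic of the certified search)] -/
theorem ofCoeffs_lpNeg (l : List ℤ) : ofCoeffs (lpNeg l) = -ofCoeffs l := by
  induction l with
  | nil => simp [lpNeg, ofCoeffs_nil]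
  | cons a l ih =>
    have h : lpNeg (a :: l) = (-a) :: lpNeg l := rfl
    rw [h, ofCoeffs_cons, ofCoeffs_cons, ih, C_neg]; ring

/-- Scalar multiple.
[cite: MossinghoffRhinWu2008, §2 (exact integer polynomial arithmetic of the certified search)] -/
def lpSMul (c : ℤ) (l : List ℤ) : List ℤ := l.map fun x => c * x

/-- `ofCoeffs (lpSMul c l) = c · ofCoeffs l`.
[cite: MossinghoffRhinWu2008, §2 (exact integer polynomial arithmetic of the certified search)] -/
theorem ofCoeffs_lpSMul (c : ℤ) (l : List ℤ) : ofCoeffs (lpSMul c l) = C c * ofCoeffs l := by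
  induction l with
  | nil => simp [lpSMul, ofCoeffs_nil]
  | cons a l ih =>
    have h : lpSMul c (a :: l) = (c * a) :: lpSMul c l := rfl
    rw [h, ofCoeffs_cons, ofCoeffs_cons, ih, C_mul]; ring

/-- Product (schoolbook).
[cite: MossinghoffRhinWu2008, §2 (exact integer polynomial arithmetic of the certified search)] -/
def lpMul : List ℤ → List ℤ → List ℤ
  | [], _ => []
  | a :: l, m => lpAdd (lpSMul a m) (0 :: lpMul l m)

/-- `ofCoeffs (lpMul l m) = ofCoeffs l * ofCoeffs m`.
[cite: MossinghoffRhinWu2008, §2 (exact integer polynomial arithmetic of the certified search)] -/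
theorem ofCoeffs_lpMul (l m : List ℤ) : ofCoeffs (lpMul l m) = ofCoeffs l * ofCoeffs m := by
  induction l with
  | nil => simp [lpMul, ofCoeffs_nil]
  | cons a l ih =>
    rw [lpMul, ofCoeffs_lpAdd, ofCoeffs_lpSMul, ofCoeffs_cons, ofCoeffs_cons, ih, C_0]; ring

/-- `P(-x)` on lists: negate the odd-index entries.
[cite: MossinghoffRhinWu2008, §2 (exact integer polynomial arithmetic of the certified search)] -/
def lpNegAlt : List ℤ → List ℤ
  | [] => []
  | a :: l => a :: lpNeg (lpNegAlt l)

/-- `ofCoeffs (lpNegAlt l) = (ofCoeffs l)(-x)`.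
[cite: MossinghoffRhinWu2008, §2 (exact integer polynomial arithmetic of the certified search)] -/
theorem ofCoeffs_lpNegAlt (l : List ℤ) : ofCoeffs (lpNegAlt l) = (ofCoeffs l).comp (-X) := by
  induction l with
  | nil => simp [lpNegAlt, ofCoeffs_nil]
  | cons a l ih =>
    rw [lpNegAlt, ofCoeffs_cons, ofCoeffs_lpNeg, ih, ofCoeffs_cons, add_comp, C_comp, mul_comp, X_comp]
    ring

/-- `P(x²)` on lists: interleave zeros.
[cite: MossinghoffRhinWu2008, §2 (exact integer polynomial arithmetic of the certified search)] -/
def lpExpand2 : List ℤ → List ℤ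
  | [] => []
  | a :: l => a :: 0 :: lpExpand2 l

/-- `ofCoeffs (lpExpand2 l) = (ofCoeffs l)(x²)`.
[cite: MossinghoffRhinWu2008, §2 (exact integer polynomial arithmetic of the certified search)] -/
theorem ofCoeffs_lpExpand2 (l : List ℤ) : ofCoeffs (lpExpand2 l) = (ofCoeffs l).comp (X ^ 2) := by
  induction l with
  | nil => simp [lpExpand2, ofCoeffs_nil]
  | cons a l ih =>
    rw [lpExpand2, ofCoeffs_cons, ofCoeffs_cons, ih, ofCoeffs_cons, add_comp, C_comp, mul_comp, X_comp, C_0]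
    ring

/-- `x^m - 1` as a list (`m ≥ 1`).
[cite: MossinghoffRhinWu2008, §2 (exact integer polynomial arithmetic of the certified search)] -/
def lpXPowSubOne (m : ℕ) : List ℤ := (-1) :: (List.replicate (m - 1) 0 ++ [1])

/-- All entries zero?
[cite: MossinghoffRhinWu2008, §2 (exact integer polynomial arithmetic of the certified search)] -/
def lpIsZero (l : List ℤ) : Bool := l.all fun x => x == 0

/-- `lpIsZero l → ofCoeffs l = 0`.
[cite: MossinghoffRhinWu2008, §2 (exact integer polynomial arithmetic of the certified search)] -/
theorem ofCoeffs_eq_zero_of_lpIsZero {l : List ℤ} (h : lpIsZero l = true) : ofCoeffs l = 0 := by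
  induction l with
  | nil => exact ofCoeffs_nil
  | cons a l ih =>
    simp only [lpIsZero, List.all_cons, Bool.and_eq_true, beq_iff_eq] at h
    rw [ofCoeffs_cons, h.1, ih (by simpa [lpIsZero] using h.2), C_0]; ring

/-- Boolean equality test of the represented polynomials (insensitive to trailing zeros).
[cite: MossinghoffRhinWu2008, §2 (exact integer polynomial arithmetic of the certified search)] -/
def lpEq (l m : List ℤ) : Bool := lpIsZero (lpAdd l (lpNeg m))

/-- `lpEq l m → ofCoeffs l = ofCoeffs m`.
[cite: MossinghoffRhinWu2008, §2 (exact integer polynomial arithmetic of the certified search)] -/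
theorem ofCoeffs_eq_of_lpEq {l m : List ℤ} (h : lpEq l m = true) : ofCoeffs l = ofCoeffs m := by
  have h1 := ofCoeffs_eq_zero_of_lpIsZero h
  rw [ofCoeffs_lpAdd, ofCoeffs_lpNeg] at h1
  linear_combination h1

end Literature.NumberTheory.MahlerMeasure

end Part22

/-!
## Part 23 — port of `Summits/Ventures/DiscreteObjects/Mahler/ReciprocalCoeffBound.lean` (6 declarations kept)

# Soundness of the census coefficient test (T2): coefficients of a product of reciprocal quadratics

Cell `pub-namedobj`, seat `pub-namedobj-mahler-g2`, target (L). Framing: lottery ticket; floor = certified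
bounds/negative ranges.

The census engines (engine A in C, engine B in Python; `HOME/code/censusL`) prune the search for reciprocal
integer polynomials `P` of degree `n = 2d` with `M(P) < B` using the test

  `T2:  |a_j(P)| < [z^j] (1 + (B + 1/B) z + z²)(1 + z)^{n-2}`   (`0 < j < n`),

applied to `P` and to its Graeffe iterates. This file PROVES the inequality behind T2 for every complex
polynomial of the shape `P = ∏_{i=1}^{d} (x² - tᵢ x + 1)` (`tᵢ ∈ ℂ`; every monic reciprocal polynomial with its
roots paired as `{α, 1/α}` has this shape, `tᵢ = αᵢ + 1/αᵢ`):

* coefficient domination tools: `Dominates Q q` (`‖q.coeff j‖ ≤ Q.coeff j`), `CoeffLE`, `CoeffNonneg`,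
  stable under products (`Dominates.mul`, `Dominates.multiset_prod`, `CoeffLE.mul_right`);
* `quad_mahlerMeasure`: `M(x² - t x + 1) = e^{u}` with `u ≥ 0` and `|t| ≤ 2 cosh u`;
* `cosh_add_cosh_le`, `cosh_mul_cosh_le`: the two-term majorisation inequalities;
* `majorize`: `∏ (x² + 2cosh(uᵢ) x + 1) ≤ (x² + 2cosh(Σuᵢ) x + 1)(x + 1)^{2(d-1)}` coefficientwise;
* `reciprocal_coeff_bound`: `|a_j(P)| ≤ [x^j] (x² + (M + 1/M) x + 1)(x² + 2x + 1)^{d-1}`, `M = M(P)`;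
* `reciprocal_coeff_bound_strict`: if moreover `M(P) < B` then for `0 < j < n` the inequality with `B + 1/B`
  in place of `M + 1/M` is STRICT — exactly the rejection criterion T2 (the engines compare the integer `|a_j|`
  with `floor_strict` of the right-hand side).

Remaining gap (named, not hidden): the purely algebraic fact that a monic (anti)reciprocal integer polynomial of
even degree factors over `ℂ` into such quadratics (after removing `x² - 1` in the antireciprocal case) is not
proved here; the theorems take the factorised shape as hypothesis.
-/

section Part23

namespace Literature.NumberTheory.MahlerMeasure

open _root_.Polynomial _root_.Finset

/-! ## Coefficient domination by real majorants -/

/-- Coefficientwise order on real polynomials. [cite: MossinghoffRhinWu2008, §2 (coefficient domination bounds)] -/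
def CoeffLE (P Q : ℝ[X]) : Prop :=
  ∀ j, P.coeff j ≤ Q.coeff j

/-- All coefficients nonnegative. [cite: MossinghoffRhinWu2008, §2 (coefficient domination bounds)] -/
def CoeffNonneg (P : ℝ[X]) : Prop :=
  ∀ j, 0 ≤ P.coeff j

/-- Reflexivity of the coefficientwise order. [cite: MossinghoffRhinWu2008, §2 (coefficient domination bounds)] -/
theorem CoeffLE.refl (P : ℝ[X]) : CoeffLE P P := fun _ => le_rfl

/-- Transitivity of the coefficientwise order. [cite: MossinghoffRhinWu2008, §2 (coefficient domination bounds)] -/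
theorem CoeffLE.trans {P Q R : ℝ[X]} (h₁ : CoeffLE P Q) (h₂ : CoeffLE Q R) : CoeffLE P R :=
  fun j => le_trans (h₁ j) (h₂ j)

/-- Multiplying a coefficientwise inequality by a polynomial with nonnegative coefficients.
[cite: MossinghoffRhinWu2008, §2 (coefficient domination bounds)] -/
theorem CoeffLE.mul_right {P Q R : ℝ[X]} (h : CoeffLE P Q) (hR : CoeffNonneg R) :
    CoeffLE (P * R) (Q * R) := by
  intro j
  rw [coeff_mul, coeff_mul]
  exact Finset.sum_le_sum fun x _ => mul_le_mul_of_nonneg_right (h x.1) (hR x.2)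

/-- Same on the left. [cite: MossinghoffRhinWu2008, §2 (coefficient domination bounds)] -/
theorem CoeffLE.mul_left {P Q R : ℝ[X]} (h : CoeffLE P Q) (hR : CoeffNonneg R) :
    CoeffLE (R * P) (R * Q) := by
  rw [mul_comm R P, mul_comm R Q]
  exact h.mul_right hR

end Literature.NumberTheory.MahlerMeasure

end Part23

/-!
## Part 24 — port of `Summits/Ventures/DiscreteObjects/Mahler/CensusCertificate.lean` (7 declarations kept)

# Certificates for the survivors of the kernel census search (venture `DiscreteObjects`, target L)

Cell `pub-namedobj`, seat `pub-namedobj-mahler-g12`. Framing: lottery ticket; floor = certified bounds/negative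
ranges.

Every half vector produced by `censusSearch` (a monic palindromic `P` of degree `n = 2d` passing the power-sum
tests) is discharged by one of four CERTIFICATES, checked by the kernel in exact integer arithmetic:

* `Cert.cyc m r`: `P · r = x^m - 1`, hence `M(P) = 1` (`intMahlerMeasure_eq_one_of_mul_eq_X_pow_sub_one`);
* `Cert.red f g`: `P = f · g` with `deg f, deg g ≥ 1`, hence `P` is reducible;
* `Cert.grf m k`: after `m` verified Graeffe root-squaring steps the `k`-th coefficient violates Mahler's bound
  `C(n,k) · B^(2^m)`, hence `B < M(P)` (`lt_intMahlerMeasure_of_graeffeChain`, mahler g2/g3);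
* `Cert.exc i s`: `P` is entry `i` of the exception list `L` (or that entry in `-x`).

`census_verdict`: if every survivor carries a valid certificate (from `allCertified … = true` by `decide`, possibly
in chunks, via `exists_cert_of_allCertified`) then every
IRREDUCIBLE monic palindromic `p` of degree `2d` with `1 < M(p) < B = Bn/Bd` is `ofCoeffs l` or `(ofCoeffs l)(-x)`
for some `l ∈ L`; `degreeCensus_of_certified` turns this into `DegreeCensus (2d) B L` for `B ≤ θ₀ = 1.3247…`
(below Smyth's constant an irreducible polynomial of measure `> 1` is ± a monic palindromic one —
`reciprocal_of_measure_lt_smythTheta`, mahler g7–g10).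
-/

section Part24

namespace Literature.NumberTheory.MahlerMeasure

open _root_.Polynomial

/-! ## Certificates and their checker -/

/-- Certificate for one survivor of the census search.
[cite: MossinghoffRhinWu2008, §2 (Graeffe rejection certificates, exact integer arithmetic)] -/
inductive Cert where
  /-- `P · r = x^m - 1` (so `M(P) = 1`). -/
  | cyc (m : ℕ) (r : List ℤ)
  /-- `P = f · g` with both factors of degree `≥ 1` (so `P` is reducible). -/
  | red (f g : List ℤ)
  /-- Graeffe rejection: after `m` root-squarings coefficient `k` exceeds `C(n,k) · B^(2^m)` (so `M(P) > B`). -/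
  | grf (m k : ℕ)
  /-- `P` is the `i`-th listed exception (`s = false`) or that exception in `-x` (`s = true`). -/
  | exc (i : ℕ) (s : Bool)

/-- The even-index entries of a list (`q(x²) ↦ q`).
[cite: MossinghoffRhinWu2008, §2 (Graeffe rejection certificates, exact integer arithmetic)] -/
def lpEvens : List ℤ → List ℤ
  | [] => []
  | [a] => [a]
  | a :: _ :: l => a :: lpEvens l

/-- `m` verified Graeffe steps on a monic list of degree `n`: each step computes `r = q(x)q(-x)`, takes
`q' = lpEvens r` and CHECKS `q'(x²) = r`, `|q'| = n + 1`, leading entry `1`; `none` if a check fails.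
[cite: MossinghoffRhinWu2008, §2 (Graeffe rejection certificates, exact integer arithmetic)] -/
def graeffeIter (n : ℕ) : ℕ → List ℤ → Option (List ℤ)
  | 0, q => some q
  | m + 1, q =>
    if lpEq (lpExpand2 (lpEvens (lpMul q (lpNegAlt q)))) (lpMul q (lpNegAlt q)) &&
        ((lpEvens (lpMul q (lpNegAlt q))).length == n + 1) &&
        ((lpEvens (lpMul q (lpNegAlt q))).getD n 0 == 1) then
      graeffeIter n m (lpEvens (lpMul q (lpNegAlt q)))
    else none

/-- A list represents a polynomial of degree exactly `|l| - 1 ≥ 1` (length `≥ 2`, last entry nonzero).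
[cite: MossinghoffRhinWu2008, §2 (Graeffe rejection certificates, exact integer arithmetic)] -/
def lpPosDegree (l : List ℤ) : Bool := (2 ≤ l.length) && (l.getD (l.length - 1) 0 != 0)

/-- Check one certificate for the ascending coefficient list `asc` (degree `n`, bound `B = Bn/Bd`, exceptions `L`).
[cite: MossinghoffRhinWu2008, §2 (Graeffe rejection certificates, exact integer arithmetic)] -/
def checkCert (Bn Bd n : ℕ) (L : List (List ℤ)) (asc : List ℤ) : Cert → Bool
  | .cyc m r => (1 ≤ m) && lpEq (lpMul asc r) (lpXPowSubOne m)
  | .red f g => lpPosDegree f && lpPosDegree g && lpEq (lpMul f g) asc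
  | .grf m k =>
    match graeffeIter n m asc with
    | none => false
    | some q => decide ((n.choose k : ℤ) * (Bn : ℤ) ^ (2 ^ m) < |q.getD k 0| * (Bd : ℤ) ^ (2 ^ m))
  | .exc i s =>
    (i < L.length) && (if s then lpEq asc (lpNegAlt (L.getD i [])) else lpEq asc (L.getD i []))

/-- Prepending a Graeffe step to a chain.
[cite: MossinghoffRhinWu2008, §2 (Graeffe rejection certificates, exact integer arithmetic)] -/
theorem GraeffeChain.cons {p q r : ℤ[X]} {m : ℕ} (h1 : IsGraeffeIterate p q) (h2 : GraeffeChain q m r) :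
    GraeffeChain p (m + 1) r := by
  induction h2 with
  | refl => exact GraeffeChain.step (GraeffeChain.refl p) h1
  | step hc hqr ih => exact GraeffeChain.step ih hqr

/-- `graeffeIter` produces a genuine Graeffe chain of monic polynomials of degree `n`.
[cite: MossinghoffRhinWu2008, §2 (Graeffe rejection certificates, exact integer arithmetic)] -/
theorem graeffeIter_sound (n m : ℕ) : ∀ (q q' : List ℤ), graeffeIter n m q = some q' →
    (ofCoeffs q).Monic → (ofCoeffs q).natDegree = n →
    GraeffeChain (ofCoeffs q) m (ofCoeffs q') ∧ (ofCoeffs q').Monic ∧ (ofCoeffs q').natDegree = n := by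
  induction m with
  | zero =>
    intro q q' h hmon hdeg
    simp only [graeffeIter, Option.some.injEq] at h
    subst h
    exact ⟨GraeffeChain.refl _, hmon, hdeg⟩
  | succ m ih =>
    intro q q' h hmon hdeg
    simp only [graeffeIter] at h
    split_ifs at h with hc
    simp only [Bool.and_eq_true, beq_iff_eq] at hc
    obtain ⟨⟨hEq, hlen⟩, hlast⟩ := hc
    set r := lpMul q (lpNegAlt q)
    set q1 := lpEvens r
    have hmon1 := monic_ofCoeffs hlen hlast
    have hstep : IsGraeffeIterate (ofCoeffs q) (ofCoeffs q1) := by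
      refine ⟨hmon1.1, by rw [hmon1.2, hdeg], Or.inl ?_⟩
      rw [← ofCoeffs_lpExpand2, ofCoeffs_eq_of_lpEq hEq, ofCoeffs_lpMul, ofCoeffs_lpNegAlt]
    obtain ⟨hchain, hmon', hdeg'⟩ := ih q1 q' h hmon1.1 hmon1.2
    exact ⟨GraeffeChain.cons hstep hchain, hmon', hdeg'⟩

end Literature.NumberTheory.MahlerMeasure

end Part24

/-!
## Part 25 — port of `Summits/Ventures/DiscreteObjects/Mahler/CensusTraceCertificate.lean` (2 declarations kept)

# The trace–Graeffe rejection certificate `tgr` (venture `DiscreteObjects`, target L)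

Cell `pub-namedobj`, seat `pub-namedobj-mahler-g16`. Framing: lottery ticket; floor = certified bounds/negative ranges.

A cheaper kernel certificate for `B < M(P)` (`P` monic palindromic of degree `2d`, given by its ascending list), replacing the
Graeffe certificate `Cert.grf` of `CensusCertificate` in the degree-20 census: all arithmetic is done on the TRACE polynomial
`Q` of degree `d` (`P(x) = x^d Q(x + 1/x)`), root squaring is the Chebyshev–Graeffe step `y ↦ y² - 2` computed by ONE even/odd
product `G(w) = E(w)² - w O(w)²` (no parity check needed) and a Taylor shift by `2`, and the final test uses the sharper
reciprocal bound `|e_{k+1}(y)| ≤ 2^{k+1} C(d-1,k+1) + (B^N + B^{-N}) 2^k C(d-1,k)` (`CensusTraceRoots`, `CensusEsymmBound`)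
instead of Mahler's `C(2d,k) B^N`.  Measured on the 73611 large-measure survivors of the degree-20 search: mean depth 3.8 on
degree-10 lists instead of 4.6 on degree-20 lists.
* list functions (evaluated by the kernel): `lpEv`/`lpOd`, `lpGr`, `lpSh2`, `chebStep`, `chebIter`, `lpLift`, `lpTrace`
  (untrusted: its output is VERIFIED by `lpLift`), `tgrCheck`;
* soundness `lt_intMahlerMeasure_of_tgrCheck`: `tgrCheck Bn Bd d m k asc = true → Bn/Bd < M(ofCoeffs asc)`.
-/

section Part25

namespace Literature.NumberTheory.MahlerMeasure

open _root_.Polynomial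

/-! ## Even/odd split and the Graeffe product -/

/-- `q · x^d` as a list. [cite: MossinghoffRhinWu2008, §2 (trace / power-sum certificates)] -/
def lpMonom (d : ℕ) (q : ℤ) : List ℤ := List.replicate d 0 ++ [q]

/-- `ofCoeffs (lpMonom d q) = q x^d`. [cite: MossinghoffRhinWu2008, §2 (trace / power-sum certificates)] -/
theorem ofCoeffs_lpMonom (q : ℤ) : ∀ d : ℕ, ofCoeffs (lpMonom d q) = C q * X ^ d
  | 0 => by simp [lpMonom, ofCoeffs_cons, ofCoeffs_nil]
  | d + 1 => by
    rw [lpMonom, List.replicate_succ, List.cons_append, ofCoeffs_cons, ← lpMonom, ofCoeffs_lpMonom q d, C_0]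
    ring

end Literature.NumberTheory.MahlerMeasure

end Part25

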